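import Mathlib.Analysis.Calculus.Deriv.Star
import Mathlib.Analysis.Distribution.SchwartzSpace.Fourier
import Mathlib.Analysis.Fourier.Inversion
import Mathlib.Analysis.Fourier.FourierTransformDeriv
import Mathlib.MeasureTheory.Integral.Prod
import Mathlib.MeasureTheory.Integral.Bochner.ContinuousLinearMap
import Mathlib.MeasureTheory.Group.Integral
import Mathlib.MeasureTheory.Group.Prod
import Mathlib.MeasureTheory.Integral.IntegralEqImproper
import Mathlib.Analysis.SpecialFunctions.SmoothTransition
import Mathlib.Analysis.SpecialFunctions.Sqrt
import Mathlib.Analysis.SpecialFunctions.ImproperIntegrals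
import Mathlib.Analysis.Complex.CauchyIntegral
import Mathlib.Analysis.Calculus.ParametricIntegral
import Literature.Analysis.FunctionSpaces.KMSStatesProofs
import Literature.MathematicalPhysics.QuantumLattice.CStarStateProofs
import HarnessLib

/-!
# Ground states of a C⋆-dynamical system: generator form versus analytic form (proofs)

This file proves, as the theorem `Literature.MathematicalPhysics.QuantumLattice.State.isGroundState_iff_isKMSGroundState'`,
Bratteli–Robinson II Prop. 5.3.19 — the statement of the named fact
`Literature.MathematicalPhysics.QuantumLattice.State.isGroundState_iff_isKMSGroundState`
(`Literature/Analysis/FunctionSpaces/KMSStates.lean`) under the additional instance hypothesis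
`[StarOrderedRing A]` — i.e. for genuine states of a unital C⋆-algebra `A` (with
`[StarOrderedRing A]` the type `State A` consists of the positive normalised functionals) and a
strongly continuous one-parameter group `τ` of ⋆-automorphisms (`Literature.IsAutomorphismGroup τ`):

* `Literature.MathematicalPhysics.QuantumLattice.State.IsGroundState.isKMSGroundState` (generator form ⇒ analytic form): if
  `-i ω(a⋆ δ(a)) ≥ 0` for all `a` in the domain of the generator `δ` (`State.IsGroundState`, BR II
  Def. 5.3.18), then for all `a b` the function `t ↦ ω(a τ_t(b))` has a bounded continuous
  extension to `Im z ≥ 0`, analytic in `Im z > 0` (`State.IsKMSGroundState`);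
* `Literature.MathematicalPhysics.QuantumLattice.State.IsKMSGroundState.isGroundState` (analytic form ⇒ generator form);
* `Literature.MathematicalPhysics.QuantumLattice.State.isGroundState_iff_isKMSGroundState'` (the equivalence);
* `section CorrectedFact`: the corrected named fact
  `Literature.MathematicalPhysics.QuantumLattice.State.isGroundState_iff_isKMSGroundState_of_starOrderedRing` (the un-primed statement with
  the `[StarOrderedRing A]` binder added, same cite), its discharge
  `Literature.MathematicalPhysics.QuantumLattice.State.isGroundState_iff_isKMSGroundState_of_starOrderedRing_holds` (by the primed theorem)
  and the corrected form `Literature.MathematicalPhysics.QuantumLattice.State.kmsGroundStates_eq_setOf_isGroundState` of the companion fact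
  `Literature.Analysis.FunctionSpaces.kmsGroundStates_eq` (`kmsGroundStates τ = {ω | ω.IsGroundState τ}` for the C⋆-order).

(The un-primed named facts `State.isGroundState_iff_isKMSGroundState` and `kmsGroundStates_eq` of
`KMSStates.lean` quantify over an arbitrary `[PartialOrder A]` and are false in that generality,
see `Literature/Analysis/FunctionSpaces/KMSStatesCounterexample.lean`; they are deliberately not
given `_holds` theorems.)

## Method

The printed proofs (Bratteli–Robinson II Prop. 5.3.19; Sakai, *Operator algebras in dynamical
systems* (1991), Prop. 4.2.3 and Prop. 4.3.5) pass through the covariant GNS representation, Stone's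
theorem `U_ω(t) = e^{itH_ω}` and the spectral calculus of the unbounded self-adjoint operator
`H_ω ≥ 0` (`F(z) = (Ω, π(a) e^{izH_ω} π(b) Ω)`), none of which is available in Mathlib. We replace
them by the Arveson-type spectral analysis of the bounded continuous orbit functions
`φ(u) = ω(x τ_u(c))` (Bratteli–Robinson I §3.2.3) with *smeared elements*
`τ_k(c) = ∫ k(t) τ_t(c) dt` whose kernels `k = 𝓕θ` are Fourier transforms of Schwartz — mostly
compactly supported smooth — *symbols* `θ` of the spectral variable `p` (so that formally `τ_{𝓕θ}`
acts on `π(c)Ω` as `θ(H_ω / 2π)`):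

* the functional calculus is emulated by the *kernel calculus* `C_{𝓕θ₁,𝓕θ₂} = 𝓕(conj θ₁ · θ₂)`
  (`Literature.Analysis.FunctionSpaces.integral_conj_fourier_mul_fourier_add`) and the *correlation identity*
  `ω((τ_g a)⋆ τ_h b) = ∫ C_{g,h}(u) ω(a⋆ τ_u b) du` for `τ`-invariant `ω`
  (`Literature.MathematicalPhysics.QuantumLattice.State.apply_star_smear_mul_smear`), whence the *spectral pairing* `Λ_φ(η) = ∫ 𝓕η(u) φ(u) du`
  (`Literature.Analysis.FunctionSpaces.specPair`) satisfies `Λ_{c,c}(|σ|²) = ω(x⋆ x) ≥ 0`, `x = τ_{𝓕σ}(c)`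
  (`Literature.MathematicalPhysics.QuantumLattice.State.specPair_sq`);
* the generator acts on symbols as multiplication by `2πp`:
  `-i ω((τ_{𝓕σ} a)⋆ τ_{𝓕σ}(δa)) = 2π Λ_{a,a}(p |σ|²)` (`Literature.MathematicalPhysics.QuantumLattice.State.generator_specPair`, an
  integration by parts);
* spectral inequalities are proved by writing differences of symbols as squares of smooth symbols
  plus symbols supported in `(-∞, -ε]` (`Literature.Analysis.FunctionSpaces.momConjMulSymb_decomp`,
  `Literature.Analysis.FunctionSpaces.momConjMulSymb_decomp_of_neg_support`, `Literature.Analysis.FunctionSpaces.conjMulSymb_modSymb_decomp`; the smooth step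
  `Literature.Analysis.FunctionSpaces.stepFun` removes the branch points of the square roots);
* symbols supported in `(-∞, -ε]` are killed (the *negative spectral part vanishes*) in both
  situations: for analytic ground states by the easy half of the Paley–Wiener theorem
  (`Literature.Analysis.FunctionSpaces.integral_fourier_mul_eq_zero_of_analytic`: contour shift with the Fourier–Laplace extension
  `Literature.Analysis.FunctionSpaces.extKernel` and the regularising factor `Literature.Analysis.FunctionSpaces.rho`), and for ground states in the generator
  form by generator positivity (`Literature.MathematicalPhysics.QuantumLattice.State.IsGroundState.specPair_eq_zero`);
* the analytic continuation `t ↦ z` of the dynamics on spectrally cut-off elements is the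
  *modulated symbol* `e_z θ = e^{2πipz} θ` (`Literature.Analysis.FunctionSpaces.modSymb`): `z ↦ ω(x τ_{𝓕(e_z θ)}(c))` is entire
  (`Literature.Analysis.FunctionSpaces.differentiable_integral_extKernel_mul`) and bounded by `e ‖x‖ ‖τ_{𝓕θ}(c)‖` on `Im z ≥ 0` for
  ground states (`Literature.MathematicalPhysics.QuantumLattice.State.IsGroundState.norm_apply_mul_smear_modSymb_le`);
* general elements are reached through the approximate identity `τ_{𝓕θ_n} → id`, `θ_n = χ(·/(n+1))`
  (`Literature.Analysis.FunctionSpaces.tendsto_smear_fourier`) and uniform limits on the closed upper half-plane.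

## Contents

* `section AnalyticInvariance`: analytic ground states are `τ`-invariant,
  `Literature.MathematicalPhysics.QuantumLattice.State.IsKMSGroundState.apply_dynamics` (`F_{1,b}` and the reflection of `F_{1,b⋆}` glue, by
  `ω(x⋆) = conj (ω x)` and Morera, to a bounded entire function, constant by Liouville).
* `section FourierKernels`: kernels `𝓕θ` of Schwartz symbols: integrability, `∫ 𝓕θ = θ(0)`, the
  kernel calculus, derivative `(𝓕θ)' = 𝓕(-2πi p θ)`, translation `𝓕θ(u - t) = 𝓕(e^{2πipt} θ)(u)`,
  scaling `𝓕(θ(·/c))(u) = c 𝓕θ(cu)`.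
* `section Smear`, `section StateSmear`, `section SmearDomain`: smeared elements `Literature.smear τ k a`,
  their norm bound, behaviour under `τ_s`, `star`, states, the correlation identity; `D(δ)` is
  stable under smearing (`Literature.Analysis.FunctionSpaces.hasDerivAt_aut_smear`), is dense
  (`Literature.MathematicalPhysics.QuantumLattice.IsAutomorphismGroup.exists_hasDerivAt_tendsto`), and `τ_{𝓕θ_n}` is an approximate identity
  (`Literature.Analysis.FunctionSpaces.tendsto_smear_fourier`).
* `section Symbols`: cut-off multiplication `Literature.Analysis.FunctionSpaces.cutMul`, the bump `Literature.Analysis.FunctionSpaces.bumpFun`/`Literature.Analysis.FunctionSpaces.bumpSymb`,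
  the smooth step `Literature.Analysis.FunctionSpaces.stepFun` and the square-root weights.
* `section PaleyWiener`: the Fourier–Laplace extension `Literature.Analysis.FunctionSpaces.extKernel`, the regulariser `Literature.Analysis.FunctionSpaces.rho`,
  and `Literature.Analysis.FunctionSpaces.integral_fourier_mul_eq_zero_of_analytic`.
* `section SpectralPairing`, `section Positivity`, `section Generator`: `Literature.Analysis.FunctionSpaces.specPair`, the squares
  `Literature.Analysis.FunctionSpaces.conjMulSymb`, positivity, and the generator identity.
* `section AnalyticImpliesGenerator`: `Literature.MathematicalPhysics.QuantumLattice.State.IsKMSGroundState.isGroundState`.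
* `section ExtKernelBounds`, `section ModulatedSymbols`: decay of `extKernel` (two integrations by
  parts), entire dependence on the modulation parameter, `Literature.Analysis.FunctionSpaces.modSymb` and the decomposition at
  height `Im z`.
* `section NegativeSpectrum`: `Literature.MathematicalPhysics.QuantumLattice.State.IsGroundState.specPair_eq_zero`.
* `section GeneratorImpliesAnalytic`: `Literature.MathematicalPhysics.QuantumLattice.State.IsGroundState.isKMSGroundState` and the
  equivalence `Literature.MathematicalPhysics.QuantumLattice.State.isGroundState_iff_isKMSGroundState'`.
* `section CorrectedFact`: `Literature.MathematicalPhysics.QuantumLattice.State.isGroundState_iff_isKMSGroundState_of_starOrderedRing`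
  (named fact), `…_holds`, `Literature.MathematicalPhysics.QuantumLattice.State.kmsGroundStates_eq_setOf_isGroundState`.

## Sources

* O. Bratteli, D. W. Robinson, *Operator Algebras and Quantum Statistical Mechanics I* (2nd ed.,
  Springer 1987), §2.5.3 (analytic elements, regularisation `τ_f`), §3.2.3 (spectral theory of
  automorphism groups), Lemma 2.3.10, Cor. 2.3.17.
* O. Bratteli, D. W. Robinson, *Operator Algebras and Quantum Statistical Mechanics II* (2nd ed.,
  Springer 1997), Def. 5.3.18, Prop. 5.3.19.
* S. Sakai, *Operator algebras in dynamical systems* (CUP 1991), Def. 4.2.1, Prop. 4.2.2, Prop.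
  4.2.3, Def. 4.3.1, Prop. 4.3.5.
-/

noncomputable section

open Real Complex Topology Filter Set MeasureTheory SchwartzMap
open scoped ComplexConjugate ComplexOrder FourierTransform

namespace Literature.Analysis.FunctionSpaces


section AnalyticInvariance

variable {A : Type*} [CStarAlgebra A] [PartialOrder A] [StarOrderedRing A]
  {τ : ℝ → (A ≃⋆ₐ[ℂ] A)}

/-- A state is Hermitian: `ω(x⋆) = conj (ω x)` (positivity; Bratteli–Robinson I
Lemma 2.3.10 (a)). [folklore] -/
theorem _root_.Literature.MathematicalPhysics.QuantumLattice.State.apply_star (ω : Literature.MathematicalPhysics.QuantumLattice.State A) (x : A) : ω (star x) = conj (ω x) :=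
  map_star ω x

/-- **Schwarz reflection of an analytic ground-state function.** If `F` is continuous on
`Im z ≥ 0`, analytic on `Im z > 0`, and `G` likewise, with conjugate boundary values
`G t = conj (F t)` on `ℝ`, then the glued function (`F` above the axis, `conj ∘ G ∘ conj` below)
is entire. Step in Bratteli–Robinson II Prop. 5.3.19. [folklore] -/
theorem differentiable_glueConj {F G : ℂ → ℂ} (hFc : ContinuousOn F {z | 0 ≤ z.im})
    (hFd : DifferentiableOn ℂ F {z | 0 < z.im}) (hGc : ContinuousOn G {z | 0 ≤ z.im})
    (hGd : DifferentiableOn ℂ G {z | 0 < z.im}) (hFG : ∀ t : ℝ, G t = conj (F t)) :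
    Differentiable ℂ (fun z : ℂ => if 0 ≤ z.im then F z else conj (G (conj z))) := by
  have hSo : IsOpen {z : ℂ | 0 < z.im} := isOpen_lt continuous_const Complex.continuous_im
  rw [← differentiableOn_univ]
  refine differentiableOn_of_continuousOn_of_differentiableOn_off_im_eq isOpen_univ 0 ?_ ?_
  · rw [continuousOn_univ]
    refine continuous_if ?_ ?_ ?_
    · intro a ha
      rw [frontier_setOf_le_im] at ha
      have hare : a = (a.re : ℂ) := by
        apply Complex.ext
        · simp
        · simpa using ha
      rw [hare, Complex.conj_ofReal, hFG, Complex.conj_conj]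
    · rw [(isClosed_le continuous_const Complex.continuous_im).closure_eq]
      exact hFc
    · have hcl : closure {a : ℂ | ¬0 ≤ a.im} = {a | a.im ≤ 0} := by
        simp_rw [not_le]
        exact closure_setOf_im_lt 0
      rw [hcl]
      refine (Complex.continuous_conj.comp_continuousOn (hGc.comp
        Complex.continuous_conj.continuousOn ?_))
      intro a ha
      simp only [mem_setOf_eq] at ha ⊢
      simpa using ha
  · rintro z ⟨-, hz0⟩
    have hz0' : z.im ≠ 0 := hz0
    rcases lt_or_gt_of_ne hz0' with hneg | hpos
    · have hev : (fun z : ℂ => if 0 ≤ z.im then F z else conj (G (conj z))) =ᶠ[𝓝 z]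
          fun w => conj (G (conj w)) := by
        filter_upwards [(isOpen_lt Complex.continuous_im continuous_const).mem_nhds hneg]
          with w hw
        rw [if_neg (not_le.mpr hw)]
      refine (hev.differentiableAt_iff.mpr ?_).differentiableWithinAt
      have hmem : conj z ∈ {z : ℂ | 0 < z.im} := by
        simp only [mem_setOf_eq, Complex.conj_im]
        linarith
      have h1 : DifferentiableAt ℂ G (conj z) := hGd.differentiableAt (hSo.mem_nhds hmem)
      have h2 := h1.conj_conj
      rw [Complex.conj_conj] at h2
      exact h2
    · have hev : (fun z : ℂ => if 0 ≤ z.im then F z else conj (G (conj z))) =ᶠ[𝓝 z] F := by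
        filter_upwards [(isOpen_lt continuous_const Complex.continuous_im).mem_nhds hpos]
          with w hw
        rw [if_pos (le_of_lt hw)]
      refine (hev.differentiableAt_iff.mpr ?_).differentiableWithinAt
      exact hFd.differentiableAt (hSo.mem_nhds hpos)

/-- **Liouville step.** Under the hypotheses of `differentiable_glueConj`, if moreover `F` and
`G` are bounded on `Im z ≥ 0`, then `F` is constant on the real axis. Step in
Bratteli–Robinson II Prop. 5.3.19. [folklore] -/
theorem apply_ofReal_eq_of_glueConj {F G : ℂ → ℂ} (hFc : ContinuousOn F {z | 0 ≤ z.im})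
    (hFd : DifferentiableOn ℂ F {z | 0 < z.im}) (hFb : ∃ C, ∀ z ∈ {z : ℂ | 0 ≤ z.im}, ‖F z‖ ≤ C)
    (hGc : ContinuousOn G {z | 0 ≤ z.im}) (hGd : DifferentiableOn ℂ G {z | 0 < z.im})
    (hGb : ∃ C, ∀ z ∈ {z : ℂ | 0 ≤ z.im}, ‖G z‖ ≤ C) (hFG : ∀ t : ℝ, G t = conj (F t)) (s : ℝ) :
    F s = F 0 := by
  obtain ⟨C₁, hC₁⟩ := hFb
  obtain ⟨C₂, hC₂⟩ := hGb
  set H : ℂ → ℂ := fun z => if 0 ≤ z.im then F z else conj (G (conj z)) with hH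
  have hHd : Differentiable ℂ H := differentiable_glueConj hFc hFd hGc hGd hFG
  have hHb : Bornology.IsBounded (range H) := by
    rw [Metric.isBounded_iff_subset_closedBall 0]
    refine ⟨max C₁ C₂, ?_⟩
    rintro _ ⟨z, rfl⟩
    rw [Metric.mem_closedBall, dist_zero_right]
    by_cases hz : 0 ≤ z.im
    · simp only [hH, if_pos hz]
      exact (hC₁ z hz).trans (le_max_left _ _)
    · simp only [hH, if_neg hz, Complex.norm_conj]
      refine (hC₂ _ ?_).trans (le_max_right _ _)
      simp only [mem_setOf_eq, Complex.conj_im]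
      linarith [not_le.mp hz]
  have hHreal : ∀ r : ℝ, H r = F r := fun r => by
    simp [hH]
  have hconst := hHd.apply_eq_apply_of_bounded hHb (s : ℂ) ((0 : ℝ) : ℂ)
  rw [hHreal, hHreal, ofReal_zero] at hconst
  exact hconst

/-- **Analytic ground states are invariant under the dynamics**: if `ω` is a ground state in the
analytic (`β = +∞` KMS) form for `τ` (`State.IsKMSGroundState`), then `ω (τ t a) = ω a`. First step
of Bratteli–Robinson II Prop. 5.3.19, analytic form ⇒ generator form (cf. Sakai (1991) Prop. 4.3.5,
`β = ∞`): `F_{1,a}` and the reflection of `F_{1,a⋆}` glue to a bounded entire function. Only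
`τ 0 = id` from `IsAutomorphismGroup τ` is used; positivity of `ω` enters through
`ω(x⋆) = conj (ω x)`. [cite: BratteliRobinsonII1997, Prop. 5.3.19] -/
theorem _root_.Literature.MathematicalPhysics.QuantumLattice.State.IsKMSGroundState.apply_dynamics (hτ : Literature.MathematicalPhysics.QuantumLattice.IsAutomorphismGroup τ) {ω : Literature.MathematicalPhysics.QuantumLattice.State A}
    (h : ω.IsKMSGroundState τ) (t : ℝ) (a : A) : ω (τ t a) = ω a := by
  obtain ⟨F, hFc, hFd, hFb, hF⟩ := h 1 a
  obtain ⟨G, hGc, hGd, hGb, hG⟩ := h 1 (star a)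
  simp only [one_mul] at hF hG
  have hFG : ∀ s : ℝ, G s = conj (F s) := fun s => by
    rw [hG, hF, ← Literature.MathematicalPhysics.QuantumLattice.State.apply_star, map_star]
  have hconst := apply_ofReal_eq_of_glueConj hFc hFd hFb hGc hGd hGb hFG t
  rw [hF, ← ofReal_zero, hF, hτ.1] at hconst
  simpa using hconst

end AnalyticInvariance



/-! ### Fourier kernels of Schwartz symbols -/

section FourierKernels

variable {E : Type*} [NormedAddCommGroup E] [NormedSpace ℂ E]

/-- The inverse Fourier transform on `ℝ` as an explicit exponential integral (companion of
Mathlib's `Real.fourier_real_eq_integral_exp_smul`). [folklore] -/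
theorem fourierInv_real_eq_integral_exp_smul (f : ℝ → E) (w : ℝ) :
    𝓕⁻ f w = ∫ v : ℝ, cexp (↑(2 * π * v * w) * I) • f v := by
  rw [Real.fourierInv_eq_fourier_neg, Real.fourier_real_eq_integral_exp_smul]
  congr 1 with v
  congr 2
  push_cast
  ring

/-- The character `e^{-2πi p s}` has modulus one. [folklore] -/
theorem norm_cexp_neg_two_pi_mul_I (p s : ℝ) : ‖cexp (↑(-2 * π * p * s) * I)‖ = 1 :=
  norm_exp_ofReal_mul_I _

/-- The Fourier transform of a Schwartz function is integrable. [folklore] -/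
theorem integrable_fourier_schwartz (θ : 𝓢(ℝ, ℂ)) : Integrable (𝓕 (θ : ℝ → ℂ)) := by
  rw [← SchwartzMap.fourier_coe]
  exact (𝓕 θ).integrable

/-- The Fourier transform of a Schwartz function is continuous. [folklore] -/
theorem continuous_fourier_schwartz (θ : 𝓢(ℝ, ℂ)) : Continuous (𝓕 (θ : ℝ → ℂ)) := by
  rw [← SchwartzMap.fourier_coe]
  exact (𝓕 θ).continuous

/-- The Fourier transform of a Schwartz function is bounded by the `L¹` norm. [folklore] -/
theorem norm_fourier_schwartz_le (θ : 𝓢(ℝ, ℂ)) (u : ℝ) : ‖𝓕 (θ : ℝ → ℂ) u‖ ≤ ∫ p, ‖θ p‖ := by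
  rw [Real.fourier_real_eq_integral_exp_smul]
  refine (norm_integral_le_integral_norm _).trans (le_of_eq ?_)
  congr 1 with p
  rw [norm_smul, norm_cexp_neg_two_pi_mul_I, one_mul]

/-- Fourier inversion for Schwartz functions, pointwise. [folklore] -/
theorem fourierInv_fourier_schwartz_apply (θ : 𝓢(ℝ, ℂ)) (p : ℝ) :
    𝓕⁻ (𝓕 (θ : ℝ → ℂ)) p = θ p := by
  rw [Continuous.fourierInv_fourier_eq θ.continuous θ.integrable (integrable_fourier_schwartz θ)]

/-- `∫ 𝓕θ = θ(0)` for a Schwartz function `θ` (Fourier inversion at `0`). [folklore] -/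
theorem integral_fourier_schwartz (θ : 𝓢(ℝ, ℂ)) : ∫ u, 𝓕 (θ : ℝ → ℂ) u = θ 0 := by
  rw [← fourierInv_fourier_schwartz_apply θ 0, fourierInv_real_eq_integral_exp_smul]
  simp

/-- The **kernel calculus**: the correlation kernel of the Fourier transforms of two Schwartz
symbols is the Fourier transform of `conj θ₁ · θ₂`,
`∫ conj (𝓕θ₁ t) 𝓕θ₂ (t + u) dt = 𝓕(conj θ₁ · θ₂)(u)` (Fubini and Fourier inversion). This is the
multiplicativity of the functional calculus `θ ↦ θ(H)` behind Bratteli–Robinson I §3.2.3.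
[folklore] -/
theorem integral_conj_fourier_mul_fourier_add (θ₁ θ₂ : 𝓢(ℝ, ℂ)) (u : ℝ) :
    ∫ t, conj (𝓕 (θ₁ : ℝ → ℂ) t) * 𝓕 (θ₂ : ℝ → ℂ) (t + u) =
      𝓕 (fun p => conj (θ₁ p) * θ₂ p) u := by
  set k₁ : ℝ → ℂ := 𝓕 (θ₁ : ℝ → ℂ) with hk₁
  set e : ℝ → ℝ → ℂ := fun p s => cexp (↑(-2 * π * p * s) * I) with he
  have he_add : ∀ p t : ℝ, e p (t + u) = e p t * e p u := fun p t => by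
    simp only [he, ← Complex.exp_add]
    congr 1
    push_cast
    ring
  have he_norm : ∀ p s : ℝ, ‖e p s‖ = 1 := fun p s => norm_cexp_neg_two_pi_mul_I p s
  -- the inner Fourier integral, expanded
  have h1 : ∀ t : ℝ, 𝓕 (θ₂ : ℝ → ℂ) (t + u) = ∫ p, e p (t + u) * θ₂ p := fun t => by
    rw [Real.fourier_real_eq_integral_exp_smul]
    simp only [he, smul_eq_mul]
  simp_rw [h1, ← integral_const_mul]
  -- Fubini
  have hint : Integrable (Function.uncurry fun (t p : ℝ) => conj (k₁ t) * (e p (t + u) * θ₂ p))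
      (volume.prod volume) := by
    have hF : Integrable (fun z : ℝ × ℝ => ‖k₁ z.1‖ * ‖θ₂ z.2‖) (volume.prod volume) :=
      (integrable_fourier_schwartz θ₁).norm.mul_prod θ₂.integrable.norm
    refine hF.mono' ?_ (Eventually.of_forall fun z => ?_)
    · have hc : Continuous k₁ := continuous_fourier_schwartz θ₁
      exact (by rw [he]; fun_prop : Continuous (Function.uncurry fun (t p : ℝ) =>
        conj (k₁ t) * (e p (t + u) * θ₂ p))).aestronglyMeasurable
    · obtain ⟨t, p⟩ := z
      simp only [Function.uncurry_apply_pair, norm_mul, Complex.norm_conj, he_norm, one_mul]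
      exact le_rfl
  rw [integral_integral_swap hint]
  -- evaluate the `t`-integral by Fourier inversion
  have h2 : ∀ p : ℝ, (∫ t, conj (k₁ t) * (e p (t + u) * θ₂ p)) =
      (∫ t, conj (k₁ t) * e p t) * (e p u * θ₂ p) := fun p => by
    rw [← integral_mul_const]
    congr 1 with t
    rw [he_add]
    ring
  have h3 : ∀ p : ℝ, (∫ t, conj (k₁ t) * e p t) = conj (θ₁ p) := fun p => by
    have hconj : (∫ t, conj (k₁ t) * e p t) = conj (∫ t, k₁ t * conj (e p t)) := by
      rw [← integral_conj]
      congr 1 with t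
      simp
    rw [hconj, ← fourierInv_fourier_schwartz_apply θ₁ p, fourierInv_real_eq_integral_exp_smul]
    congr 2 with t
    rw [smul_eq_mul, mul_comm (cexp _)]
    congr 1
    rw [he, ← Complex.exp_conj]
    congr 1
    simp only [map_mul, Complex.conj_ofReal, Complex.conj_I]
    push_cast
    ring
  simp_rw [h2, h3]
  rw [Real.fourier_real_eq_integral_exp_smul]
  congr 1 with p
  simp only [he, smul_eq_mul]
  ring

/-- **Derivative of a kernel**: `(𝓕θ)' = 𝓕η` for the symbol `η(p) = -2πi p θ(p)`.
[folklore] -/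
theorem hasDerivAt_fourier_schwartz (θ η : 𝓢(ℝ, ℂ)) (hη : ∀ p : ℝ, η p = -2 * π * I * p * θ p)
    (u : ℝ) : HasDerivAt (𝓕 (θ : ℝ → ℂ)) (𝓕 (η : ℝ → ℂ) u) u := by
  have h1 : Integrable (fun x : ℝ => x • (θ : ℝ → ℂ) x) := by
    refine (θ.integrable_pow_mul volume 1).mono' (by fun_prop : Continuous fun x : ℝ =>
      x • (θ : ℝ → ℂ) x).aestronglyMeasurable (Eventually.of_forall fun x => ?_)
    rw [norm_smul, pow_one]
  have h2 := Real.hasDerivAt_fourier θ.integrable h1 u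
  have h3 : (fun x : ℝ => (-2 * ↑π * I * ↑x) • (θ : ℝ → ℂ) x) = (η : ℝ → ℂ) := by
    ext x
    rw [hη, smul_eq_mul]
  rwa [h3] at h2

/-- **Translation of a kernel**: `𝓕θ (u - t) = 𝓕η (u)` for the modulated symbol
`η(p) = e^{2πi p t} θ(p)`. [folklore] -/
theorem fourier_schwartz_sub (θ η : 𝓢(ℝ, ℂ)) (t : ℝ)
    (hη : ∀ p : ℝ, η p = cexp (2 * π * I * p * t) * θ p) (u : ℝ) :
    𝓕 (θ : ℝ → ℂ) (u - t) = 𝓕 (η : ℝ → ℂ) u := by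
  simp only [Real.fourier_real_eq_integral_exp_smul, smul_eq_mul, hη]
  congr 1 with p
  rw [← mul_assoc, ← Complex.exp_add]
  congr 2
  push_cast
  ring

/-- **Scaling of a kernel**: for `θ_c(p) = θ(p / c)`, `c > 0`, `𝓕θ_c (u) = c 𝓕θ (c u)`.
[folklore] -/
theorem fourier_schwartz_compDiv (θ θc : 𝓢(ℝ, ℂ)) {c : ℝ} (hc : 0 < c)
    (hθc : ∀ p : ℝ, θc p = θ (p / c)) (u : ℝ) :
    𝓕 (θc : ℝ → ℂ) u = c * 𝓕 (θ : ℝ → ℂ) (c * u) := by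
  simp only [Real.fourier_real_eq_integral_exp_smul, smul_eq_mul, hθc]
  have h := Measure.integral_comp_div
    (fun y : ℝ => cexp (↑(-2 * π * (c * y) * u) * I) * θ y) c
  have h' : (fun x : ℝ => cexp (↑(-2 * π * (c * (x / c)) * u) * I) * θ (x / c)) =
      fun x : ℝ => cexp (↑(-2 * π * x * u) * I) * θ (x / c) := by
    ext x
    rw [mul_div_cancel₀ x hc.ne']
  rw [h'] at h
  rw [h, abs_of_pos hc, real_smul]
  congr 2 with y
  congr 3
  push_cast
  ring

/-- Scaling leaves the `L¹` norm of the kernel invariant: `‖𝓕θ_c‖₁ = ‖𝓕θ‖₁`. [folklore] -/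
theorem integral_norm_fourier_schwartz_compDiv (θ θc : 𝓢(ℝ, ℂ)) {c : ℝ} (hc : 0 < c)
    (hθc : ∀ p : ℝ, θc p = θ (p / c)) :
    ∫ u, ‖𝓕 (θc : ℝ → ℂ) u‖ = ∫ u, ‖𝓕 (θ : ℝ → ℂ) u‖ := by
  simp_rw [fourier_schwartz_compDiv θ θc hc hθc, norm_mul, Complex.norm_real, Real.norm_eq_abs,
    abs_of_pos hc]
  rw [integral_const_mul, Measure.integral_comp_mul_left (fun u => ‖𝓕 (θ : ℝ → ℂ) u‖) c,
    abs_of_pos (inv_pos.mpr hc), smul_eq_mul, ← mul_assoc, mul_inv_cancel₀ hc.ne', one_mul]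

/-- The scaled kernel as a rescaled function: `𝓕θ_c(u) g(u)` integrates like `𝓕θ(v) g(v/c)`.
[folklore] -/
theorem integral_fourier_schwartz_compDiv_mul {F : Type*} [NormedAddCommGroup F]
    [NormedSpace ℂ F] (θ θc : 𝓢(ℝ, ℂ)) {c : ℝ} (hc : 0 < c)
    (hθc : ∀ p : ℝ, θc p = θ (p / c)) (g : ℝ → F) :
    ∫ u, 𝓕 (θc : ℝ → ℂ) u • g u = ∫ v, 𝓕 (θ : ℝ → ℂ) v • g (v / c) := by
  simp_rw [fourier_schwartz_compDiv θ θc hc hθc]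
  have hfun : (fun x : ℝ => (fun v : ℝ => 𝓕 (θ : ℝ → ℂ) v • g (v / c)) (c * x)) =
      fun x => 𝓕 (θ : ℝ → ℂ) (c * x) • g x := by
    ext x
    simp only [mul_div_cancel_left₀ x hc.ne']
  have h := Measure.integral_comp_mul_left (fun v : ℝ => 𝓕 (θ : ℝ → ℂ) v • g (v / c)) c
  rw [hfun, abs_of_pos (inv_pos.mpr hc)] at h
  calc ∫ u, ((c : ℂ) * 𝓕 (θ : ℝ → ℂ) (c * u)) • g u
      = (c : ℂ) • ∫ u, 𝓕 (θ : ℝ → ℂ) (c * u) • g u := by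
        rw [← integral_smul]
        congr 1 with u
        rw [mul_smul]
    _ = (c : ℂ) • (c⁻¹ • ∫ y, 𝓕 (θ : ℝ → ℂ) y • g (y / c)) := by rw [h]
    _ = ∫ y, 𝓕 (θ : ℝ → ℂ) y • g (y / c) := by
        rw [Complex.coe_smul, smul_smul, mul_inv_cancel₀ hc.ne', one_smul]

end FourierKernels



variable {A : Type*} [CStarAlgebra A]

/-! ### Smearing an automorphism group with an integrable kernel -/

section Smear

variable {τ : ℝ → (A ≃⋆ₐ[ℂ] A)}

/-- The **smeared element** `τ_k(a) = ∫ k(t) τ_t(a) dt` (Bochner integral in `A`) of `a` by an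
integrable kernel `k : ℝ → ℂ` along the automorphism group `τ`; for `k ∈ L¹(ℝ)` this is the
standard regularisation `τ_f(A) = ∫ f(t) τ_t(A) dt` of Bratteli–Robinson I §2.5.3 (Def. 2.5.17 ff.)
and §3.2.3 (spectral theory of automorphism groups). [folklore] -/
def smear (τ : ℝ → (A ≃⋆ₐ[ℂ] A)) (k : ℝ → ℂ) (a : A) : A :=
  ∫ t, k t • τ t a

/-- Unfolding of `smear`. [folklore] -/
theorem smear_def (τ : ℝ → (A ≃⋆ₐ[ℂ] A)) (k : ℝ → ℂ) (a : A) :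
    smear τ k a = ∫ t, k t • τ t a := rfl

/-- The smearing integrand `k(t) τ_t(a)` is integrable for `k ∈ L¹`. [folklore] -/
theorem integrable_smul_aut (hτ : Literature.MathematicalPhysics.QuantumLattice.IsAutomorphismGroup τ) {k : ℝ → ℂ} (hk : Integrable k)
    (a : A) : Integrable fun t : ℝ => k t • τ t a :=
  hk.smul_bdd ‖a‖ (hτ.continuous_apply a).aestronglyMeasurable
    (Eventually.of_forall fun t => (norm_aut_apply τ t a).le)

/-- `‖τ_k(a)‖ ≤ ‖k‖₁ ‖a‖`. Bratteli–Robinson I §2.5.3. [folklore] -/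
theorem norm_smear_le (τ : ℝ → (A ≃⋆ₐ[ℂ] A)) {k : ℝ → ℂ} (hk : Integrable k) (a : A) :
    ‖smear τ k a‖ ≤ (∫ t, ‖k t‖) * ‖a‖ := by
  rw [smear_def, ← integral_mul_const]
  refine norm_integral_le_of_norm_le (hk.norm.mul_const _) (Eventually.of_forall fun t => ?_)
  rw [norm_smul, norm_aut_apply]

/-- Smearing is additive in the element. [folklore] -/
theorem smear_add (hτ : Literature.MathematicalPhysics.QuantumLattice.IsAutomorphismGroup τ) {k : ℝ → ℂ} (hk : Integrable k) (a b : A) :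
    smear τ k (a + b) = smear τ k a + smear τ k b := by
  simp only [smear_def, map_add, smul_add]
  exact integral_add (integrable_smul_aut hτ hk a) (integrable_smul_aut hτ hk b)

/-- Smearing is homogeneous in the element. [folklore] -/
theorem smear_smul (τ : ℝ → (A ≃⋆ₐ[ℂ] A)) (k : ℝ → ℂ) (c : ℂ) (a : A) :
    smear τ k (c • a) = c • smear τ k a := by
  simp only [smear_def, map_smul, smul_comm (k _) c, integral_smul]

/-- Smearing is additive in the kernel. [folklore] -/
theorem smear_add_left (hτ : Literature.MathematicalPhysics.QuantumLattice.IsAutomorphismGroup τ) {k₁ k₂ : ℝ → ℂ} (hk₁ : Integrable k₁)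
    (hk₂ : Integrable k₂) (a : A) :
    smear τ (k₁ + k₂) a = smear τ k₁ a + smear τ k₂ a := by
  simp only [smear_def, Pi.add_apply, add_smul]
  exact integral_add (integrable_smul_aut hτ hk₁ a) (integrable_smul_aut hτ hk₂ a)

/-- Smearing is additive in the kernel (subtraction). [folklore] -/
theorem smear_sub_left (hτ : Literature.MathematicalPhysics.QuantumLattice.IsAutomorphismGroup τ) {k₁ k₂ : ℝ → ℂ} (hk₁ : Integrable k₁)
    (hk₂ : Integrable k₂) (a : A) :
    smear τ (k₁ - k₂) a = smear τ k₁ a - smear τ k₂ a := by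
  simp only [smear_def, Pi.sub_apply, sub_smul]
  exact integral_sub (integrable_smul_aut hτ hk₁ a) (integrable_smul_aut hτ hk₂ a)

/-- Smearing is homogeneous in the kernel. [folklore] -/
theorem smear_smul_left (τ : ℝ → (A ≃⋆ₐ[ℂ] A)) (k : ℝ → ℂ) (c : ℂ) (a : A) :
    smear τ (c • k) a = c • smear τ k a := by
  simp only [smear_def, Pi.smul_apply, smul_eq_mul, mul_smul, integral_smul]

/-- `τ_s` acts on a smeared element by translating the kernel:
`τ_s(τ_k(a)) = ∫ k(t) τ_{t+s}(a) dt`. Bratteli–Robinson I §2.5.3. [folklore] -/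
theorem aut_smear (hτ : Literature.MathematicalPhysics.QuantumLattice.IsAutomorphismGroup τ) {k : ℝ → ℂ} (hk : Integrable k) (a : A) (s : ℝ) :
    τ s (smear τ k a) = ∫ t, k t • τ (t + s) a := by
  have h := (autCLM τ s).integral_comp_comm (integrable_smul_aut hτ hk a)
  simp only [autCLM_apply, map_smul] at h
  rw [smear_def, ← h]
  congr 1 with t
  rw [hτ.map_add_apply']

/-- `τ_s(τ_k(a)) = τ_{k(· - s)}(a)`. Bratteli–Robinson I §2.5.3. [folklore] -/
theorem aut_smear_eq_smear (hτ : Literature.MathematicalPhysics.QuantumLattice.IsAutomorphismGroup τ) {k : ℝ → ℂ} (hk : Integrable k) (a : A)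
    (s : ℝ) : τ s (smear τ k a) = smear τ (fun u => k (u - s)) a := by
  rw [aut_smear hτ hk a s, smear_def]
  have := integral_add_right_eq_self (μ := volume) (fun u => k (u - s) • τ u a) s
  simp only [add_sub_cancel_right] at this
  rw [← this]

/-- Star of a smeared element: `(τ_k(a))⋆ = τ_{k̄}(a⋆)`. [folklore] -/
theorem star_smear (hτ : Literature.MathematicalPhysics.QuantumLattice.IsAutomorphismGroup τ) {k : ℝ → ℂ} (hk : Integrable k) (a : A) :
    star (smear τ k a) = smear τ (fun t => conj (k t)) (star a) := by
  have h := ((starL ℂ : A ≃L⋆[ℂ] A) : A →L⋆[ℂ] A).integral_comp_commSL (by intros; simp)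
    (integrable_smul_aut hτ hk a)
  simp only [ContinuousLinearEquiv.coe_coe, starL_apply, star_smul] at h
  rw [smear_def, smear_def, ← h]
  congr 1 with t
  rw [map_star (τ t)]
  rfl

end Smear

/-! ### States and smeared elements -/

section StateSmear

variable [PartialOrder A] [StarOrderedRing A] {τ : ℝ → (A ≃⋆ₐ[ℂ] A)}

/-- A state passes under the smearing integral: `ω(x τ_k(a)) = ∫ k(t) ω(x τ_t(a)) dt`. [folklore] -/
theorem _root_.Literature.MathematicalPhysics.QuantumLattice.State.apply_mul_smear (ω : Literature.MathematicalPhysics.QuantumLattice.State A) (hτ : Literature.MathematicalPhysics.QuantumLattice.IsAutomorphismGroup τ) {k : ℝ → ℂ}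
    (hk : Integrable k) (x a : A) :
    ω (x * smear τ k a) = ∫ t, k t * ω (x * τ t a) := by
  have h1 : x * smear τ k a = ∫ t, k t • (x * τ t a) := by
    have h := (ContinuousLinearMap.mul ℂ A x).integral_comp_comm (integrable_smul_aut hτ hk a)
    simp only [ContinuousLinearMap.mul_apply', mul_smul_comm] at h
    rw [smear_def, ← h]
  have h2 : Integrable fun t : ℝ => k t • (x * τ t a) := by
    have := (ContinuousLinearMap.mul ℂ A x).integrable_comp (integrable_smul_aut hτ hk a)
    simpa only [ContinuousLinearMap.mul_apply', mul_smul_comm] using this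
  rw [h1, ← ω.toContinuousLinearMap_apply, ← ω.toContinuousLinearMap.integral_comp_comm h2]
  simp only [map_smul, smul_eq_mul, Literature.MathematicalPhysics.QuantumLattice.State.toContinuousLinearMap_apply]

/-- A state passes under the smearing integral: `ω(τ_k(a) x) = ∫ k(t) ω(τ_t(a) x) dt`. [folklore] -/
theorem _root_.Literature.MathematicalPhysics.QuantumLattice.State.apply_smear_mul (ω : Literature.MathematicalPhysics.QuantumLattice.State A) (hτ : Literature.MathematicalPhysics.QuantumLattice.IsAutomorphismGroup τ) {k : ℝ → ℂ}
    (hk : Integrable k) (a x : A) :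
    ω (smear τ k a * x) = ∫ t, k t * ω (τ t a * x) := by
  have h1 : smear τ k a * x = ∫ t, k t • (τ t a * x) := by
    have h := ((ContinuousLinearMap.mul ℂ A).flip x).integral_comp_comm
      (integrable_smul_aut hτ hk a)
    simp only [ContinuousLinearMap.flip_apply, ContinuousLinearMap.mul_apply',
      smul_mul_assoc] at h
    rw [smear_def, ← h]
  have h2 : Integrable fun t : ℝ => k t • (τ t a * x) := by
    have := ((ContinuousLinearMap.mul ℂ A).flip x).integrable_comp (integrable_smul_aut hτ hk a)
    simpa only [ContinuousLinearMap.flip_apply, ContinuousLinearMap.mul_apply',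
      smul_mul_assoc] using this
  rw [h1, ← ω.toContinuousLinearMap_apply, ← ω.toContinuousLinearMap.integral_comp_comm h2]
  simp only [map_smul, smul_eq_mul, Literature.MathematicalPhysics.QuantumLattice.State.toContinuousLinearMap_apply]

/-- Conjugates of integrable functions are integrable. [folklore] -/
theorem integrable_conj {g : ℝ → ℂ} (hg : Integrable g) : Integrable fun t => conj (g t) := by
  simpa using (Complex.conjCLE : ℂ →L[ℝ] ℂ).integrable_comp hg

/-- The **correlation kernel** `C_{g,h}(u) = ∫ conj (g t) h(t + u) dt` of two kernels.
[folklore] -/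
def corrKernel (g h : ℝ → ℂ) (u : ℝ) : ℂ :=
  ∫ t, conj (g t) * h (t + u)

/-- Unfolding of `corrKernel`. [folklore] -/
theorem corrKernel_def (g h : ℝ → ℂ) (u : ℝ) :
    corrKernel g h u = ∫ t, conj (g t) * h (t + u) := rfl

/-- `t ↦ ω(x τ_t(b))` is continuous. [folklore] -/
theorem _root_.Literature.MathematicalPhysics.QuantumLattice.State.continuous_apply_mul_aut (ω : Literature.MathematicalPhysics.QuantumLattice.State A) (hτ : Literature.MathematicalPhysics.QuantumLattice.IsAutomorphismGroup τ) (x b : A) :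
    Continuous fun t : ℝ => ω (x * τ t b) :=
  ω.toContinuousLinearMap.continuous.comp (continuous_const.mul (hτ.continuous_apply b))

/-- `|ω(x τ_t(b))| ≤ ‖x‖ ‖b‖`. [folklore] -/
theorem _root_.Literature.MathematicalPhysics.QuantumLattice.State.norm_apply_mul_aut_le (ω : Literature.MathematicalPhysics.QuantumLattice.State A) (x b : A) (t : ℝ) :
    ‖ω (x * τ t b)‖ ≤ ‖x‖ * ‖b‖ :=
  (Literature.MathematicalPhysics.QuantumLattice.State.norm_apply_le_norm_holds ω _).trans ((norm_mul_le _ _).trans (by rw [norm_aut_apply]))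

/-- **Correlation identity.** For a `τ`-invariant state `ω` and continuous integrable kernels
`g, h`, `ω((τ_g a)⋆ τ_h b) = ∫ C_{g,h}(u) ω(a⋆ τ_u b) du` with
`C_{g,h}(u) = ∫ conj (g t) h(t+u) dt`:
the two-point function of smeared elements only depends on the difference variable (this is the
computation behind the unitary group `U_ω(t) π_ω(A)Ω_ω = π_ω(τ_t A)Ω_ω` of an invariant state,
Bratteli–Robinson I Cor. 2.3.17, and behind the spectral estimates of Bratteli–Robinson II
Prop. 5.3.19). [folklore] -/
theorem _root_.Literature.MathematicalPhysics.QuantumLattice.State.apply_star_smear_mul_smear (ω : Literature.MathematicalPhysics.QuantumLattice.State A) (hτ : Literature.MathematicalPhysics.QuantumLattice.IsAutomorphismGroup τ)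
    (hinv : ∀ (t : ℝ) (a : A), ω (τ t a) = ω a) {g h : ℝ → ℂ} (hg : Continuous g)
    (hgi : Integrable g) (hh : Continuous h) (hhi : Integrable h) (a b : A) :
    ω (star (smear τ g a) * smear τ h b) = ∫ u, corrKernel g h u * ω (star a * τ u b) := by
  set φ : ℝ → ℂ := fun u => ω (star a * τ u b) with hφ
  have hφc : Continuous φ := ω.continuous_apply_mul_aut hτ (star a) b
  have hφb : ∀ u, ‖φ u‖ ≤ ‖a‖ * ‖b‖ := fun u => by
    simpa only [hφ, norm_star] using ω.norm_apply_mul_aut_le (star a) b u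
  -- Step 1: expand both smearings
  have h1 : ω (star (smear τ g a) * smear τ h b) =
      ∫ t, conj (g t) * ∫ s, h s * φ (s - t) := by
    rw [star_smear hτ hgi, ω.apply_smear_mul hτ (integrable_conj hgi)]
    congr 1 with t
    congr 1
    rw [ω.apply_mul_smear hτ hhi]
    congr 1 with s
    congr 1
    -- invariance: `ω(τ_t(a⋆) τ_s(b)) = ω(a⋆ τ_{s-t}(b))`
    have hs : τ s b = τ t (τ (s - t) b) := by
      rw [← hτ.map_add_apply', sub_add_cancel]
    rw [hs, ← map_mul, hinv]
  -- Step 2: substitute `s = u + t` in the inner integral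
  have h2 : ∀ t : ℝ, (∫ s, h s * φ (s - t)) = ∫ u, h (u + t) * φ u := fun t => by
    rw [← integral_add_right_eq_self (μ := volume) (fun s => h s * φ (s - t)) t]
    simp only [add_sub_cancel_right]
  simp_rw [h1, h2, ← integral_const_mul]
  -- Step 3: Fubini
  have hint : Integrable (Function.uncurry fun (t u : ℝ) => conj (g t) * (h (u + t) * φ u))
      (volume.prod volume) := by
    have hF : Integrable (fun z : ℝ × ℝ => ‖g z.1‖ * ‖h z.2‖) (volume.prod volume) :=
      hgi.norm.mul_prod hhi.norm
    have hshear := (measurePreserving_prod_add (volume : Measure ℝ) (volume : Measure ℝ))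
    have hF' : Integrable (fun z : ℝ × ℝ => ‖g z.1‖ * ‖h (z.1 + z.2)‖) (volume.prod volume) :=
      hshear.integrable_comp_of_integrable hF
    refine (hF'.const_mul (‖a‖ * ‖b‖)).mono' ?_ (Eventually.of_forall fun z => ?_)
    · exact (by fun_prop : Continuous (Function.uncurry fun (t u : ℝ) =>
        conj (g t) * (h (u + t) * φ u))).aestronglyMeasurable
    · obtain ⟨t, u⟩ := z
      simp only [Function.uncurry_apply_pair, norm_mul, Complex.norm_conj]
      rw [add_comm u t]
      calc ‖g t‖ * (‖h (t + u)‖ * ‖φ u‖)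
          ≤ ‖g t‖ * (‖h (t + u)‖ * (‖a‖ * ‖b‖)) := by gcongr; exact hφb _
        _ = ‖a‖ * ‖b‖ * (‖g t‖ * ‖h (t + u)‖) := by ring
  rw [integral_integral_swap hint]
  congr 1 with u
  rw [corrKernel_def, ← integral_mul_const]
  congr 1 with t
  rw [add_comm u t]
  ring

end StateSmear


/-! ### The generator domain under smearing; approximate identities -/

section SmearDomain

variable {τ : ℝ → (A ≃⋆ₐ[ℂ] A)}

/-- Smearing by an integrable kernel as a continuous linear map `a ↦ τ_k(a)` (bounded by
`‖k‖₁`). Bratteli–Robinson I §2.5.3. [folklore] -/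
def smearCLM (hτ : Literature.MathematicalPhysics.QuantumLattice.IsAutomorphismGroup τ) {k : ℝ → ℂ} (hk : Integrable k) : A →L[ℂ] A :=
  LinearMap.mkContinuous
    { toFun := smear τ k
      map_add' := smear_add hτ hk
      map_smul' := fun c a => smear_smul τ k c a }
    (∫ t, ‖k t‖) fun a => norm_smear_le τ hk a

/-- `smearCLM` is `smear` as a function. [folklore] -/
@[simp]
theorem smearCLM_apply (hτ : Literature.MathematicalPhysics.QuantumLattice.IsAutomorphismGroup τ) {k : ℝ → ℂ} (hk : Integrable k) (a : A) :
    smearCLM hτ hk a = smear τ k a := rfl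

/-- The automorphisms commute with smearing: `τ_h(τ_k(a)) = τ_k(τ_h(a))`. [folklore] -/
theorem aut_smear_comm (hτ : Literature.MathematicalPhysics.QuantumLattice.IsAutomorphismGroup τ) {k : ℝ → ℂ} (hk : Integrable k) (a : A)
    (h : ℝ) : τ h (smear τ k a) = smear τ k (τ h a) := by
  rw [aut_smear hτ hk a h, smear_def]
  congr 1 with t
  rw [hτ.map_add_apply]

/-- **The orbit of an element of `D(δ)` is differentiable everywhere**: if `t ↦ τ_t(a)` has
derivative `δa` at `0`, it has derivative `τ_u(δa)` at `u`. [folklore] -/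
theorem hasDerivAt_aut_apply (hτ : Literature.MathematicalPhysics.QuantumLattice.IsAutomorphismGroup τ) {a δa : A}
    (ha : HasDerivAt (fun t : ℝ => τ t a) δa 0) (u : ℝ) :
    HasDerivAt (fun t : ℝ => τ t a) (τ u δa) u := by
  have h0 : HasDerivAt (fun t : ℝ => τ t a) δa (u + -u) := by rwa [add_neg_cancel]
  have h1 : HasDerivAt (fun t : ℝ => τ (t + -u) a) δa u := HasDerivAt.comp_add_const u (-u) h0
  have h2 := (((autCLM τ u).restrictScalars ℝ).hasFDerivAt).comp_hasDerivAt u h1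
  have h3 : ((autCLM τ u).restrictScalars ℝ : A → A) ∘ (fun t : ℝ => τ (t + -u) a) =
      fun t : ℝ => τ t a := by
    ext t
    simp only [Function.comp_apply, ContinuousLinearMap.coe_restrictScalars', autCLM_apply]
    rw [← hτ.map_add_apply', neg_add_cancel_right]
  rwa [h3] at h2

/-- **`D(δ)` is stable under smearing**, with `δ(τ_k(a)) = τ_k(δa)`: if `t ↦ τ_t(a)` has
derivative `δa` at `0` and `k ∈ L¹`, then `h ↦ τ_h(τ_k(a))` has derivative `τ_k(δa)` at `0`.
Bratteli–Robinson I §3.2.3. [folklore] -/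
theorem hasDerivAt_aut_smear (hτ : Literature.MathematicalPhysics.QuantumLattice.IsAutomorphismGroup τ) {k : ℝ → ℂ} (hk : Integrable k)
    {a δa : A} (ha : HasDerivAt (fun t : ℝ => τ t a) δa 0) :
    HasDerivAt (fun h : ℝ => τ h (smear τ k a)) (smear τ k δa) 0 := by
  have h2 := (((smearCLM hτ hk).restrictScalars ℝ).hasFDerivAt).comp_hasDerivAt 0 ha
  have h3 : ((smearCLM hτ hk).restrictScalars ℝ : A → A) ∘ (fun t : ℝ => τ t a) =
      fun h : ℝ => τ h (smear τ k a) := by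
    ext t
    simp only [Function.comp_apply, ContinuousLinearMap.coe_restrictScalars', smearCLM_apply]
    rw [aut_smear_comm hτ hk]
  rw [h3] at h2
  exact h2

/-- **Density of `D(δ)`**: every element is a limit of elements of the domain of the generator
(here: of entire analytic elements, `Literature.MathematicalPhysics.QuantumLattice.IsAutomorphismGroup.exists_entire_tendsto`,
Bratteli–Robinson I Prop. 2.5.22). [folklore] -/
theorem _root_.Literature.MathematicalPhysics.QuantumLattice.IsAutomorphismGroup.exists_hasDerivAt_tendsto (hτ : Literature.MathematicalPhysics.QuantumLattice.IsAutomorphismGroup τ) (b : A) :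
    ∃ (c δc : ℕ → A), (∀ n, HasDerivAt (fun t : ℝ => τ t (c n)) (δc n) 0) ∧
      Tendsto c atTop (𝓝 b) := by
  obtain ⟨c, F, hcF, hc⟩ := hτ.exists_entire_tendsto b
  refine ⟨c, fun n => deriv (F n) 0, fun n => ?_, hc⟩
  have hd : DifferentiableAt ℂ (F n) ((0 : ℝ) : ℂ) := (hcF n).1 _
  have h1 : HasFDerivAt (F n) ((fderiv ℂ (F n) ((0 : ℝ) : ℂ)).restrictScalars ℝ) ((0 : ℝ) : ℂ) :=
    hd.hasFDerivAt.restrictScalars ℝ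
  have h2 : HasDerivAt (fun y : ℝ => (y : ℂ)) 1 0 := by
    simpa using (hasDerivAt_id (0 : ℝ)).ofReal_comp
  have h3 := h1.comp_hasDerivAt (0 : ℝ) h2
  have h4 : ((fderiv ℂ (F n) ((0 : ℝ) : ℂ)).restrictScalars ℝ) 1 = deriv (F n) 0 := by
    rw [ContinuousLinearMap.coe_restrictScalars', ofReal_zero, fderiv_apply_one_eq_deriv]
  rw [h4] at h3
  refine h3.congr_of_eventuallyEq (Eventually.of_forall fun t => ?_)
  exact ((hcF n).2 t).symm

/-- **Approximate identity.** If `θ` is a Schwartz symbol with `θ(0) = 1` and `θ_n(p) = θ(p/(n+1))`,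
then `τ_{𝓕θ_n}(a) → a`: indeed `τ_{𝓕θ_n}(a) - a = ∫ 𝓕θ(v) (τ_{v/(n+1)}(a) - a) dv → 0` by
dominated convergence and strong continuity. Bratteli–Robinson I §2.5.3 (proof of Prop. 2.5.22).
[folklore] -/
theorem tendsto_smear_fourier (hτ : Literature.MathematicalPhysics.QuantumLattice.IsAutomorphismGroup τ) (θ : 𝓢(ℝ, ℂ)) (hθ : θ 0 = 1)
    (θn : ℕ → 𝓢(ℝ, ℂ)) (hθn : ∀ (n : ℕ) (p : ℝ), θn n p = θ (p / (n + 1))) (a : A) :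
    Tendsto (fun n => smear τ (𝓕 (θn n : ℝ → ℂ)) a) atTop (𝓝 a) := by
  have hpos : ∀ n : ℕ, (0 : ℝ) < n + 1 := fun n => by positivity
  -- rewrite the smeared elements over the fixed kernel `𝓕θ`
  have h1 : ∀ n : ℕ, smear τ (𝓕 (θn n : ℝ → ℂ)) a =
      ∫ v, 𝓕 (θ : ℝ → ℂ) v • τ (v / (n + 1)) a := fun n => by
    rw [smear_def]
    exact integral_fourier_schwartz_compDiv_mul θ (θn n) (hpos n) (hθn n) fun u => τ u a
  have h2 : a = ∫ v, 𝓕 (θ : ℝ → ℂ) v • a := by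
    rw [integral_smul_const, integral_fourier_schwartz, hθ, one_smul]
  have key : Tendsto (fun n : ℕ => ∫ v, 𝓕 (θ : ℝ → ℂ) v • τ (v / (n + 1)) a) atTop
      (𝓝 (∫ v, 𝓕 (θ : ℝ → ℂ) v • a)) := by
    refine tendsto_integral_of_dominated_convergence (fun v => ‖𝓕 (θ : ℝ → ℂ) v‖ * ‖a‖)
      (fun n => ?_) ((integrable_fourier_schwartz θ).norm.mul_const _) (fun n => ?_) ?_
    · exact ((continuous_fourier_schwartz θ).smul
        ((hτ.continuous_apply a).comp (continuous_id.div_const _))).aestronglyMeasurable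
    · exact Eventually.of_forall fun v => by rw [norm_smul, norm_aut_apply]
    · refine Eventually.of_forall fun v => Tendsto.smul tendsto_const_nhds ?_
      have hc : Tendsto (fun n : ℕ => v / ((n : ℝ) + 1)) atTop (𝓝 0) :=
        tendsto_const_nhds.div_atTop (tendsto_natCast_atTop_atTop.atTop_add tendsto_const_nhds)
      have := ((hτ.continuous_apply a).tendsto 0).comp hc
      rwa [hτ.map_zero_apply] at this
  rw [← h2] at key
  exact key.congr fun n => (h1 n).symm

/-- The `L¹` norms of the rescaled kernels `𝓕θ_n` are all equal to `‖𝓕θ‖₁`. [folklore] -/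
theorem integral_norm_fourier_rescaled (θ : 𝓢(ℝ, ℂ)) (θn : ℕ → 𝓢(ℝ, ℂ))
    (hθn : ∀ (n : ℕ) (p : ℝ), θn n p = θ (p / (n + 1))) (n : ℕ) :
    ∫ u, ‖𝓕 (θn n : ℝ → ℂ) u‖ = ∫ u, ‖𝓕 (θ : ℝ → ℂ) u‖ :=
  integral_norm_fourier_schwartz_compDiv θ (θn n) (by positivity) (hθn n)

end SmearDomain



/-! ### Compactly supported smooth symbols -/

section Symbols

open scoped ContDiff

/-- The values of `HasCompactSupport.toSchwartzMap`. [folklore] -/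
@[simp]
theorem toSchwartzMap_apply {f : ℝ → ℂ} (h₁ : HasCompactSupport f) (h₂ : ContDiff ℝ ∞ f)
    (x : ℝ) : h₁.toSchwartzMap h₂ x = f x := rfl

/-- **Cut-off multiplication**: the product of a smooth function `m` with a compactly supported
Schwartz symbol `θ`, as a Schwartz symbol. [folklore] -/
def cutMul (m : ℝ → ℂ) (hm : ContDiff ℝ ∞ m) (θ : 𝓢(ℝ, ℂ))
    (hθ : HasCompactSupport (θ : ℝ → ℂ)) : 𝓢(ℝ, ℂ) :=
  (hθ.mul_left (f := m)).toSchwartzMap (hm.mul (θ.smooth ⊤))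

/-- The values of `cutMul`: `(m θ)(p) = m(p) θ(p)`. [folklore] -/
@[simp]
theorem cutMul_apply (m : ℝ → ℂ) (hm : ContDiff ℝ ∞ m) (θ : 𝓢(ℝ, ℂ))
    (hθ : HasCompactSupport (θ : ℝ → ℂ)) (p : ℝ) : cutMul m hm θ hθ p = m p * θ p := rfl

/-- `cutMul m θ` is compactly supported. [folklore] -/
theorem hasCompactSupport_cutMul (m : ℝ → ℂ) (hm : ContDiff ℝ ∞ m) (θ : 𝓢(ℝ, ℂ))
    (hθ : HasCompactSupport (θ : ℝ → ℂ)) : HasCompactSupport (cutMul m hm θ hθ : ℝ → ℂ) :=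
  hθ.mul_left

/-- The support of `cutMul m θ` lies in the support of `θ`. [folklore] -/
theorem tsupport_cutMul_subset (m : ℝ → ℂ) (hm : ContDiff ℝ ∞ m) (θ : 𝓢(ℝ, ℂ))
    (hθ : HasCompactSupport (θ : ℝ → ℂ)) :
    tsupport (cutMul m hm θ hθ : ℝ → ℂ) ⊆ tsupport (θ : ℝ → ℂ) :=
  tsupport_mul_subset_right

/-- A function vanishing on `(-ε, ∞)` has topological support in `(-∞, -ε]`. [folklore] -/
theorem tsupport_subset_Iic_of {f : ℝ → ℂ} {ε : ℝ} (h : ∀ p, -ε < p → f p = 0) :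
    tsupport f ⊆ Iic (-ε) := by
  refine closure_minimal (fun p hp => ?_) isClosed_Iic
  by_contra hcon
  exact hp (h p (lt_of_not_ge hcon))

/-- The explicit smooth **bump symbol** at scale `c`: `χ_c(p) = S(p/c + 2) S(2 - p/c)` with
Mathlib's `Real.smoothTransition S`; equal to `1` on `[-c, c]`, supported in `[-2c, 2c]`, with
values in `[0, 1]`. [folklore] -/
def bumpFun (c : ℝ) (p : ℝ) : ℂ :=
  ((Real.smoothTransition (p / c + 2) * Real.smoothTransition (2 - p / c) : ℝ) : ℂ)

/-- The bump `χ_c` is smooth. [folklore] -/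
theorem contDiff_bumpFun (c : ℝ) : ContDiff ℝ ∞ (bumpFun c) := by
  unfold bumpFun
  refine Complex.ofRealCLM.contDiff.comp ?_
  exact (Real.smoothTransition.contDiff.comp (by fun_prop)).mul
    (Real.smoothTransition.contDiff.comp (by fun_prop))

/-- `χ_c = 1` on `[-c, c]`. [folklore] -/
theorem bumpFun_apply_of_abs_le {c p : ℝ} (hc : 0 < c) (hp : |p| ≤ c) : bumpFun c p = 1 := by
  rw [abs_le] at hp
  have h1' : -1 ≤ p / c := by rw [le_div_iff₀ hc]; linarith
  have h2' : p / c ≤ 1 := by rw [div_le_iff₀ hc]; linarith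
  have h1 : 1 ≤ p / c + 2 := by linarith
  have h2 : 1 ≤ 2 - p / c := by linarith
  simp [bumpFun, Real.smoothTransition.one_of_one_le h1, Real.smoothTransition.one_of_one_le h2]

/-- `χ_c = 0` off `(-2c, 2c)`. [folklore] -/
theorem bumpFun_apply_of_le_abs {c p : ℝ} (hc : 0 < c) (hp : 2 * c ≤ |p|) : bumpFun c p = 0 := by
  rcases le_abs'.mp hp with h | h
  · have h1' : p / c ≤ -2 := by rw [div_le_iff₀ hc]; linarith
    have h1 : p / c + 2 ≤ 0 := by linarith
    simp [bumpFun, Real.smoothTransition.zero_of_nonpos h1]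
  · have h2' : 2 ≤ p / c := by rw [le_div_iff₀ hc]; linarith
    have h2 : 2 - p / c ≤ 0 := by linarith
    simp [bumpFun, Real.smoothTransition.zero_of_nonpos h2]

/-- `χ_c(0) = 1`. [folklore] -/
theorem bumpFun_zero (c : ℝ) : bumpFun c 0 = 1 := by
  simp [bumpFun, Real.smoothTransition.one_of_one_le (by norm_num : (1 : ℝ) ≤ 2)]

/-- The support of `χ_c` lies in `[-2c, 2c]`. [folklore] -/
theorem tsupport_bumpFun_subset {c : ℝ} (hc : 0 < c) :
    tsupport (bumpFun c) ⊆ Icc (-(2 * c)) (2 * c) := by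
  refine closure_minimal (fun p hp => ?_) isClosed_Icc
  by_contra hcon
  refine hp (bumpFun_apply_of_le_abs hc ?_)
  simp only [mem_Icc, not_and_or, not_le] at hcon
  rcases hcon with h | h
  · rw [abs_of_neg (by linarith)]; linarith
  · rw [abs_of_pos (by linarith)]; linarith

/-- `χ_c` is compactly supported. [folklore] -/
theorem hasCompactSupport_bumpFun {c : ℝ} (hc : 0 < c) : HasCompactSupport (bumpFun c) :=
  HasCompactSupport.of_support_subset_isCompact isCompact_Icc
    (subset_tsupport _ |>.trans (tsupport_bumpFun_subset hc))

/-- Scaling: `χ_c(p) = χ_1(p / c)`. [folklore] -/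
theorem bumpFun_eq_bumpFun_one_div (c p : ℝ) : bumpFun c p = bumpFun 1 (p / c) := by
  simp [bumpFun]

/-- The bump is real with values in `[0, 1]`: `conj χ = χ`, `‖χ‖ ≤ 1`. [folklore] -/
theorem conj_bumpFun (c p : ℝ) : conj (bumpFun c p) = bumpFun c p := by
  simp [bumpFun, Complex.conj_ofReal]

/-- `‖χ_c(p)‖ ≤ 1`. [folklore] -/
theorem norm_bumpFun_le (c p : ℝ) : ‖bumpFun c p‖ ≤ 1 := by
  have h0 : ∀ x : ℝ, |Real.smoothTransition x| ≤ 1 := fun x => by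
    rw [abs_le]
    exact ⟨by linarith [Real.smoothTransition.nonneg x], Real.smoothTransition.le_one x⟩
  rw [bumpFun, Complex.norm_real, Real.norm_eq_abs, abs_mul]
  exact mul_le_one₀ (h0 _) (abs_nonneg _) (h0 _)

/-- The bump symbol `χ_c` as a Schwartz function. [folklore] -/
def bumpSymb (c : ℝ) (hc : 0 < c) : 𝓢(ℝ, ℂ) :=
  (hasCompactSupport_bumpFun hc).toSchwartzMap (contDiff_bumpFun c)

/-- The values of `bumpSymb`. [folklore] -/
@[simp]
theorem bumpSymb_apply (c : ℝ) (hc : 0 < c) (p : ℝ) : bumpSymb c hc p = bumpFun c p := rfl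

/-- `bumpSymb c` is compactly supported. [folklore] -/
theorem hasCompactSupport_bumpSymb (c : ℝ) (hc : 0 < c) :
    HasCompactSupport (bumpSymb c hc : ℝ → ℂ) :=
  hasCompactSupport_bumpFun hc

/-- The smooth **step** at scale `ε > 0`: `ψ_ε(p) = S((p + 2ε)/ε)`, `= 0` on `(-∞, -2ε]`, `= 1` on
`[-ε, ∞)`, values in `[0, 1]`. [folklore] -/
def stepFun (ε : ℝ) (p : ℝ) : ℝ :=
  Real.smoothTransition ((p + 2 * ε) / ε)

/-- The step `ψ_ε` is smooth. [folklore] -/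
theorem contDiff_stepFun {ε : ℝ} : ContDiff ℝ ∞ (stepFun ε) :=
  Real.smoothTransition.contDiff.comp (by fun_prop : ContDiff ℝ ∞ fun p : ℝ => (p + 2 * ε) / ε)

/-- `ψ_ε = 0` on `(-∞, -2ε]`. [folklore] -/
theorem stepFun_of_le {ε p : ℝ} (hε : 0 < ε) (hp : p ≤ -(2 * ε)) : stepFun ε p = 0 :=
  Real.smoothTransition.zero_of_nonpos (div_nonpos_iff.mpr (Or.inr ⟨by linarith, hε.le⟩))

/-- `ψ_ε = 1` on `[-ε, ∞)`. [folklore] -/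
theorem stepFun_of_ge {ε p : ℝ} (hε : 0 < ε) (hp : -ε ≤ p) : stepFun ε p = 1 :=
  Real.smoothTransition.one_of_one_le (by rw [le_div_iff₀ hε]; linarith)

/-- `0 ≤ ψ_ε`. [folklore] -/
theorem stepFun_nonneg (ε p : ℝ) : 0 ≤ stepFun ε p := Real.smoothTransition.nonneg _

/-- `ψ_ε ≤ 1`. [folklore] -/
theorem stepFun_le_one (ε p : ℝ) : stepFun ε p ≤ 1 := Real.smoothTransition.le_one _

/-- `ψ_ε(p) > 0 ↔ p > -2ε`. [folklore] -/
theorem stepFun_pos_iff {ε p : ℝ} (hε : 0 < ε) : 0 < stepFun ε p ↔ -(2 * ε) < p := by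
  rw [stepFun]
  constructor
  · intro h
    by_contra hcon
    have h' : (p + 2 * ε) / ε ≤ 0 := div_nonpos_iff.mpr (Or.inr ⟨by linarith, hε.le⟩)
    rw [Real.smoothTransition.zero_of_nonpos h'] at h
    exact lt_irrefl _ h
  · intro h
    exact Real.smoothTransition.pos_of_pos (div_pos (by linarith) hε)

/-- The **square-root weight** `s_ε(p) = √(p + 3ε) ψ_ε(p)` is smooth (the step vanishes near the
branch point `p = -3ε`). [folklore] -/
theorem contDiff_sqrt_mul_stepFun {ε : ℝ} (hε : 0 < ε) :
    ContDiff ℝ ∞ fun p : ℝ => Real.sqrt (p + 3 * ε) * stepFun ε p := by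
  rw [contDiff_iff_contDiffAt]
  intro p
  by_cases hp : -(3 * ε) < p
  · have h1 : ContDiffAt ℝ ∞ (fun p : ℝ => Real.sqrt (p + 3 * ε)) p := by
      have hne : p + 3 * ε ≠ 0 := by linarith
      exact (Real.contDiffAt_sqrt hne).comp p (by fun_prop)
    exact h1.mul contDiff_stepFun.contDiffAt
  · -- near `p ≤ -3ε` the step (hence the product) vanishes identically
    have hev : (fun p : ℝ => Real.sqrt (p + 3 * ε) * stepFun ε p) =ᶠ[𝓝 p] fun _ => 0 := by
      filter_upwards [(isOpen_Iio (a := -(2 * ε))).mem_nhds (by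
        simp only [mem_Iio]; linarith)] with q hq
      rw [stepFun_of_le hε (le_of_lt hq), mul_zero]
    exact (contDiffAt_const (c := (0 : ℝ))).congr_of_eventuallyEq hev

end Symbols

/-! ### The easy half of the Paley–Wiener theorem: kernels with negative spectral support
annihilate boundary values of bounded analytic functions -/

section PaleyWiener

open scoped ContDiff

/-- The **Fourier–Laplace extension** `K(w) = ∫ e^{-2πi p w} η(p) dp` of the kernel `𝓕η` to
complex arguments. [folklore] -/
def extKernel (η : ℝ → ℂ) (w : ℂ) : ℂ :=
  ∫ p : ℝ, cexp (-(2 * π * I * p * w)) * η p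

/-- On the real axis the Fourier–Laplace extension is the Fourier transform, `K(u) = 𝓕η(u)`.
[folklore] -/
theorem extKernel_ofReal (η : ℝ → ℂ) (u : ℝ) : extKernel η u = 𝓕 η u := by
  rw [extKernel, Real.fourier_real_eq_integral_exp_smul]
  congr 1 with p
  rw [smul_eq_mul]
  congr 2
  push_cast
  ring

/-- `|e^{-2πipw}| = e^{2πp Im w}`. [folklore] -/
theorem norm_cexp_extKernel (p : ℝ) (w : ℂ) :
    ‖cexp (-(2 * π * I * p * w))‖ = Real.exp (2 * π * p * w.im) := by
  rw [norm_exp]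
  congr 1
  simp only [neg_re, mul_re, re_ofNat, ofReal_re, im_ofNat, ofReal_im, mul_zero, sub_zero, I_re,
    mul_im, zero_mul, add_zero, I_im, mul_one, zero_sub, neg_neg, zero_add]

/-- Growth bound of the Fourier–Laplace extension of a kernel with **negative spectral support**:
if `η` vanishes on `(-ε, ∞)`, then `|K(w)| ≤ e^{-2πε Im w} ‖η‖₁` for `Im w ≥ 0`. [folklore] -/
theorem norm_extKernel_le {η : ℝ → ℂ} (hη : Integrable η) {ε : ℝ}
    (hsupp : ∀ p, -ε < p → η p = 0) {w : ℂ} (hw : 0 ≤ w.im) :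
    ‖extKernel η w‖ ≤ Real.exp (-(2 * π * ε * w.im)) * ∫ p, ‖η p‖ := by
  rw [extKernel, ← integral_const_mul]
  refine norm_integral_le_of_norm_le (hη.norm.const_mul _) (Eventually.of_forall fun p => ?_)
  rw [norm_mul, norm_cexp_extKernel]
  by_cases hp : η p = 0
  · simp [hp]
  · have hp' : p ≤ -ε := le_of_not_gt fun h => hp (hsupp p h)
    have hexp : Real.exp (2 * π * p * w.im) ≤ Real.exp (-(2 * π * ε * w.im)) := by
      apply Real.exp_le_exp.mpr
      calc 2 * π * p * w.im = (2 * π * w.im) * p := by ring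
        _ ≤ (2 * π * w.im) * (-ε) := by gcongr
        _ = -(2 * π * ε * w.im) := by ring
    exact mul_le_mul_of_nonneg_right hexp (norm_nonneg _)

/-- The derivative of the Fourier–Laplace extension of a continuous compactly supported kernel
`η` is the extension of the kernel of `p ↦ -2πi p η(p)` (differentiation under the integral
sign). [folklore] -/
theorem hasDerivAt_extKernel {η : ℝ → ℂ} (hηc : Continuous η) (hηs : HasCompactSupport η)
    (w₀ : ℂ) :
    HasDerivAt (extKernel η) (extKernel (fun p : ℝ => -(2 * π * I * p) * η p) w₀) w₀ := by
  obtain ⟨S, hS0, hS⟩ : ∃ S : ℝ, 0 ≤ S ∧ ∀ p, η p ≠ 0 → |p| ≤ S := by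
    obtain ⟨S, hS⟩ := hηs.isCompact.isBounded.subset_closedBall 0
    refine ⟨max S 0, le_max_right _ _, fun p hp => ?_⟩
    have h := hS (subset_tsupport _ hp)
    rw [Metric.mem_closedBall, Real.dist_eq, sub_zero] at h
    exact h.trans (le_max_left _ _)
  have hηi : Integrable η := hηc.integrable_of_hasCompactSupport hηs
  set C : ℝ := 2 * π * S * Real.exp (2 * π * S * (|w₀.im| + 1)) with hC
  have key := hasDerivAt_integral_of_dominated_loc_of_deriv_le (μ := volume)
    (F := fun (w : ℂ) (p : ℝ) => cexp (-(2 * π * I * p * w)) * η p)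
    (F' := fun (w : ℂ) (p : ℝ) => -(2 * π * I * p) * cexp (-(2 * π * I * p * w)) * η p)
    (x₀ := w₀) (bound := fun p => C * ‖η p‖) (s := Metric.ball w₀ 1)
    (Metric.ball_mem_nhds w₀ one_pos) ?_ ?_ ?_ ?_ (hηi.norm.const_mul C) ?_
  · have h := key.2
    have hF' : (∫ p : ℝ, -(2 * π * I * p) * cexp (-(2 * π * I * p * w₀)) * η p) =
        extKernel (fun p : ℝ => -(2 * π * I * p) * η p) w₀ := by
      rw [extKernel]
      congr 1 with p
      ring
    rwa [hF'] at h
  · exact Eventually.of_forall fun w =>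
      (by fun_prop : Continuous fun p : ℝ => cexp (-(2 * π * I * p * w)) * η p).aestronglyMeasurable
  · refine (hηi.norm.const_mul (Real.exp (2 * π * S * |w₀.im|))).mono'
      (by fun_prop : Continuous fun p : ℝ =>
        cexp (-(2 * π * I * p * w₀)) * η p).aestronglyMeasurable (Eventually.of_forall fun p => ?_)
    rw [norm_mul, norm_cexp_extKernel]
    by_cases hp : η p = 0
    · simp [hp]
    · refine mul_le_mul_of_nonneg_right (Real.exp_le_exp.mpr ?_) (norm_nonneg _)
      calc 2 * π * p * w₀.im ≤ |2 * π * p * w₀.im| := le_abs_self _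
        _ = 2 * π * |p| * |w₀.im| := by
          rw [abs_mul, abs_mul, abs_mul, abs_two, abs_of_pos Real.pi_pos]
        _ ≤ 2 * π * S * |w₀.im| := by gcongr; exact hS p hp
  · exact (by fun_prop : Continuous fun p : ℝ =>
      -(2 * π * I * p) * cexp (-(2 * π * I * p * w₀)) * η p).aestronglyMeasurable
  · refine Eventually.of_forall fun p w hw => ?_
    rw [Metric.mem_ball, dist_eq_norm] at hw
    by_cases hp : η p = 0
    · simp [hp, hC]
    have hpS := hS p hp
    have him : |w.im| ≤ |w₀.im| + 1 := by
      have h1 : |w.im - w₀.im| < 1 := by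
        simpa using (abs_im_le_norm (w - w₀)).trans_lt hw
      have h2 := abs_sub_abs_le_abs_sub w.im w₀.im
      linarith
    rw [norm_mul, norm_mul, norm_cexp_extKernel, norm_neg]
    have hn : ‖2 * (π : ℂ) * I * p‖ = 2 * π * |p| := by
      simp [abs_of_pos Real.pi_pos]
    rw [hn, hC]
    have hexp : Real.exp (2 * π * p * w.im) ≤ Real.exp (2 * π * S * (|w₀.im| + 1)) := by
      refine Real.exp_le_exp.mpr ?_
      calc 2 * π * p * w.im ≤ |2 * π * p * w.im| := le_abs_self _
        _ = 2 * π * |p| * |w.im| := by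
          rw [abs_mul, abs_mul, abs_mul, abs_two, abs_of_pos Real.pi_pos]
        _ ≤ 2 * π * S * (|w₀.im| + 1) := by gcongr
    calc 2 * π * |p| * Real.exp (2 * π * p * w.im) * ‖η p‖
        ≤ 2 * π * S * Real.exp (2 * π * S * (|w₀.im| + 1)) * ‖η p‖ := by gcongr
      _ = _ := rfl
  · refine Eventually.of_forall fun p w _ => ?_
    have h1 := ((hasDerivAt_id w).const_mul (2 * π * I * p)).neg
    have h2 := (h1.cexp).mul_const (η p)
    simp only [id_eq, mul_one, Pi.neg_apply] at h2
    exact h2.congr_deriv (by ring)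

/-- The Fourier–Laplace extension of a continuous compactly supported kernel is **entire**
(differentiation under the integral sign). [folklore] -/
theorem differentiable_extKernel {η : ℝ → ℂ} (hηc : Continuous η) (hηs : HasCompactSupport η) :
    Differentiable ℂ (extKernel η) := fun w =>
  (hasDerivAt_extKernel hηc hηs w).differentiableAt

/-- The **regularising factor** `ρ_s(w) = (1 - i s w)⁻²`, `s > 0`: analytic on `Im w > -1/s`,
bounded by `1` on the closed upper half-plane, and `O(1/(s² (Re w)²))` there. [folklore] -/
def rho (s : ℝ) (w : ℂ) : ℂ :=
  ((1 - I * s * w) ^ 2)⁻¹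

/-- `1 - isw ≠ 0` for `Im w ≥ 0`, `s > 0`. [folklore] -/
theorem one_sub_ne_zero_of_im {s : ℝ} (hs : 0 < s) {w : ℂ} (hw : 0 ≤ w.im) :
    1 - I * s * w ≠ 0 := by
  intro h
  have := congrArg Complex.re h
  simp only [sub_re, one_re, mul_re, I_re, ofReal_re, zero_mul, I_im, ofReal_im, mul_zero,
    sub_zero, one_mul, mul_im, zero_add, zero_re] at this
  nlinarith

/-- `|1 - isw|² = (1 + s Im w)² + (s Re w)²`. [folklore] -/
theorem normSq_one_sub (s : ℝ) (w : ℂ) :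
    Complex.normSq (1 - I * s * w) = (1 + s * w.im) ^ 2 + (s * w.re) ^ 2 := by
  rw [Complex.normSq_apply]
  simp only [sub_re, one_re, mul_re, I_re, ofReal_re, zero_mul, I_im, ofReal_im, mul_zero,
    sub_zero, one_mul, mul_im, zero_add, sub_im, one_im, zero_sub]
  ring

/-- `|1 - isw| ≥ 1` for `Im w ≥ 0`, `s > 0`. [folklore] -/
theorem one_le_norm_one_sub {s : ℝ} (hs : 0 < s) {w : ℂ} (hw : 0 ≤ w.im) :
    1 ≤ ‖1 - I * s * w‖ := by
  have h : 1 ≤ ‖1 - I * s * w‖ ^ 2 := by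
    rw [← Complex.normSq_eq_norm_sq, normSq_one_sub]
    nlinarith [sq_nonneg (s * w.re), mul_nonneg hs.le hw]
  nlinarith [norm_nonneg (1 - I * s * w)]

/-- `|ρ_s(w)| ≤ 1` on the closed upper half-plane. [folklore] -/
theorem norm_rho_le_one {s : ℝ} (hs : 0 < s) {w : ℂ} (hw : 0 ≤ w.im) : ‖rho s w‖ ≤ 1 := by
  rw [rho, norm_inv, norm_pow]
  exact inv_le_one_of_one_le₀ (one_le_pow₀ (one_le_norm_one_sub hs hw))

/-- Decay of the regularising factor along horizontal lines in the closed upper half-plane: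
`|ρ_s(w)| ≤ (1 + s⁻²) / (1 + (Re w)²)`. [folklore] -/
theorem norm_rho_le {s : ℝ} (hs : 0 < s) {w : ℂ} (hw : 0 ≤ w.im) :
    ‖rho s w‖ ≤ (1 + (s ^ 2)⁻¹) * (1 + w.re ^ 2)⁻¹ := by
  have hz : 1 + (s * w.re) ^ 2 ≤ ‖1 - I * s * w‖ ^ 2 := by
    rw [← Complex.normSq_eq_norm_sq, normSq_one_sub]
    nlinarith [mul_nonneg hs.le hw]
  have hpos : 0 < ‖1 - I * s * w‖ ^ 2 := lt_of_lt_of_le (by positivity) hz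
  have hs2 : 0 < s ^ 2 := by positivity
  have hre : (0 : ℝ) < 1 + w.re ^ 2 := by positivity
  rw [rho, norm_inv, norm_pow, ← div_eq_mul_inv, le_div_iff₀ hre, inv_mul_le_iff₀ hpos]
  calc 1 + w.re ^ 2 ≤ (1 + (s * w.re) ^ 2) * (1 + (s ^ 2)⁻¹) := by
        have : (1 + (s * w.re) ^ 2) * (1 + (s ^ 2)⁻¹) =
            1 + w.re ^ 2 + ((s * w.re) ^ 2 + (s ^ 2)⁻¹) := by
          field_simp
          ring
        rw [this]
        nlinarith [sq_nonneg (s * w.re), inv_nonneg.mpr hs2.le]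
    _ ≤ ‖1 - I * s * w‖ ^ 2 * (1 + (s ^ 2)⁻¹) := by gcongr

/-- `ρ_s` is complex differentiable at the points of the closed upper half-plane. [folklore] -/
theorem differentiableAt_rho {s : ℝ} (hs : 0 < s) {w : ℂ} (hw : 0 ≤ w.im) :
    DifferentiableAt ℂ (rho s) w := by
  unfold rho
  have h1 : DifferentiableAt ℂ (fun w : ℂ => (1 - I * s * w) ^ 2) w := by fun_prop
  exact h1.inv (pow_ne_zero 2 (one_sub_ne_zero_of_im hs hw))

/-- `ρ_s` is continuous on the closed upper half-plane. [folklore] -/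
theorem continuousOn_rho {s : ℝ} (hs : 0 < s) : ContinuousOn (rho s) {w : ℂ | 0 ≤ w.im} :=
  fun _ hw => (differentiableAt_rho hs hw).continuousAt.continuousWithinAt

/-- `ρ_{1/(n+1)}(u) → 1` as `n → ∞`, for real `u`. [folklore] -/
theorem rho_ofReal_tendsto (u : ℝ) :
    Tendsto (fun n : ℕ => rho (1 / ((n : ℝ) + 1)) u) atTop (𝓝 1) := by
  have hc : Tendsto (fun n : ℕ => (1 : ℝ) / ((n : ℝ) + 1)) atTop (𝓝 0) :=
    tendsto_one_div_add_atTop_nhds_zero_nat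
  have hne : ∀ s : ℝ, (1 - I * s * u) ^ 2 ≠ 0 := fun s => pow_ne_zero 2 (by
    intro h
    have := congrArg Complex.re h
    simp at this)
  have hcont : Continuous fun s : ℝ => rho s u :=
    (by fun_prop : Continuous fun s : ℝ => (1 - I * s * u) ^ 2).inv₀ hne
  have h0 : rho 0 u = 1 := by simp [rho]
  have := (hcont.tendsto 0).comp hc
  rwa [h0] at this

/-- **Kernels with negative spectral support annihilate the boundary values of bounded analytic
functions on the upper half-plane** (the easy half of the Paley–Wiener theorem for bounded
functions): if `F` is continuous and bounded on `Im z ≥ 0` and analytic in `Im z > 0`, and the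
Schwartz symbol `η` has compact support in `(-∞, -ε]`, `ε > 0`, then `∫ 𝓕η(u) F(u) du = 0`. Proof:
with `K` the Fourier–Laplace extension of `𝓕η` (`|K(w)| ≤ e^{-2πε Im w} ‖η‖₁`) and the regularising
factor `ρ_s(w) = (1 - isw)⁻²`, Cauchy's theorem on the rectangles `[-R, R] × [0, Y]` for `K F ρ_s`
gives, as `R → ∞` and then `Y → ∞`, `∫ K F ρ_s = 0` on the real axis; finally `s → 0` by dominated
convergence. This is the mechanism by which the spectrum condition follows from analyticity in
Bratteli–Robinson II Prop. 5.3.19 (analytic form ⇒ generator form); cf. Bratteli–Robinson I §3.2.3.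
[folklore] -/
theorem integral_fourier_mul_eq_zero_of_analytic {F : ℂ → ℂ}
    (hFc : ContinuousOn F {z | 0 ≤ z.im}) (hFd : DifferentiableOn ℂ F {z | 0 < z.im})
    {M : ℝ} (hM : ∀ z : ℂ, 0 ≤ z.im → ‖F z‖ ≤ M) (η : 𝓢(ℝ, ℂ))
    (hηs : HasCompactSupport (η : ℝ → ℂ)) {ε : ℝ} (hε : 0 < ε)
    (hsupp : ∀ p : ℝ, -ε < p → η p = 0) :
    ∫ u : ℝ, 𝓕 (η : ℝ → ℂ) u * F u = 0 := by
  -- the extended kernel and its bounds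
  set K : ℂ → ℂ := extKernel η with hKdef
  have hK : Differentiable ℂ K := differentiable_extKernel η.continuous hηs
  set L : ℝ := ∫ p, ‖η p‖ with hL
  have hL0 : 0 ≤ L := integral_nonneg fun p => norm_nonneg _
  have hKb : ∀ w : ℂ, 0 ≤ w.im → ‖K w‖ ≤ Real.exp (-(2 * π * ε * w.im)) * L := fun w hw =>
    norm_extKernel_le η.integrable hsupp hw
  have hKb' : ∀ w : ℂ, 0 ≤ w.im → ‖K w‖ ≤ L := fun w hw =>
    (hKb w hw).trans (mul_le_of_le_one_left hL0 (Real.exp_le_one_iff.mpr (by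
      have : 0 ≤ 2 * π * ε * w.im := by positivity
      linarith)))
  have hM0 : 0 ≤ M := (norm_nonneg _).trans (hM 0 (le_refl _))
  have hFc' : Continuous fun x : ℝ => F x :=
    hFc.comp_continuous continuous_ofReal fun x => by simp
  -- the regularised integrand
  set f : ℝ → ℂ → ℂ := fun s w => K w * F w * rho s w with hf
  have hfb : ∀ {s : ℝ}, 0 < s → ∀ w : ℂ, 0 ≤ w.im →
      ‖f s w‖ ≤ Real.exp (-(2 * π * ε * w.im)) * L * M * ((1 + (s ^ 2)⁻¹) * (1 + w.re ^ 2)⁻¹) := by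
    intro s hs w hw
    rw [hf, norm_mul, norm_mul]
    have h1 := hKb w hw
    have h2 := hM w hw
    have h3 := norm_rho_le hs hw
    have h4 : 0 ≤ Real.exp (-(2 * π * ε * w.im)) * L := by positivity
    calc ‖K w‖ * ‖F w‖ * ‖rho s w‖ ≤ (Real.exp (-(2 * π * ε * w.im)) * L) * M *
          ((1 + (s ^ 2)⁻¹) * (1 + w.re ^ 2)⁻¹) := by gcongr
      _ = _ := by ring
  have hfc : ∀ {s : ℝ}, 0 < s → ContinuousOn (f s) {w : ℂ | 0 ≤ w.im} := fun hs =>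
    (hK.continuous.continuousOn.mul hFc).mul (continuousOn_rho hs)
  have hfd : ∀ {s : ℝ}, 0 < s → DifferentiableOn ℂ (f s) {w : ℂ | 0 < w.im} := fun hs =>
    (hK.differentiableOn.mul hFd).mul fun w hw =>
      (differentiableAt_rho hs (le_of_lt hw)).differentiableWithinAt
  -- integrability along horizontal lines `Im w = Y ≥ 0`
  have hdom : ∀ {s : ℝ}, 0 < s → Integrable fun x : ℝ => L * M * (1 + (s ^ 2)⁻¹) * (1 + x ^ 2)⁻¹ :=
    fun hs => integrable_inv_one_add_sq.const_mul _
  have hfi : ∀ {s : ℝ}, 0 < s → ∀ {Y : ℝ}, 0 ≤ Y → Integrable fun x : ℝ => f s (x + Y * I) := by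
    intro s hs Y hY
    have him : ∀ x : ℝ, ((x : ℂ) + Y * I).im = Y := fun x => by simp
    have hre : ∀ x : ℝ, ((x : ℂ) + Y * I).re = x := fun x => by simp
    refine (hdom hs).mono' ?_ (Eventually.of_forall fun x => ?_)
    · have hcx : Continuous ((f s) ∘ fun x : ℝ => (x : ℂ) + Y * I) :=
        (hfc hs).comp_continuous (by fun_prop : Continuous fun x : ℝ => (x : ℂ) + Y * I)
          fun x => by simp [hY]
      exact hcx.aestronglyMeasurable
    · refine (hfb hs _ (by rw [him]; exact hY)).trans ?_
      rw [hre, him]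
      have : Real.exp (-(2 * π * ε * Y)) ≤ 1 := Real.exp_le_one_iff.mpr (by
        have : 0 ≤ 2 * π * ε * Y := by positivity
        linarith)
      have h5 : 0 ≤ L * M * ((1 + (s ^ 2)⁻¹) * (1 + x ^ 2)⁻¹) := by positivity
      calc Real.exp (-(2 * π * ε * Y)) * L * M * ((1 + (s ^ 2)⁻¹) * (1 + x ^ 2)⁻¹)
          = Real.exp (-(2 * π * ε * Y)) * (L * M * ((1 + (s ^ 2)⁻¹) * (1 + x ^ 2)⁻¹)) := by ring
        _ ≤ 1 * (L * M * ((1 + (s ^ 2)⁻¹) * (1 + x ^ 2)⁻¹)) := by gcongr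
        _ = _ := by ring
  -- Step 1: for `s > 0` and `Y > 0`, `∫ f s = ∫ f s (· + iY)` over the real line
  have step1 : ∀ {s : ℝ}, 0 < s → ∀ {Y : ℝ}, 0 < Y →
      ∫ x : ℝ, f s x = ∫ x : ℝ, f s (x + Y * I) := by
    intro s hs Y hY
    have hnat : Tendsto (fun n : ℕ => (n : ℝ) + 1) atTop atTop :=
      tendsto_natCast_atTop_atTop.atTop_add tendsto_const_nhds
    -- the rectangle identity
    have rect : ∀ n : ℕ,
        (∫ x in (-((n : ℝ) + 1))..((n : ℝ) + 1), f s x) -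
          (∫ x in (-((n : ℝ) + 1))..((n : ℝ) + 1), f s (x + Y * I)) +
          I • (∫ y in (0 : ℝ)..Y, f s ((((n : ℝ) + 1 : ℝ) : ℂ) + y * I)) -
          I • (∫ y in (0 : ℝ)..Y, f s (((-((n : ℝ) + 1) : ℝ) : ℂ) + y * I)) = 0 := by
      intro n
      have h := Complex.integral_boundary_rect_eq_zero_of_continuousOn_of_differentiableOn (f s)
        ((-((n : ℝ) + 1) : ℝ) : ℂ) ((((n : ℝ) + 1 : ℝ) : ℂ) + Y * I) ?_ ?_
      · simpa using h
      · refine (hfc hs).mono fun q hq => ?_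
        rw [mem_reProdIm] at hq
        have h2 := hq.2
        simp only [ofReal_im, add_im, mul_im, ofReal_re, I_im, mul_one, I_re, mul_zero, add_zero,
          zero_add, uIcc_of_le hY.le, mem_Icc] at h2
        exact h2.1
      · refine (hfd hs).mono fun q hq => ?_
        rw [mem_reProdIm] at hq
        have h2 := hq.2
        simp only [ofReal_im, add_im, mul_im, ofReal_re, I_im, mul_one, I_re, mul_zero, add_zero,
          zero_add, min_eq_left hY.le, max_eq_right hY.le, mem_Ioo] at h2
        exact h2.1
    -- limits of the four sides
    have hbot : Tendsto (fun n : ℕ => ∫ x in (-((n : ℝ) + 1))..((n : ℝ) + 1), f s x) atTop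
        (𝓝 (∫ x : ℝ, f s x)) := by
      have hi := hfi hs (le_refl (0 : ℝ))
      simp only [ofReal_zero, zero_mul, add_zero] at hi
      exact intervalIntegral_tendsto_integral hi (tendsto_neg_atTop_atBot.comp hnat) hnat
    have htop : Tendsto (fun n : ℕ => ∫ x in (-((n : ℝ) + 1))..((n : ℝ) + 1), f s (x + Y * I))
        atTop (𝓝 (∫ x : ℝ, f s (x + Y * I))) :=
      intervalIntegral_tendsto_integral (hfi hs hY.le) (tendsto_neg_atTop_atBot.comp hnat) hnat
    have hvert : ∀ σ : ℝ, (σ = 1 ∨ σ = -1) → Tendsto (fun n : ℕ =>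
        I • ∫ y in (0 : ℝ)..Y, f s (((σ * ((n : ℝ) + 1) : ℝ) : ℂ) + y * I)) atTop (𝓝 0) := by
      intro σ hσ
      have hσ2 : σ ^ 2 = 1 := by rcases hσ with h | h <;> simp [h]
      rw [tendsto_zero_iff_norm_tendsto_zero]
      have hbound : ∀ n : ℕ, ‖I • ∫ y in (0 : ℝ)..Y, f s (((σ * ((n : ℝ) + 1) : ℝ) : ℂ) + y * I)‖ ≤
          L * M * (1 + (s ^ 2)⁻¹) * (1 + ((n : ℝ) + 1) ^ 2)⁻¹ * |Y - 0| := by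
        intro n
        rw [norm_smul, Complex.norm_I, one_mul]
        refine intervalIntegral.norm_integral_le_of_norm_le_const fun y hy => ?_
        rw [uIoc_of_le hY.le, mem_Ioc] at hy
        obtain ⟨hy0, -⟩ := hy
        have him : ((((σ * ((n : ℝ) + 1)) : ℝ) : ℂ) + y * I).im = y := by simp
        have hre : ((((σ * ((n : ℝ) + 1)) : ℝ) : ℂ) + y * I).re = σ * ((n : ℝ) + 1) := by simp
        refine (hfb hs _ (by rw [him]; exact hy0.le)).trans ?_
        rw [him, hre, mul_pow, hσ2, one_mul]
        have : Real.exp (-(2 * π * ε * y)) ≤ 1 := Real.exp_le_one_iff.mpr (by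
          have : 0 ≤ 2 * π * ε * y := by positivity
          linarith)
        have h5 : 0 ≤ L * M * ((1 + (s ^ 2)⁻¹) * (1 + ((n : ℝ) + 1) ^ 2)⁻¹) := by positivity
        calc Real.exp (-(2 * π * ε * y)) * L * M * ((1 + (s ^ 2)⁻¹) * (1 + ((n : ℝ) + 1) ^ 2)⁻¹)
            = Real.exp (-(2 * π * ε * y)) * (L * M * ((1 + (s ^ 2)⁻¹) *
                (1 + ((n : ℝ) + 1) ^ 2)⁻¹)) := by ring
          _ ≤ 1 * (L * M * ((1 + (s ^ 2)⁻¹) * (1 + ((n : ℝ) + 1) ^ 2)⁻¹)) := by gcongr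
          _ = _ := by ring
      have hlim : Tendsto
          (fun n : ℕ => L * M * (1 + (s ^ 2)⁻¹) * (1 + ((n : ℝ) + 1) ^ 2)⁻¹ * |Y - 0|)
          atTop (𝓝 (L * M * (1 + (s ^ 2)⁻¹) * 0 * |Y - 0|)) := by
        refine ((tendsto_const_nhds.mul ?_).mul tendsto_const_nhds)
        refine tendsto_inv_atTop_zero.comp ?_
        exact tendsto_atTop_add_const_left _ _ ((tendsto_pow_atTop two_ne_zero).comp hnat)
      rw [mul_zero, zero_mul] at hlim
      exact squeeze_zero (fun n => norm_nonneg _) hbound hlim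
    have hv1 := hvert 1 (Or.inl rfl)
    have hv2 := hvert (-1) (Or.inr rfl)
    simp only [one_mul, neg_mul] at hv1 hv2
    have hall := ((hbot.sub htop).add hv1).sub hv2
    have hzero : (fun n : ℕ => (∫ x in (-((n : ℝ) + 1))..((n : ℝ) + 1), f s x) -
        (∫ x in (-((n : ℝ) + 1))..((n : ℝ) + 1), f s (x + Y * I)) +
        I • (∫ y in (0 : ℝ)..Y, f s ((((n : ℝ) + 1 : ℝ) : ℂ) + y * I)) -
        I • (∫ y in (0 : ℝ)..Y, f s (((-((n : ℝ) + 1) : ℝ) : ℂ) + y * I))) = fun _ => 0 :=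
      funext rect
    rw [hzero] at hall
    have := tendsto_nhds_unique hall tendsto_const_nhds
    simp only [add_zero, sub_zero] at this
    exact sub_eq_zero.mp this
  -- Step 2: `∫ f s = 0` on the real axis, letting `Y → ∞`
  have step2 : ∀ {s : ℝ}, 0 < s → ∫ x : ℝ, f s x = 0 := by
    intro s hs
    have hbound : ∀ m : ℕ, ‖∫ x : ℝ, f s x‖ ≤
        Real.exp (-(2 * π * ε * ((m : ℝ) + 1))) * (L * M * (1 + (s ^ 2)⁻¹) * π) := by
      intro m
      have hY : (0 : ℝ) < (m : ℝ) + 1 := by positivity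
      set C₀ : ℝ := Real.exp (-(2 * π * ε * ((m : ℝ) + 1))) * (L * M * (1 + (s ^ 2)⁻¹)) with hC₀
      have hB : ‖∫ x : ℝ, f s (x + (((m : ℝ) + 1 : ℝ) : ℂ) * I)‖ ≤ ∫ x : ℝ, C₀ * (1 + x ^ 2)⁻¹ := by
        refine norm_integral_le_of_norm_le (integrable_inv_one_add_sq.const_mul C₀)
          (Eventually.of_forall fun x => ?_)
        have him : ((x : ℂ) + (((m : ℝ) + 1 : ℝ) : ℂ) * I).im = (m : ℝ) + 1 := by simp
        have hre : ((x : ℂ) + (((m : ℝ) + 1 : ℝ) : ℂ) * I).re = x := by simp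
        refine (hfb hs _ (by rw [him]; exact hY.le)).trans (le_of_eq ?_)
        rw [him, hre, hC₀]
        ring
      rw [integral_const_mul, integral_univ_inv_one_add_sq] at hB
      rw [step1 hs hY]
      calc ‖∫ x : ℝ, f s (x + (((m : ℝ) + 1 : ℝ) : ℂ) * I)‖ ≤ C₀ * π := hB
        _ = _ := by rw [hC₀]; ring
    have hlim : Tendsto (fun m : ℕ => Real.exp (-(2 * π * ε * ((m : ℝ) + 1))) *
        (L * M * (1 + (s ^ 2)⁻¹) * π)) atTop (𝓝 (0 * (L * M * (1 + (s ^ 2)⁻¹) * π))) := by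
      refine Tendsto.mul_const _ ?_
      refine Real.tendsto_exp_atBot.comp ?_
      refine tendsto_neg_atTop_atBot.comp ?_
      exact (tendsto_natCast_atTop_atTop.atTop_add tendsto_const_nhds).const_mul_atTop
        (by positivity)
    rw [zero_mul] at hlim
    have h0 : ‖∫ x : ℝ, f s x‖ ≤ 0 := ge_of_tendsto' hlim hbound
    exact norm_le_zero_iff.mp h0
  -- Step 3: `s → 0`
  have hKF : Integrable fun x : ℝ => K x * F x := by
    have hi : Integrable fun x : ℝ => 𝓕 (η : ℝ → ℂ) x := by
      rw [← SchwartzMap.fourier_coe]; exact (𝓕 η).integrable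
    refine (hi.norm.mul_const M).mono' ((hK.continuous.comp continuous_ofReal).mul
      hFc').aestronglyMeasurable (Eventually.of_forall fun x => ?_)
    rw [norm_mul, hKdef, extKernel_ofReal]
    gcongr
    exact hM x (by simp)
  have hlim3 : Tendsto (fun n : ℕ => ∫ x : ℝ, f (1 / ((n : ℝ) + 1)) x) atTop
      (𝓝 (∫ x : ℝ, K x * F x)) := by
    have h1 : (fun x : ℝ => K x * F x) = fun x : ℝ => K x * F x * 1 := by simp
    rw [h1]
    refine tendsto_integral_of_dominated_convergence (fun x : ℝ => ‖K x * F x‖) (fun n => ?_)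
      hKF.norm (fun n => Eventually.of_forall fun x => ?_) (Eventually.of_forall fun x => ?_)
    · have hs : (0 : ℝ) < 1 / ((n : ℝ) + 1) := by positivity
      have hi := hfi hs (le_refl (0 : ℝ))
      simp only [ofReal_zero, zero_mul, add_zero] at hi
      exact hi.aestronglyMeasurable
    · rw [hf, norm_mul]
      exact mul_le_of_le_one_right (norm_nonneg _) (norm_rho_le_one (by positivity) (by simp))
    · exact Tendsto.const_mul _ (rho_ofReal_tendsto x)
  have hzero : (fun n : ℕ => ∫ x : ℝ, f (1 / ((n : ℝ) + 1)) x) = fun _ => 0 :=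
    funext fun n => step2 (by positivity)
  rw [hzero] at hlim3
  have := tendsto_nhds_unique hlim3 tendsto_const_nhds
  rw [← this]
  congr 1 with x
  rw [hKdef, extKernel_ofReal]

end PaleyWiener


/-! ### The spectral pairing of an orbit function with a symbol -/

section SpectralPairing

/-- The **spectral pairing** `Λ_φ(η) = ∫ 𝓕η(u) φ(u) du` of a bounded continuous function `φ`
(an orbit function `u ↦ ω(a⋆ τ_u(b))`) with a Schwartz symbol `η`; formally `∫ η dμ_φ` for the
spectral measure `μ_φ` of `φ` (Bratteli–Robinson I §3.2.3). [folklore] -/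
def specPair (φ : ℝ → ℂ) (η : 𝓢(ℝ, ℂ)) : ℂ :=
  ∫ u, 𝓕 (η : ℝ → ℂ) u * φ u

/-- Unfolding of `specPair`. [folklore] -/
theorem specPair_def (φ : ℝ → ℂ) (η : 𝓢(ℝ, ℂ)) :
    specPair φ η = ∫ u, 𝓕 (η : ℝ → ℂ) u * φ u := rfl

/-- `𝓕η · φ` is integrable for a bounded continuous `φ`. [folklore] -/
theorem integrable_fourier_mul {φ : ℝ → ℂ} (hφ : Continuous φ) {B : ℝ} (hB : ∀ u, ‖φ u‖ ≤ B)
    (η : 𝓢(ℝ, ℂ)) : Integrable fun u => 𝓕 (η : ℝ → ℂ) u * φ u :=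
  (integrable_fourier_schwartz η).mul_bdd hφ.aestronglyMeasurable (Eventually.of_forall hB)

/-- The spectral pairing is additive in the symbol. [folklore] -/
theorem specPair_add {φ : ℝ → ℂ} (hφ : Continuous φ) {B : ℝ} (hB : ∀ u, ‖φ u‖ ≤ B)
    (η₁ η₂ : 𝓢(ℝ, ℂ)) : specPair φ (η₁ + η₂) = specPair φ η₁ + specPair φ η₂ := by
  simp only [specPair_def, ← integral_add (integrable_fourier_mul hφ hB η₁)
    (integrable_fourier_mul hφ hB η₂), ← add_mul]
  congr 1 with u
  congr 1
  change (𝓕 (η₁ + η₂)) u = (𝓕 η₁) u + (𝓕 η₂) u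
  rw [FourierTransform.fourier_add]
  rfl

/-- The spectral pairing is additive in the symbol (subtraction). [folklore] -/
theorem specPair_sub {φ : ℝ → ℂ} (hφ : Continuous φ) {B : ℝ} (hB : ∀ u, ‖φ u‖ ≤ B)
    (η₁ η₂ : 𝓢(ℝ, ℂ)) : specPair φ (η₁ - η₂) = specPair φ η₁ - specPair φ η₂ := by
  rw [eq_sub_iff_add_eq, ← specPair_add hφ hB, sub_add_cancel]

/-- The spectral pairing is homogeneous in the symbol. [folklore] -/
theorem specPair_smul (φ : ℝ → ℂ) (c : ℂ) (η : 𝓢(ℝ, ℂ)) :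
    specPair φ (c • η) = c * specPair φ η := by
  simp only [specPair_def, ← integral_const_mul, ← mul_assoc]
  congr 1 with u
  congr 1
  change (𝓕 (c • η)) u = c * (𝓕 η) u
  rw [FourierTransform.fourier_smul]
  rfl

/-- The spectral pairing vanishes on symbols with **negative spectral support** as soon as `φ`
is the boundary value of a bounded analytic function on the upper half-plane
(`integral_fourier_mul_eq_zero_of_analytic`). [folklore] -/
theorem specPair_eq_zero_of_analytic {φ : ℝ → ℂ} {F : ℂ → ℂ}
    (hFc : ContinuousOn F {z | 0 ≤ z.im}) (hFd : DifferentiableOn ℂ F {z | 0 < z.im})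
    (hFb : ∃ C, ∀ z ∈ {z : ℂ | 0 ≤ z.im}, ‖F z‖ ≤ C) (hFφ : ∀ t : ℝ, F t = φ t) (η : 𝓢(ℝ, ℂ))
    (hηs : HasCompactSupport (η : ℝ → ℂ)) {ε : ℝ} (hε : 0 < ε)
    (hsupp : ∀ p : ℝ, -ε < p → η p = 0) : specPair φ η = 0 := by
  obtain ⟨M, hM⟩ := hFb
  rw [specPair_def]
  have h := integral_fourier_mul_eq_zero_of_analytic hFc hFd (fun z hz => hM z hz) η hηs hε hsupp
  simpa only [hFφ] using h

end SpectralPairing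

/-! ### Squares of symbols and positivity of the spectral pairing -/

section Positivity

open scoped ContDiff in
/-- `conj ∘ σ` is smooth for a Schwartz symbol `σ`. [folklore] -/
theorem contDiff_conj_comp (σ : 𝓢(ℝ, ℂ)) : ContDiff ℝ ∞ fun p => conj (σ p) :=
  Complex.conjCLE.contDiff.comp (σ.smooth ⊤)

/-- The **mixed square** `conj σ₁ · σ₂` of two symbols (`σ₂` compactly supported). [folklore] -/
def conjMulSymb (σ₁ σ₂ : 𝓢(ℝ, ℂ)) (hσ₂ : HasCompactSupport (σ₂ : ℝ → ℂ)) : 𝓢(ℝ, ℂ) :=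
  cutMul (fun p => conj (σ₁ p)) (contDiff_conj_comp σ₁) σ₂ hσ₂

/-- The values of `conjMulSymb`. [folklore] -/
@[simp]
theorem conjMulSymb_apply (σ₁ σ₂ : 𝓢(ℝ, ℂ)) (hσ₂ : HasCompactSupport (σ₂ : ℝ → ℂ)) (p : ℝ) :
    conjMulSymb σ₁ σ₂ hσ₂ p = conj (σ₁ p) * σ₂ p := rfl

variable [PartialOrder A] [StarOrderedRing A] {τ : ℝ → (A ≃⋆ₐ[ℂ] A)}

/-- **The spectral pairing of a mixed square is a two-point function of smeared elements**:
for a `τ`-invariant state, `Λ_{a,b}(conj σ₁ · σ₂) = ω((τ_{𝓕σ₁} a)⋆ τ_{𝓕σ₂} b)` (correlation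
identity and kernel calculus). This emulates `⟨σ₁(H)ξ, σ₂(H)η⟩` of the spectral calculus in
Bratteli–Robinson II Prop. 5.3.19. [folklore] -/
theorem _root_.Literature.MathematicalPhysics.QuantumLattice.State.specPair_conjMulSymb (ω : Literature.MathematicalPhysics.QuantumLattice.State A) (hτ : Literature.MathematicalPhysics.QuantumLattice.IsAutomorphismGroup τ)
    (hinv : ∀ (t : ℝ) (a : A), ω (τ t a) = ω a) (σ₁ σ₂ : 𝓢(ℝ, ℂ))
    (hσ₂ : HasCompactSupport (σ₂ : ℝ → ℂ)) (a b : A) :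
    specPair (fun u => ω (star a * τ u b)) (conjMulSymb σ₁ σ₂ hσ₂) =
      ω (star (smear τ (𝓕 (σ₁ : ℝ → ℂ)) a) * smear τ (𝓕 (σ₂ : ℝ → ℂ)) b) := by
  rw [ω.apply_star_smear_mul_smear hτ hinv (continuous_fourier_schwartz σ₁)
    (integrable_fourier_schwartz σ₁) (continuous_fourier_schwartz σ₂)
    (integrable_fourier_schwartz σ₂), specPair_def]
  congr 1 with u
  congr 1
  rw [corrKernel_def, integral_conj_fourier_mul_fourier_add]
  rfl

/-- **Positivity**: `Λ_{a,a}(|σ|²) = ω(x⋆ x) ≥ 0` with `x = τ_{𝓕σ}(a)`; in particular it is real,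
nonnegative and bounded by `‖x‖²`. [folklore] -/
theorem _root_.Literature.MathematicalPhysics.QuantumLattice.State.specPair_sq (ω : Literature.MathematicalPhysics.QuantumLattice.State A) (hτ : Literature.MathematicalPhysics.QuantumLattice.IsAutomorphismGroup τ)
    (hinv : ∀ (t : ℝ) (a : A), ω (τ t a) = ω a) (σ : 𝓢(ℝ, ℂ))
    (hσ : HasCompactSupport (σ : ℝ → ℂ)) (a : A) :
    (specPair (fun u => ω (star a * τ u a)) (conjMulSymb σ σ hσ)).im = 0 ∧
      0 ≤ (specPair (fun u => ω (star a * τ u a)) (conjMulSymb σ σ hσ)).re ∧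
      (specPair (fun u => ω (star a * τ u a)) (conjMulSymb σ σ hσ)).re ≤
        ‖smear τ (𝓕 (σ : ℝ → ℂ)) a‖ ^ 2 := by
  rw [ω.specPair_conjMulSymb hτ hinv σ σ hσ a a]
  set x := smear τ (𝓕 (σ : ℝ → ℂ)) a
  have hpos : 0 ≤ ω (star x * x) := ω.map_nonneg (star_mul_self_nonneg x)
  refine ⟨(Complex.nonneg_iff.mp hpos).2.symm, (Complex.nonneg_iff.mp hpos).1, ?_⟩
  calc (ω (star x * x)).re ≤ ‖ω (star x * x)‖ := Complex.re_le_norm _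
    _ ≤ ‖star x * x‖ := Literature.MathematicalPhysics.QuantumLattice.State.norm_apply_le_norm_holds ω _
    _ ≤ ‖star x‖ * ‖x‖ := norm_mul_le _ _
    _ = ‖x‖ ^ 2 := by rw [norm_star, sq]

end Positivity

/-! ### The generator through the spectral pairing -/

section Generator

open scoped ContDiff in
/-- The **first-moment square** symbol `p ↦ p conj(σ p) σ p` (formally `H |σ|²(H) / 2π`).
[folklore] -/
def momConjMulSymb (σ : 𝓢(ℝ, ℂ)) (hσ : HasCompactSupport (σ : ℝ → ℂ)) : 𝓢(ℝ, ℂ) :=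
  cutMul (fun p : ℝ => (p : ℂ) * conj (σ p))
    (Complex.ofRealCLM.contDiff.mul (contDiff_conj_comp σ)) σ hσ

/-- The values of `momConjMulSymb`. [folklore] -/
@[simp]
theorem momConjMulSymb_apply (σ : 𝓢(ℝ, ℂ)) (hσ : HasCompactSupport (σ : ℝ → ℂ)) (p : ℝ) :
    momConjMulSymb σ hσ p = p * conj (σ p) * σ p := rfl

open scoped ContDiff in
/-- The derivative symbol `p ↦ -2πi p conj(σ p) σ p` of the square `|σ|²`. [folklore] -/
def derivConjMulSymb (σ : 𝓢(ℝ, ℂ)) (hσ : HasCompactSupport (σ : ℝ → ℂ)) : 𝓢(ℝ, ℂ) :=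
  cutMul (fun p : ℝ => -2 * π * I * p * conj (σ p))
    ((contDiff_const.mul Complex.ofRealCLM.contDiff).mul (contDiff_conj_comp σ)) σ hσ

/-- `derivConjMulSymb σ = -2πi · momConjMulSymb σ`. [folklore] -/
theorem derivConjMulSymb_eq (σ : 𝓢(ℝ, ℂ)) (hσ : HasCompactSupport (σ : ℝ → ℂ)) :
    derivConjMulSymb σ hσ = (-2 * π * I) • momConjMulSymb σ hσ := by
  ext p
  simp only [derivConjMulSymb, cutMul_apply, smul_apply, momConjMulSymb_apply, smul_eq_mul]
  ring

variable [PartialOrder A] [StarOrderedRing A] {τ : ℝ → (A ≃⋆ₐ[ℂ] A)}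

/-- The orbit function `u ↦ ω(x τ_u(a))` of `a ∈ D(δ)` is differentiable, with derivative
`ω(x τ_u(δa))`. [folklore] -/
theorem _root_.Literature.MathematicalPhysics.QuantumLattice.State.hasDerivAt_apply_mul_aut (ω : Literature.MathematicalPhysics.QuantumLattice.State A) (hτ : Literature.MathematicalPhysics.QuantumLattice.IsAutomorphismGroup τ) (x : A)
    {a δa : A} (ha : HasDerivAt (fun t : ℝ => τ t a) δa 0) (u : ℝ) :
    HasDerivAt (fun t : ℝ => ω (x * τ t a)) (ω (x * τ u δa)) u := by
  set L : A →L[ℝ] ℂ :=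
    (ω.toContinuousLinearMap.comp (ContinuousLinearMap.mul ℂ A x)).restrictScalars ℝ with hL
  have h := (L.hasFDerivAt).comp_hasDerivAt u (hasDerivAt_aut_apply hτ ha u)
  have hL' : ∀ y : A, L y = ω (x * y) := fun y => rfl
  simp only [hL'] at h
  exact h

/-- **The generator through the spectral pairing.** For a `τ`-invariant state `ω`, `a ∈ D(δ)` with
`δ(a) = δa`, and a compactly supported symbol `σ` with kernel `k = 𝓕σ`,
`-i ω((τ_k a)⋆ τ_k(δa)) = 2π Λ_{a,a}(p |σ|²)`: the smeared generator acts as multiplication of the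
symbol by the spectral variable (formally `-i⟨σ(H)ξ, iH σ(H)ξ⟩ = ⟨ξ, H|σ|²(H) ξ⟩`; here by the
correlation identity, `(𝓕θ)' = 𝓕(-2πi p θ)` and an integration by parts). This is the identity
behind Bratteli–Robinson II Prop. 5.3.19 (generator condition versus spectrum condition). [folklore]
-/
theorem _root_.Literature.MathematicalPhysics.QuantumLattice.State.generator_specPair (ω : Literature.MathematicalPhysics.QuantumLattice.State A) (hτ : Literature.MathematicalPhysics.QuantumLattice.IsAutomorphismGroup τ)
    (hinv : ∀ (t : ℝ) (a : A), ω (τ t a) = ω a) (σ : 𝓢(ℝ, ℂ))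
    (hσ : HasCompactSupport (σ : ℝ → ℂ)) {a δa : A}
    (ha : HasDerivAt (fun t : ℝ => τ t a) δa 0) :
    -I * ω (star (smear τ (𝓕 (σ : ℝ → ℂ)) a) * smear τ (𝓕 (σ : ℝ → ℂ)) δa) =
      2 * π * specPair (fun u => ω (star a * τ u a)) (momConjMulSymb σ hσ) := by
  set φ : ℝ → ℂ := fun u => ω (star a * τ u a) with hφ
  set ψ : ℝ → ℂ := fun u => ω (star a * τ u δa) with hψ
  set C : ℝ → ℂ := 𝓕 (conjMulSymb σ σ hσ : ℝ → ℂ) with hC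
  set C' : ℝ → ℂ := 𝓕 (derivConjMulSymb σ hσ : ℝ → ℂ) with hC'
  -- Step 1: correlation identity with `b = δa`
  have h1 : ω (star (smear τ (𝓕 (σ : ℝ → ℂ)) a) * smear τ (𝓕 (σ : ℝ → ℂ)) δa) =
      ∫ u, C u * ψ u := by
    rw [ω.apply_star_smear_mul_smear hτ hinv (continuous_fourier_schwartz σ)
      (integrable_fourier_schwartz σ) (continuous_fourier_schwartz σ)
      (integrable_fourier_schwartz σ)]
    congr 1 with u
    congr 1
    rw [corrKernel_def, integral_conj_fourier_mul_fourier_add, hC]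
    rfl
  -- Step 2: integration by parts
  have hφd : ∀ u, HasDerivAt φ (ψ u) u := fun u => ω.hasDerivAt_apply_mul_aut hτ (star a) ha u
  have hCd : ∀ u, HasDerivAt C (C' u) u := fun u =>
    hasDerivAt_fourier_schwartz _ _ (fun p => by
      simp only [conjMulSymb_apply, derivConjMulSymb, cutMul_apply]; ring) u
  have hφc : Continuous φ := ω.continuous_apply_mul_aut hτ (star a) a
  have hψc : Continuous ψ := ω.continuous_apply_mul_aut hτ (star a) δa
  have hφb : ∀ u, ‖φ u‖ ≤ ‖a‖ * ‖a‖ := fun u => by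
    simpa only [hφ, norm_star] using ω.norm_apply_mul_aut_le (star a) a u
  have hψb : ∀ u, ‖ψ u‖ ≤ ‖a‖ * ‖δa‖ := fun u => by
    simpa only [hψ, norm_star] using ω.norm_apply_mul_aut_le (star a) δa u
  have hlim : ∀ l : Filter ℝ, l ≤ cocompact ℝ → Tendsto (C * φ) l (𝓝 0) := by
    intro l hl
    have hC0 : Tendsto C l (𝓝 0) := by
      have := (𝓕 (conjMulSymb σ σ hσ)).tendsto_cocompact
      exact this.mono_left hl
    refine squeeze_zero_norm (fun u => ?_) ((hC0.norm.mul_const (‖a‖ * ‖a‖)).trans_eq (by simp))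
    rw [Pi.mul_apply, norm_mul]
    gcongr
    exact hφb u
  have hibp := integral_mul_deriv_eq_deriv_mul (fun u _ => hCd u) (fun u _ => hφd u)
    (integrable_fourier_mul hψc hψb _) (integrable_fourier_mul hφc hφb _)
    (hlim atBot atBot_le_cocompact) (hlim atTop atTop_le_cocompact)
  simp only [sub_zero, zero_sub] at hibp
  -- Step 3: identify the derivative symbol
  have h3 : (∫ u, C' u * φ u) = (-2 * π * I) * specPair φ (momConjMulSymb σ hσ) := by
    rw [← specPair_smul, ← derivConjMulSymb_eq]
    rfl
  rw [h1, hibp, h3]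
  ring_nf
  rw [Complex.I_sq]
  ring

end Generator

/-! ### Analytic ground states are ground states in the generator form -/

section AnalyticImpliesGenerator

open scoped ContDiff in
/-- The **spectral decomposition of the first moment** at scale `ε > 0`: for a compactly supported
symbol `Θ` and the smooth step `ψ = ψ_ε` (`= 0` on `(-∞, -2ε]`, `= 1` on `[-ε, ∞)`),
`p |Θ|² = |√(p + 3ε) ψ Θ|² - 3ε |Θ|² + 3ε (1 - ψ²)|Θ|² + p (1 - ψ²)|Θ|²`, where the last two
symbols are supported in `(-∞, -ε]`. [folklore] -/
theorem momConjMulSymb_decomp (Θ : 𝓢(ℝ, ℂ)) (hΘ : HasCompactSupport (Θ : ℝ → ℂ)) {ε : ℝ}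
    (hε : 0 < ε) :
    ∃ (ρ ηB ηC : 𝓢(ℝ, ℂ)) (hρ : HasCompactSupport (ρ : ℝ → ℂ)),
      HasCompactSupport (ηB : ℝ → ℂ) ∧ HasCompactSupport (ηC : ℝ → ℂ) ∧
      (∀ p : ℝ, -ε < p → ηB p = 0) ∧ (∀ p : ℝ, -ε < p → ηC p = 0) ∧
      momConjMulSymb Θ hΘ = conjMulSymb ρ ρ hρ - (3 * ε : ℂ) • conjMulSymb Θ Θ hΘ +
        (3 * ε : ℂ) • ηC + ηB := by
  set ψ : ℝ → ℝ := stepFun ε with hψ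
  have hψc : ContDiff ℝ ∞ fun p : ℝ => (ψ p : ℂ) := Complex.ofRealCLM.contDiff.comp contDiff_stepFun
  set ρ : 𝓢(ℝ, ℂ) := cutMul (fun p : ℝ => ((Real.sqrt (p + 3 * ε) * ψ p : ℝ) : ℂ))
    (Complex.ofRealCLM.contDiff.comp (contDiff_sqrt_mul_stepFun hε)) Θ hΘ with hρdef
  have hρ : HasCompactSupport (ρ : ℝ → ℂ) := hasCompactSupport_cutMul _ _ _ hΘ
  set ηB : 𝓢(ℝ, ℂ) := cutMul (fun p : ℝ => (p : ℂ) * (1 - (ψ p : ℂ) ^ 2) * conj (Θ p))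
    (((Complex.ofRealCLM.contDiff).mul (contDiff_const.sub (hψc.pow 2))).mul
      (contDiff_conj_comp Θ)) Θ hΘ with hηBdef
  set ηC : 𝓢(ℝ, ℂ) := cutMul (fun p : ℝ => (1 - (ψ p : ℂ) ^ 2) * conj (Θ p))
    ((contDiff_const.sub (hψc.pow 2)).mul (contDiff_conj_comp Θ)) Θ hΘ with hηCdef
  have hψ1 : ∀ p : ℝ, -ε < p → ψ p = 1 := fun p hp => stepFun_of_ge hε hp.le
  refine ⟨ρ, ηB, ηC, hρ, hasCompactSupport_cutMul _ _ _ hΘ, hasCompactSupport_cutMul _ _ _ hΘ,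
    fun p hp => by simp [hηBdef, hψ1 p hp], fun p hp => by simp [hηCdef, hψ1 p hp], ?_⟩
  ext p
  simp only [momConjMulSymb_apply, add_apply, sub_apply, smul_apply, conjMulSymb_apply,
    hρdef, hηBdef, hηCdef, cutMul_apply, smul_eq_mul, map_mul, Complex.conj_ofReal]
  by_cases hψ0 : ψ p = 0
  · simp only [hψ0, mul_zero, Complex.ofReal_zero, zero_mul]
    ring
  · have hp : -(2 * ε) < p := (stepFun_pos_iff hε).mp (lt_of_le_of_ne (stepFun_nonneg ε p)
      (Ne.symm hψ0))
    have hs : (Real.sqrt (p + 3 * ε) : ℂ) ^ 2 = (p : ℂ) + 3 * ε := by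
      rw [← Complex.ofReal_pow, Real.sq_sqrt (by linarith)]
      push_cast
      ring
    push_cast
    linear_combination (-(conj (Θ p) * Θ p * (ψ p : ℂ) ^ 2)) * hs

variable [PartialOrder A] [StarOrderedRing A] {τ : ℝ → (A ≃⋆ₐ[ℂ] A)}

/-- **The key lower bound.** For an analytic ground state `ω` (τ-invariant, with
`Λ_{a,a}` vanishing on symbols supported in `(-∞, -ε]`) and a compactly supported symbol `Θ`:
`Λ_{a,a}(p |Θ|²)` is real and `≥ -3ε ‖τ_{𝓕Θ}(a)‖²`. [folklore] -/
theorem _root_.Literature.MathematicalPhysics.QuantumLattice.State.specPair_mom_re_ge (ω : Literature.MathematicalPhysics.QuantumLattice.State A) (hτ : Literature.MathematicalPhysics.QuantumLattice.IsAutomorphismGroup τ)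
    (hinv : ∀ (t : ℝ) (a : A), ω (τ t a) = ω a) (a : A) {ε : ℝ} (hε : 0 < ε)
    (hvan : ∀ (η : 𝓢(ℝ, ℂ)), HasCompactSupport (η : ℝ → ℂ) → (∀ p : ℝ, -ε < p → η p = 0) →
      specPair (fun u => ω (star a * τ u a)) η = 0)
    (Θ : 𝓢(ℝ, ℂ)) (hΘ : HasCompactSupport (Θ : ℝ → ℂ)) :
    (specPair (fun u => ω (star a * τ u a)) (momConjMulSymb Θ hΘ)).im = 0 ∧
      -(3 * ε * ‖smear τ (𝓕 (Θ : ℝ → ℂ)) a‖ ^ 2) ≤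
        (specPair (fun u => ω (star a * τ u a)) (momConjMulSymb Θ hΘ)).re := by
  set φ : ℝ → ℂ := fun u => ω (star a * τ u a) with hφ
  have hφc : Continuous φ := ω.continuous_apply_mul_aut hτ (star a) a
  have hφb : ∀ u, ‖φ u‖ ≤ ‖a‖ * ‖a‖ := fun u => by
    simpa only [hφ, norm_star] using ω.norm_apply_mul_aut_le (star a) a u
  obtain ⟨ρ, ηB, ηC, hρ, hηB, hηC, hB0, hC0, hdec⟩ := momConjMulSymb_decomp Θ hΘ hε
  have h1 := ω.specPair_sq hτ hinv ρ hρ a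
  have h2 := ω.specPair_sq hτ hinv Θ hΘ a
  rw [hdec, specPair_add hφc hφb, specPair_add hφc hφb, specPair_sub hφc hφb, specPair_smul,
    specPair_smul, hvan ηB hηB hB0, hvan ηC hηC hC0]
  have h3 : ((3 * ε : ℂ)) = ((3 * ε : ℝ) : ℂ) := by push_cast; ring
  rw [h3, mul_zero, add_zero, add_zero, sub_im, sub_re, Complex.im_ofReal_mul,
    Complex.re_ofReal_mul, h1.1, h2.1, mul_zero, sub_zero]
  refine ⟨rfl, ?_⟩
  nlinarith [h1.2.1, h2.2.2, hε]

/-- Continuity of `(x, y) ↦ -i ω(x⋆ y)` along convergent sequences. [folklore] -/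
theorem _root_.Literature.MathematicalPhysics.QuantumLattice.State.tendsto_neg_I_mul_apply_star_mul (ω : Literature.MathematicalPhysics.QuantumLattice.State A) {x y : ℕ → A} {a b : A}
    (hx : Tendsto x atTop (𝓝 a)) (hy : Tendsto y atTop (𝓝 b)) :
    Tendsto (fun n => -I * ω (star (x n) * y n)) atTop (𝓝 (-I * ω (star a * b))) := by
  have h1 : Tendsto (fun n => star (x n) * y n) atTop (𝓝 (star a * b)) := hx.star.mul hy
  have h2 : Tendsto (fun n => ω (star (x n) * y n)) atTop (𝓝 (ω (star a * b))) :=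
    (ω.toContinuousLinearMap.continuous.tendsto _).comp h1
  exact h2.const_mul _

/-- The set `{z | Im z = 0, c ≤ Re z}` is closed. [folklore] -/
theorem isClosed_im_eq_zero_re_ge (c : ℝ) : IsClosed {z : ℂ | z.im = 0 ∧ c ≤ z.re} :=
  (isClosed_eq Complex.continuous_im continuous_const).inter
    (isClosed_le continuous_const Complex.continuous_re)

/-- If `-(C ε) ≤ r` for all `ε > 0` (with `C ε → 0` linear in `ε`), then `0 ≤ r`. [folklore] -/
theorem re_nonneg_of_forall_eps {r K : ℝ} (h : ∀ ε : ℝ, 0 < ε → -(2 * π * (3 * ε * K)) ≤ r) :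
    0 ≤ r := by
  have ht : Tendsto (fun ε : ℝ => -(2 * π * (3 * ε * K))) (𝓝[>] 0)
      (𝓝 (-(2 * π * (3 * 0 * K)))) :=
    tendsto_nhdsWithin_of_tendsto_nhds ((by fun_prop : Continuous fun ε : ℝ =>
      -(2 * π * (3 * ε * K))).tendsto 0)
  simp only [mul_zero, zero_mul, neg_zero] at ht
  exact le_of_tendsto ht (eventually_nhdsWithin_of_forall fun ε hε => h ε hε)

/-- **Analytic ground states are ground states in the generator form** (Bratteli–Robinson II Prop.
5.3.19, analytic form ⇒ generator form, for genuine states of the C⋆-algebra `A`,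
`[StarOrderedRing A]`): if for all `a b` the function `t ↦ ω(a τ_t(b))` is the boundary value of a
bounded continuous function on `Im z ≥ 0`, analytic in `Im z > 0`, then `-i ω(a⋆ δ(a)) ≥ 0` for
every `a ∈ D(δ)`.

Proof (Stone/Bochner-free version of the printed argument through `H_ω ≥ 0`, cf. Sakai (1991)
Prop. 4.3.5 with `β = ∞`): `ω` is `τ`-invariant (`State.IsKMSGroundState.apply_dynamics`);
by the easy Paley–Wiener theorem (`integral_fourier_mul_eq_zero_of_analytic`) the spectral
pairing `Λ_{a,a}` of `u ↦ ω(a⋆ τ_u a)` kills symbols supported in `(-∞, -ε]`; smearing `a` and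
`δa` by the approximate identity `𝓕θ_n`, `θ_n = χ(·/(n+1))`, gives
`-i ω((τ_n a)⋆ τ_n(δa)) = 2π Λ_{a,a}(p θ_n²)` (`State.generator_specPair`), which is real and
`≥ -6πε ‖𝓕χ‖₁² ‖a‖²` by the spectral decomposition of the first moment and positivity
(`State.specPair_mom_re_ge`); let `n → ∞` and then `ε → 0`.
[cite: BratteliRobinsonII1997, Prop. 5.3.19] -/
theorem _root_.Literature.MathematicalPhysics.QuantumLattice.State.IsKMSGroundState.isGroundState (hτ : Literature.MathematicalPhysics.QuantumLattice.IsAutomorphismGroup τ) {ω : Literature.MathematicalPhysics.QuantumLattice.State A}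
    (h : ω.IsKMSGroundState τ) : ω.IsGroundState τ := by
  intro a δa ha
  have hinv : ∀ (t : ℝ) (x : A), ω (τ t x) = ω x := fun t x =>
    Literature.MathematicalPhysics.QuantumLattice.State.IsKMSGroundState.apply_dynamics hτ h t x
  obtain ⟨F, hFc, hFd, hFb, hF⟩ := h (star a) a
  have hvan : ∀ {ε : ℝ}, 0 < ε → ∀ (η : 𝓢(ℝ, ℂ)), HasCompactSupport (η : ℝ → ℂ) →
      (∀ p : ℝ, -ε < p → η p = 0) → specPair (fun u => ω (star a * τ u a)) η = 0 :=
    fun hε η hη hs => specPair_eq_zero_of_analytic hFc hFd hFb (fun t => hF t) η hη hε hs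
  -- the approximate identity `𝓕θ_n`, `θ_n = χ(·/(n+1))`
  obtain ⟨χ, hχ⟩ : ∃ χ : 𝓢(ℝ, ℂ), χ = bumpSymb 1 one_pos := ⟨_, rfl⟩
  obtain ⟨θ, hθ⟩ : ∃ θ : ℕ → 𝓢(ℝ, ℂ), ∀ n, θ n = bumpSymb ((n : ℝ) + 1) (by positivity) :=
    ⟨_, fun n => rfl⟩
  have hθs : ∀ n, HasCompactSupport (θ n : ℝ → ℂ) := fun n => by
    rw [hθ n]; exact hasCompactSupport_bumpSymb _ _
  have hθn : ∀ (n : ℕ) (p : ℝ), θ n p = χ (p / (n + 1)) := fun n p => by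
    rw [hθ n, hχ, bumpSymb_apply, bumpSymb_apply, bumpFun_eq_bumpFun_one_div]
  have hχ0 : χ 0 = 1 := by rw [hχ, bumpSymb_apply, bumpFun_zero]
  have hxt : Tendsto (fun n => smear τ (𝓕 (θ n : ℝ → ℂ)) a) atTop (𝓝 a) :=
    tendsto_smear_fourier hτ χ hχ0 θ hθn a
  have hyt : Tendsto (fun n => smear τ (𝓕 (θ n : ℝ → ℂ)) δa) atTop (𝓝 δa) :=
    tendsto_smear_fourier hτ χ hχ0 θ hθn δa
  -- uniform bound on the smeared elements
  have hxb : ∀ n, ‖smear τ (𝓕 (θ n : ℝ → ℂ)) a‖ ≤ (∫ u, ‖𝓕 (χ : ℝ → ℂ) u‖) * ‖a‖ := fun n => by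
    have := norm_smear_le τ (integrable_fourier_schwartz (θ n)) a
    rwa [integral_norm_fourier_rescaled χ θ hθn n] at this
  -- the terms of the sequence are real and bounded below, for every `ε > 0`
  have key : ∀ {ε : ℝ}, 0 < ε → ∀ n : ℕ,
      (-I * ω (star (smear τ (𝓕 (θ n : ℝ → ℂ)) a) * smear τ (𝓕 (θ n : ℝ → ℂ)) δa)).im = 0 ∧
      -(2 * π * (3 * ε * ((∫ u, ‖𝓕 (χ : ℝ → ℂ) u‖) * ‖a‖) ^ 2)) ≤
        (-I * ω (star (smear τ (𝓕 (θ n : ℝ → ℂ)) a) * smear τ (𝓕 (θ n : ℝ → ℂ)) δa)).re := by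
    intro ε hε n
    obtain ⟨him, hre⟩ := ω.specPair_mom_re_ge hτ hinv a hε (fun η hη hs => hvan hε η hη hs)
      (θ n) (hθs n)
    rw [ω.generator_specPair hτ hinv (θ n) (hθs n) ha]
    have h2π : (2 : ℂ) * π = ((2 * π : ℝ) : ℂ) := by push_cast; ring
    rw [h2π, Complex.im_ofReal_mul, Complex.re_ofReal_mul, him, mul_zero]
    refine ⟨rfl, ?_⟩
    have hK : ‖smear τ (𝓕 (θ n : ℝ → ℂ)) a‖ ^ 2 ≤ ((∫ u, ‖𝓕 (χ : ℝ → ℂ) u‖) * ‖a‖) ^ 2 :=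
      pow_le_pow_left₀ (norm_nonneg _) (hxb n) 2
    have h3 : -(3 * ε * ((∫ u, ‖𝓕 (χ : ℝ → ℂ) u‖) * ‖a‖) ^ 2) ≤
        (specPair (fun u => ω (star a * τ u a)) (momConjMulSymb (θ n) (hθs n))).re :=
      le_trans (neg_le_neg (mul_le_mul_of_nonneg_left hK (by positivity))) hre
    have h4 := mul_le_mul_of_nonneg_left h3 (by positivity : (0 : ℝ) ≤ 2 * π)
    linarith [h4]
  -- pass to the limit `n → ∞`, then `ε → 0`
  have hlim := ω.tendsto_neg_I_mul_apply_star_mul hxt hyt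
  have hmem : ∀ {ε : ℝ}, 0 < ε → (-I * ω (star a * δa)).im = 0 ∧
      -(2 * π * (3 * ε * ((∫ u, ‖𝓕 (χ : ℝ → ℂ) u‖) * ‖a‖) ^ 2)) ≤ (-I * ω (star a * δa)).re := by
    intro ε hε
    exact (isClosed_im_eq_zero_re_ge _).mem_of_tendsto hlim (Eventually.of_forall fun n => key hε n)
  refine Complex.nonneg_iff.mpr ⟨?_, (hmem one_pos).1.symm⟩
  exact re_nonneg_of_forall_eps (fun ε hε => (hmem hε).2)

end AnalyticImpliesGenerator

/-! ### Bounds for the Fourier–Laplace extension of compactly supported symbols -/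

section ExtKernelBounds

open scoped ContDiff

/-- Two-sided growth bound: if `η` vanishes off `[-S, S]`, then `|K(w)| ≤ e^{2πS|Im w|} ‖η‖₁`.
[folklore] -/
theorem norm_extKernel_le_exp {η : ℝ → ℂ} (hη : Integrable η) {S : ℝ}
    (hS : ∀ p, η p ≠ 0 → |p| ≤ S) (w : ℂ) :
    ‖extKernel η w‖ ≤ Real.exp (2 * π * S * |w.im|) * ∫ p, ‖η p‖ := by
  rw [extKernel, ← integral_const_mul]
  refine norm_integral_le_of_norm_le (hη.norm.const_mul _) (Eventually.of_forall fun p => ?_)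
  rw [norm_mul, norm_cexp_extKernel]
  by_cases hp : η p = 0
  · simp [hp]
  · refine mul_le_mul_of_nonneg_right (Real.exp_le_exp.mpr ?_) (norm_nonneg _)
    calc 2 * π * p * w.im ≤ |2 * π * p * w.im| := le_abs_self _
      _ = 2 * π * |p| * |w.im| := by
        rw [abs_mul, abs_mul, abs_mul, abs_two, abs_of_pos Real.pi_pos]
      _ ≤ 2 * π * S * |w.im| := by gcongr; exact hS p hp

/-- A compactly supported function vanishes off some `[-S, S]`. [folklore] -/
theorem exists_abs_le_of_hasCompactSupport {η : ℝ → ℂ} (hηs : HasCompactSupport η) :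
    ∃ S : ℝ, 0 ≤ S ∧ ∀ p, η p ≠ 0 → |p| ≤ S := by
  obtain ⟨S, hS⟩ := hηs.isCompact.isBounded.subset_closedBall 0
  refine ⟨max S 0, le_max_right _ _, fun p hp => ?_⟩
  have h := hS (subset_tsupport _ hp)
  rw [Metric.mem_closedBall, Real.dist_eq, sub_zero] at h
  exact h.trans (le_max_left _ _)

/-- **Integration by parts** in the Fourier–Laplace extension: `K_{η'}(w) = 2πi w K_η(w)` for a
compactly supported Schwartz symbol `η`. [folklore] -/
theorem extKernel_deriv (η : 𝓢(ℝ, ℂ)) (hηs : HasCompactSupport (η : ℝ → ℂ)) (w : ℂ) :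
    extKernel (fun p => deriv (η : ℝ → ℂ) p) w = 2 * π * I * w * extKernel η w := by
  set e : ℝ → ℂ := fun p => cexp (-(2 * π * I * p * w)) with he
  set e' : ℝ → ℂ := fun p => -(2 * π * I * w) * cexp (-(2 * π * I * p * w)) with he'
  have hed : ∀ p : ℝ, HasDerivAt e (e' p) p := fun p => by
    have h1 : HasDerivAt (fun q : ℝ => -(2 * π * I * (q : ℂ) * w)) (-(2 * π * I * w)) p := by
      have h0 : HasDerivAt (fun q : ℝ => (q : ℂ)) 1 p := by
        simpa using (hasDerivAt_id p).ofReal_comp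
      exact (((h0.const_mul (2 * π * I)).mul_const w).neg).congr_deriv (by ring)
    have h2 := h1.cexp
    refine h2.congr_deriv ?_
    rw [he']
    ring
  have hηd : ∀ p : ℝ, HasDerivAt (η : ℝ → ℂ) (deriv (η : ℝ → ℂ) p) p := fun p => η.hasDerivAt p
  have hds : HasCompactSupport (fun p => deriv (η : ℝ → ℂ) p) := hηs.deriv
  have hec : Continuous e := by rw [he]; fun_prop
  have he'c : Continuous e' := by rw [he']; fun_prop
  have hi1 : Integrable (e * fun p => deriv (η : ℝ → ℂ) p) :=
    (hec.mul (SchwartzMap.derivCLM ℝ ℂ η).continuous).integrable_of_hasCompactSupport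
      hds.mul_left
  have hi2 : Integrable (e' * (η : ℝ → ℂ)) :=
    (he'c.mul η.continuous).integrable_of_hasCompactSupport hηs.mul_left
  have hzero : ∀ l : Filter ℝ, l ≤ cocompact ℝ → Tendsto (e * (η : ℝ → ℂ)) l (𝓝 0) := by
    intro l hl
    have hcs : HasCompactSupport (e * (η : ℝ → ℂ)) := hηs.mul_left
    have hev : (e * (η : ℝ → ℂ)) =ᶠ[cocompact ℝ] 0 := by
      have h := hasCompactSupport_iff_eventuallyEq.mp hcs
      rwa [Filter.coclosedCompact_eq_cocompact] at h
    exact (tendsto_const_nhds.congr' (hev.filter_mono hl).symm)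
  have hibp := integral_mul_deriv_eq_deriv_mul (fun p _ => hed p) (fun p _ => hηd p) hi1 hi2
    (hzero atBot atBot_le_cocompact) (hzero atTop atTop_le_cocompact)
  simp only [sub_zero, zero_sub] at hibp
  rw [extKernel]
  change (∫ p : ℝ, e p * deriv (η : ℝ → ℂ) p) = _
  rw [hibp, extKernel, ← integral_neg, ← integral_const_mul]
  congr 1 with p
  simp only [he']
  ring

/-- **Decay of the Fourier–Laplace extension of a compactly supported symbol**:
`(1 + (Re w)²) |K_η(w)| ≤ M e^{2πS|Im w|}` (two integrations by parts). [folklore] -/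
theorem exists_bound_extKernel (η : 𝓢(ℝ, ℂ)) (hηs : HasCompactSupport (η : ℝ → ℂ)) :
    ∃ S M : ℝ, 0 ≤ S ∧ 0 ≤ M ∧ ∀ w : ℂ,
      (1 + w.re ^ 2) * ‖extKernel η w‖ ≤ M * Real.exp (2 * π * S * |w.im|) := by
  obtain ⟨S, hS0, hS⟩ := exists_abs_le_of_hasCompactSupport hηs
  set η₁ : 𝓢(ℝ, ℂ) := SchwartzMap.derivCLM ℝ ℂ η with hη₁
  set η₂ : 𝓢(ℝ, ℂ) := SchwartzMap.derivCLM ℝ ℂ η₁ with hη₂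
  have hη₁f : (η₁ : ℝ → ℂ) = fun p => deriv (η : ℝ → ℂ) p := by
    ext p; rw [hη₁, SchwartzMap.derivCLM_apply]
  have hη₂f : (η₂ : ℝ → ℂ) = fun p => deriv (η₁ : ℝ → ℂ) p := by
    ext p; rw [hη₂, SchwartzMap.derivCLM_apply]
  have hη₁s : HasCompactSupport (η₁ : ℝ → ℂ) := by rw [hη₁f]; exact hηs.deriv
  have hη₂s : HasCompactSupport (η₂ : ℝ → ℂ) := by rw [hη₂f]; exact hη₁s.deriv
  have ht₁ : tsupport (η₁ : ℝ → ℂ) ⊆ tsupport (η : ℝ → ℂ) := by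
    rw [hη₁f]; exact tsupport_deriv_subset
  have ht₂ : tsupport (η₂ : ℝ → ℂ) ⊆ tsupport (η : ℝ → ℂ) := by
    rw [hη₂f]; exact tsupport_deriv_subset.trans ht₁
  -- `η₂` vanishes off `[-S, S]` as well
  have hS' : ∀ p, (η : ℝ → ℂ) p ≠ 0 → |p| ≤ S := hS
  have hS₂ : ∀ p, (η₂ : ℝ → ℂ) p ≠ 0 → |p| ≤ S := by
    intro p hp
    by_contra hcon
    have hp' : p ∉ tsupport (η : ℝ → ℂ) := by
      intro hmem
      -- every point of `tsupport η` is a limit of points where `η ≠ 0`, all in `[-S, S]`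
      have hcl : tsupport (η : ℝ → ℂ) ⊆ Icc (-S) S := by
        refine closure_minimal (fun q hq => ?_) isClosed_Icc
        have := hS q hq
        rw [abs_le] at this
        exact ⟨this.1, this.2⟩
      have := hcl hmem
      rw [mem_Icc, ← abs_le] at this
      exact hcon this
    exact hp (image_eq_zero_of_notMem_tsupport (fun h => hp' (ht₂ h)))
  have hK2 : ∀ w : ℂ, extKernel η₂ w = (2 * π * I * w) ^ 2 * extKernel η w := fun w => by
    rw [hη₂f, extKernel_deriv η₁ hη₁s w, hη₁f, extKernel_deriv η hηs w]
    ring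
  set L0 : ℝ := ∫ p, ‖(η : ℝ → ℂ) p‖ with hL0
  set L2 : ℝ := ∫ p, ‖(η₂ : ℝ → ℂ) p‖ with hL2
  have hL0n : 0 ≤ L0 := integral_nonneg fun _ => norm_nonneg _
  have hL2n : 0 ≤ L2 := integral_nonneg fun _ => norm_nonneg _
  refine ⟨S, L0 + L2 / (4 * π ^ 2), hS0, by positivity, fun w => ?_⟩
  have h0 : ‖extKernel η w‖ ≤ Real.exp (2 * π * S * |w.im|) * L0 :=
    norm_extKernel_le_exp η.integrable hS w
  have h2 : ‖extKernel η₂ w‖ ≤ Real.exp (2 * π * S * |w.im|) * L2 :=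
    norm_extKernel_le_exp η₂.integrable hS₂ w
  have h2' : ‖w‖ ^ 2 * ‖extKernel η w‖ ≤ Real.exp (2 * π * S * |w.im|) * L2 / (4 * π ^ 2) := by
    have hn : ‖extKernel η₂ w‖ = 4 * π ^ 2 * ‖w‖ ^ 2 * ‖extKernel η w‖ := by
      rw [hK2, norm_mul, norm_pow, norm_mul, norm_mul, norm_mul, Complex.norm_I,
        Complex.norm_real, Real.norm_eq_abs, abs_of_pos Real.pi_pos]
      simp only [Complex.norm_ofNat, mul_one]
      ring
    rw [hn] at h2
    have hπ : (0 : ℝ) < 4 * π ^ 2 := by positivity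
    rw [le_div_iff₀ hπ]
    linarith
  have hre : w.re ^ 2 ≤ ‖w‖ ^ 2 := by
    rw [← Complex.normSq_eq_norm_sq, Complex.normSq_apply]
    nlinarith [sq_nonneg w.im]
  have hpos : 0 ≤ ‖extKernel η w‖ := norm_nonneg _
  calc (1 + w.re ^ 2) * ‖extKernel η w‖
      = ‖extKernel η w‖ + w.re ^ 2 * ‖extKernel η w‖ := by ring
    _ ≤ ‖extKernel η w‖ + ‖w‖ ^ 2 * ‖extKernel η w‖ := by gcongr
    _ ≤ Real.exp (2 * π * S * |w.im|) * L0 +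
        Real.exp (2 * π * S * |w.im|) * L2 / (4 * π ^ 2) := add_le_add h0 h2'
    _ = (L0 + L2 / (4 * π ^ 2)) * Real.exp (2 * π * S * |w.im|) := by ring

/-- Comparison of shifted Cauchy weights: `(1 + (u - r)²)⁻¹ ≤ 3 (1 + (u - r₀)²)⁻¹` for
`|r - r₀| ≤ 1`. [folklore] -/
theorem inv_one_add_sq_sub_le {r r₀ : ℝ} (h : |r - r₀| ≤ 1) (u : ℝ) :
    (1 + (u - r) ^ 2)⁻¹ ≤ 3 * (1 + (u - r₀) ^ 2)⁻¹ := by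
  rw [abs_le] at h
  have h1 : (0 : ℝ) < 1 + (u - r) ^ 2 := by positivity
  have h2 : (0 : ℝ) < 1 + (u - r₀) ^ 2 := by positivity
  rw [← div_eq_mul_inv, le_div_iff₀ h2, inv_mul_le_iff₀ h1]
  nlinarith [sq_nonneg (u - r - (r - r₀)), sq_nonneg (u - r + (r - r₀)), sq_nonneg (r - r₀)]

/-- **The spectral pairing with a modulated compactly supported symbol is entire**: for a
bounded continuous `φ` and a compactly supported Schwartz symbol `θ`, the function
`z ↦ ∫ K_θ(u - z) φ(u) du` is differentiable on `ℂ` (differentiation under the integral sign,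
with the decay bound `exists_bound_extKernel`). [folklore] -/
theorem differentiable_integral_extKernel_mul {φ : ℝ → ℂ} (hφ : Continuous φ) {B : ℝ}
    (hB : ∀ u, ‖φ u‖ ≤ B) (θ : 𝓢(ℝ, ℂ)) (hθ : HasCompactSupport (θ : ℝ → ℂ)) :
    Differentiable ℂ fun z : ℂ => ∫ u : ℝ, extKernel θ (u - z) * φ u := by
  have hB0 : 0 ≤ B := (norm_nonneg _).trans (hB 0)
  -- the derivative kernel
  set θ₁ : 𝓢(ℝ, ℂ) := cutMul (fun p : ℝ => -(2 * π * I * p))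
    ((contDiff_const.mul Complex.ofRealCLM.contDiff).neg) θ hθ with hθ₁
  have hθ₁f : (θ₁ : ℝ → ℂ) = fun p : ℝ => -(2 * π * I * p) * θ p := rfl
  have hθ₁s : HasCompactSupport (θ₁ : ℝ → ℂ) := hasCompactSupport_cutMul _ _ _ hθ
  have hder : ∀ w : ℂ, HasDerivAt (extKernel θ) (extKernel θ₁ w) w := fun w => by
    have := hasDerivAt_extKernel θ.continuous hθ w
    rwa [← hθ₁f] at this
  have hKc : Continuous (extKernel θ) := (differentiable_extKernel θ.continuous hθ).continuous
  have hK₁c : Continuous (extKernel θ₁) := (differentiable_extKernel θ₁.continuous hθ₁s).continuous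
  obtain ⟨S₀, M₀, hS₀, hM₀, hb₀⟩ := exists_bound_extKernel θ hθ
  obtain ⟨S₁, M₁, hS₁, hM₁, hb₁⟩ := exists_bound_extKernel θ₁ hθ₁s
  -- pointwise decay of the shifted kernels
  have hdec : ∀ (η : 𝓢(ℝ, ℂ)) (S M : ℝ), (∀ w : ℂ, (1 + w.re ^ 2) * ‖extKernel η w‖ ≤
      M * Real.exp (2 * π * S * |w.im|)) → ∀ (z : ℂ) (u : ℝ),
      ‖extKernel η (u - z)‖ ≤ M * Real.exp (2 * π * S * |z.im|) * (1 + (u - z.re) ^ 2)⁻¹ := by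
    intro η S M h z u
    have h1 := h ((u : ℂ) - z)
    simp only [sub_re, ofReal_re, sub_im, ofReal_im, zero_sub, abs_neg] at h1
    have hpos : (0 : ℝ) < 1 + (u - z.re) ^ 2 := by positivity
    rw [mul_comm] at h1
    rwa [← div_eq_mul_inv, le_div_iff₀ hpos]
  intro z₀
  set C : ℝ := M₁ * Real.exp (2 * π * S₁ * (|z₀.im| + 1)) * 3 * B with hC
  have key := hasDerivAt_integral_of_dominated_loc_of_deriv_le (μ := volume)
    (F := fun (z : ℂ) (u : ℝ) => extKernel θ (u - z) * φ u)
    (F' := fun (z : ℂ) (u : ℝ) => -extKernel θ₁ (u - z) * φ u)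
    (x₀ := z₀) (bound := fun u => C * (1 + (u - z₀.re) ^ 2)⁻¹) (s := Metric.ball z₀ 1)
    (Metric.ball_mem_nhds z₀ one_pos) ?_ ?_ ?_ ?_
    ((integrable_inv_one_add_sq.comp_sub_right z₀.re).const_mul C) ?_
  · exact key.2.differentiableAt
  · exact Eventually.of_forall fun z =>
      ((hKc.comp (continuous_ofReal.sub continuous_const)).mul hφ).aestronglyMeasurable
  · refine (((integrable_inv_one_add_sq.comp_sub_right z₀.re).const_mul
      (M₀ * Real.exp (2 * π * S₀ * |z₀.im|) * B)).mono'
      ((hKc.comp (continuous_ofReal.sub continuous_const)).mul hφ).aestronglyMeasurable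
      (Eventually.of_forall fun u => ?_))
    rw [norm_mul]
    calc ‖extKernel θ (u - z₀)‖ * ‖φ u‖
        ≤ M₀ * Real.exp (2 * π * S₀ * |z₀.im|) * (1 + (u - z₀.re) ^ 2)⁻¹ * B :=
          mul_le_mul (hdec θ S₀ M₀ hb₀ z₀ u) (hB u) (norm_nonneg _) (by positivity)
      _ = M₀ * Real.exp (2 * π * S₀ * |z₀.im|) * B * (1 + (u - z₀.re) ^ 2)⁻¹ := by ring
  · exact ((hK₁c.comp (continuous_ofReal.sub continuous_const)).neg.mul hφ).aestronglyMeasurable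
  · refine Eventually.of_forall fun u z hz => ?_
    rw [Metric.mem_ball, dist_eq_norm] at hz
    have him : |z.im| ≤ |z₀.im| + 1 := by
      have h1 : |z.im - z₀.im| < 1 := by simpa using (abs_im_le_norm (z - z₀)).trans_lt hz
      have h2 := abs_sub_abs_le_abs_sub z.im z₀.im
      linarith
    have hre : |z.re - z₀.re| ≤ 1 := by
      simpa using ((abs_re_le_norm (z - z₀)).trans hz.le)
    rw [norm_mul, norm_neg]
    calc ‖extKernel θ₁ (u - z)‖ * ‖φ u‖
        ≤ M₁ * Real.exp (2 * π * S₁ * |z.im|) * (1 + (u - z.re) ^ 2)⁻¹ * B :=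
          mul_le_mul (hdec θ₁ S₁ M₁ hb₁ z u) (hB u) (norm_nonneg _) (by positivity)
      _ ≤ M₁ * Real.exp (2 * π * S₁ * (|z₀.im| + 1)) * (3 * (1 + (u - z₀.re) ^ 2)⁻¹) * B := by
          gcongr
          · exact inv_one_add_sq_sub_le hre u
      _ = C * (1 + (u - z₀.re) ^ 2)⁻¹ := by rw [hC]; ring
  · refine Eventually.of_forall fun u z _ => ?_
    have h1 : HasDerivAt (fun z : ℂ => (u : ℂ) - z) (-1) z := by
      simpa using (hasDerivAt_id z).const_sub (u : ℂ)
    have h2 := (hder ((u : ℂ) - z)).comp z h1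
    have h3 := h2.mul_const (φ u)
    refine h3.congr_deriv ?_
    simp only [mul_neg, mul_one, neg_mul]

end ExtKernelBounds

/-! ### Modulated symbols -/

section ModulatedSymbols

open scoped ContDiff

/-- The character `p ↦ e^{2πipz}` is smooth in the real variable `p`. [folklore] -/
theorem contDiff_cexp_mul (z : ℂ) : ContDiff ℝ ∞ fun p : ℝ => cexp (2 * π * I * p * z) :=
  Complex.contDiff_exp.comp
    ((contDiff_const.mul Complex.ofRealCLM.contDiff).mul contDiff_const)

/-- The **modulated symbol** `e_z θ : p ↦ e^{2πipz} θ(p)` of a compactly supported symbol `θ`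
(`z ∈ ℂ`); its kernel is the translate `𝓕(e_z θ)(u) = K_θ(u - z)` of the Fourier–Laplace extension
of `𝓕θ`, so that `τ_{𝓕(e_t θ)}(c) = τ_t(τ_{𝓕θ}(c))` for real `t`. Formally
`e_z(H) θ(H) = e^{izH} θ(H)`: this is the analytic continuation `t ↦ z` of the dynamics on the
spectral subspace cut out by `θ` (Bratteli–Robinson II Prop. 5.3.19, proof of generator form ⇒
analytic form). [folklore] -/
def modSymb (θ : 𝓢(ℝ, ℂ)) (hθ : HasCompactSupport (θ : ℝ → ℂ)) (z : ℂ) : 𝓢(ℝ, ℂ) :=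
  cutMul (fun p : ℝ => cexp (2 * π * I * p * z)) (contDiff_cexp_mul z) θ hθ

/-- The values of `modSymb`. [folklore] -/
@[simp]
theorem modSymb_apply (θ : 𝓢(ℝ, ℂ)) (hθ : HasCompactSupport (θ : ℝ → ℂ)) (z : ℂ) (p : ℝ) :
    modSymb θ hθ z p = cexp (2 * π * I * p * z) * θ p := rfl

/-- `e_z θ` is compactly supported. [folklore] -/
theorem hasCompactSupport_modSymb (θ : 𝓢(ℝ, ℂ)) (hθ : HasCompactSupport (θ : ℝ → ℂ)) (z : ℂ) :
    HasCompactSupport (modSymb θ hθ z : ℝ → ℂ) :=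
  hasCompactSupport_cutMul _ _ _ hθ

/-- Modulation is additive in the symbol. [folklore] -/
theorem modSymb_sub (θ₁ θ₂ : 𝓢(ℝ, ℂ)) (hθ₁ : HasCompactSupport (θ₁ : ℝ → ℂ))
    (hθ₂ : HasCompactSupport (θ₂ : ℝ → ℂ)) (h₁₂ : HasCompactSupport ((θ₁ - θ₂ : 𝓢(ℝ, ℂ)) : ℝ → ℂ))
    (z : ℂ) : modSymb (θ₁ - θ₂) h₁₂ z = modSymb θ₁ hθ₁ z - modSymb θ₂ hθ₂ z := by
  ext p
  simp only [modSymb_apply, sub_apply]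
  ring

/-- The kernel of a modulated symbol is the translated Fourier–Laplace extension:
`𝓕(e_z θ)(u) = K_θ(u - z)`. [folklore] -/
theorem fourier_modSymb (θ : 𝓢(ℝ, ℂ)) (hθ : HasCompactSupport (θ : ℝ → ℂ)) (z : ℂ) (u : ℝ) :
    𝓕 (modSymb θ hθ z : ℝ → ℂ) u = extKernel θ (u - z) := by
  rw [Real.fourier_real_eq_integral_exp_smul, extKernel]
  congr 1 with p
  rw [smul_eq_mul, modSymb_apply, ← mul_assoc, ← Complex.exp_add]
  congr 2
  push_cast
  ring

/-- For real `t`, the kernel of `e_t θ` is the translate `𝓕θ(· - t)`. [folklore] -/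
theorem fourier_modSymb_ofReal (θ : 𝓢(ℝ, ℂ)) (hθ : HasCompactSupport (θ : ℝ → ℂ)) (t u : ℝ) :
    𝓕 (modSymb θ hθ t : ℝ → ℂ) u = 𝓕 (θ : ℝ → ℂ) (u - t) :=
  (fourier_schwartz_sub θ (modSymb θ hθ t) t (fun p => by rw [modSymb_apply]) u).symm

/-- `|e_z θ|² = e^{-4πp Im z} |θ|²`. [folklore] -/
theorem conj_modSymb_mul_modSymb (θ : 𝓢(ℝ, ℂ)) (hθ : HasCompactSupport (θ : ℝ → ℂ)) (z : ℂ)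
    (p : ℝ) : conj (modSymb θ hθ z p) * modSymb θ hθ z p =
      (Real.exp (-(4 * π * p * z.im)) : ℂ) * (conj (θ p) * θ p) := by
  rw [modSymb_apply, map_mul]
  set E : ℂ := cexp (2 * π * I * p * z) with hE
  have hre : (2 * π * I * p * z).re = -(2 * π * p * z.im) := by
    simp only [mul_re, mul_im, I_re, I_im, ofReal_re, ofReal_im, re_ofNat, im_ofNat]
    ring
  have h : conj E * E = (Real.exp (-(4 * π * p * z.im)) : ℂ) := by
    rw [← Complex.normSq_eq_conj_mul_self, Complex.normSq_eq_norm_sq, hE, Complex.norm_exp, hre,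
      sq, ← Real.exp_add]
    congr 1
    ring_nf
  calc conj E * conj (θ p) * (E * θ p) = (conj E * E) * (conj (θ p) * θ p) := by ring
    _ = _ := by rw [h]

/-- Positivity of the radicand `e - e^{-4πpy}` on `p > -4ε` when `16π y ε ≤ 1`, `y ≥ 0`.
[folklore] -/
theorem radicand_pos {y ε : ℝ} (hy : 0 ≤ y) (hyε : 16 * π * y * ε ≤ 1) {p : ℝ}
    (hp : -(4 * ε) < p) : 0 < Real.exp 1 - Real.exp (-(4 * π * p * y)) := by
  rw [sub_pos, Real.exp_lt_exp]
  rcases le_or_gt 0 p with h0 | h0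
  · have : 0 ≤ 4 * π * p * y := by positivity
    linarith
  · rcases eq_or_lt_of_le hy with hy0 | hy0
    · rw [← hy0]; simp
    · have h1 : -(4 * π * p * y) = 4 * π * y * (-p) := by ring
      rw [h1]
      calc 4 * π * y * (-p) < 4 * π * y * (4 * ε) := by
            have : -p < 4 * ε := by linarith
            have : 0 < 4 * π * y := by positivity
            gcongr
        _ = 16 * π * y * ε := by ring
        _ ≤ 1 := hyε

/-- The **weight** `s(p) = ψ_ε(p) √(e - e^{-4πpy})` is smooth when `16π y ε ≤ 1`, `y ≥ 0`,
`ε > 0` (the step `ψ_ε` vanishes near the zero `p = -1/(4πy) ≤ -4ε` of the radicand).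
[folklore] -/
theorem contDiff_stepFun_mul_sqrt {y ε : ℝ} (hy : 0 ≤ y) (hε : 0 < ε)
    (hyε : 16 * π * y * ε ≤ 1) :
    ContDiff ℝ ∞ fun p : ℝ =>
      stepFun ε p * Real.sqrt (Real.exp 1 - Real.exp (-(4 * π * p * y))) := by
  rw [contDiff_iff_contDiffAt]
  intro p
  by_cases hp : -(4 * ε) < p
  · have h1 : ContDiffAt ℝ ∞ (fun p : ℝ =>
        Real.sqrt (Real.exp 1 - Real.exp (-(4 * π * p * y)))) p :=
      (Real.contDiffAt_sqrt (radicand_pos hy hyε hp).ne').comp p (by fun_prop)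
    exact contDiff_stepFun.contDiffAt.mul h1
  · -- near `p ≤ -4ε` the step (hence the product) vanishes identically
    have hev : (fun p : ℝ => stepFun ε p * Real.sqrt (Real.exp 1 - Real.exp (-(4 * π * p * y))))
        =ᶠ[𝓝 p] fun _ => 0 := by
      filter_upwards [(isOpen_Iio (a := -(2 * ε))).mem_nhds (by
        simp only [mem_Iio]; linarith)] with q hq
      rw [stepFun_of_le hε (le_of_lt hq), zero_mul]
    exact (contDiffAt_const (c := (0 : ℝ))).congr_of_eventuallyEq hev

/-- The weight `m(p) = (1 - ψ_{ε/2}(p)) √(-p - ε/4)` is smooth (the factor `1 - ψ_{ε/2}` vanishes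
on `[-ε/2, ∞)`, away from which the radicand is positive). [folklore] -/
theorem contDiff_one_sub_stepFun_mul_sqrt {ε : ℝ} (hε : 0 < ε) :
    ContDiff ℝ ∞ fun p : ℝ => (1 - stepFun (ε / 2) p) * Real.sqrt (-p - ε / 4) := by
  rw [contDiff_iff_contDiffAt]
  intro p
  by_cases hp : p < -(ε / 4)
  · have h1 : ContDiffAt ℝ ∞ (fun p : ℝ => Real.sqrt (-p - ε / 4)) p := by
      have hne : -p - ε / 4 ≠ 0 := by linarith
      exact (Real.contDiffAt_sqrt hne).comp p (by fun_prop)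
    exact (contDiff_const.sub contDiff_stepFun).contDiffAt.mul h1
  · have hev : (fun p : ℝ => (1 - stepFun (ε / 2) p) * Real.sqrt (-p - ε / 4))
        =ᶠ[𝓝 p] fun _ => 0 := by
      filter_upwards [(isOpen_Ioi (a := -(ε / 2))).mem_nhds (by
        simp only [mem_Ioi]; linarith)] with q hq
      rw [stepFun_of_ge (half_pos hε) (le_of_lt hq), sub_self, zero_mul]
    exact (contDiffAt_const (c := (0 : ℝ))).congr_of_eventuallyEq hev

/-- **Spectral decomposition of the first moment on the negative half-line**: for a compactly
supported symbol `σ` vanishing on `(-ε, ∞)`,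
`p |σ|² = -(ε/4) |σ|² - |m σ|²` with the smooth weight `m = (1 - ψ_{ε/2}) √(-p - ε/4)`.
[folklore] -/
theorem momConjMulSymb_decomp_of_neg_support (σ : 𝓢(ℝ, ℂ))
    (hσ : HasCompactSupport (σ : ℝ → ℂ)) {ε : ℝ} (hε : 0 < ε)
    (hσ0 : ∀ p : ℝ, -ε < p → σ p = 0) :
    ∃ (ρ : 𝓢(ℝ, ℂ)) (hρ : HasCompactSupport (ρ : ℝ → ℂ)),
      momConjMulSymb σ hσ = -(((ε / 4 : ℝ) : ℂ) • conjMulSymb σ σ hσ) - conjMulSymb ρ ρ hρ := by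
  set m : ℝ → ℝ := fun p => (1 - stepFun (ε / 2) p) * Real.sqrt (-p - ε / 4) with hm
  set ρ : 𝓢(ℝ, ℂ) := cutMul (fun p : ℝ => (m p : ℂ))
    (Complex.ofRealCLM.contDiff.comp (contDiff_one_sub_stepFun_mul_sqrt hε)) σ hσ with hρdef
  refine ⟨ρ, hasCompactSupport_cutMul _ _ _ hσ, ?_⟩
  ext p
  simp only [momConjMulSymb_apply, sub_apply, neg_apply, smul_apply, conjMulSymb_apply, hρdef,
    cutMul_apply, smul_eq_mul, map_mul, Complex.conj_ofReal]
  by_cases hσp : σ p = 0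
  · simp [hσp]
  · have hp : p ≤ -ε := le_of_not_gt fun h => hσp (hσ0 p h)
    have hψ : stepFun (ε / 2) p = 0 := stepFun_of_le (half_pos hε) (by linarith)
    have hm2 : ((m p : ℂ)) ^ 2 = -(p : ℂ) - ε / 4 := by
      rw [← Complex.ofReal_pow, hm]
      simp only [hψ, sub_zero, one_mul]
      rw [Real.sq_sqrt (by linarith)]
      push_cast
      ring
    push_cast
    linear_combination (conj (σ p) * σ p) * hm2

/-- **Spectral decomposition at height `y = Im z ≥ 0`**: for a compactly supported symbol `θ`,
`ε > 0` with `16π y ε ≤ 1`, and the step `ψ = ψ_ε`,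
`e |θ|² = |e_z θ|² + |ψ √(e - e^{-4πpy}) θ|² + (1 - ψ²)(e - e^{-4πpy}) |θ|²`, where the last symbol
is supported in `(-∞, -ε]`. This emulates the spectral-calculus bound
`‖e^{izH} θ(H) ξ‖² ≤ e ‖θ(H)ξ‖²`, `Im z ≥ 0`, for vectors `ξ` whose spectral measure vanishes on
`(-∞, -ε]` (Bratteli–Robinson II Prop. 5.3.19, generator form ⇒ analytic form). [folklore] -/
theorem conjMulSymb_modSymb_decomp (θ : 𝓢(ℝ, ℂ)) (hθ : HasCompactSupport (θ : ℝ → ℂ))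
    {z : ℂ} (hz : 0 ≤ z.im) {ε : ℝ} (hε : 0 < ε) (hzε : 16 * π * z.im * ε ≤ 1) :
    ∃ (ρ η : 𝓢(ℝ, ℂ)) (hρ : HasCompactSupport (ρ : ℝ → ℂ)),
      HasCompactSupport (η : ℝ → ℂ) ∧ (∀ p : ℝ, -ε < p → η p = 0) ∧
      ((Real.exp 1 : ℝ) : ℂ) • conjMulSymb θ θ hθ =
        conjMulSymb (modSymb θ hθ z) (modSymb θ hθ z) (hasCompactSupport_modSymb θ hθ z) +
          conjMulSymb ρ ρ hρ + η := by
  set y : ℝ := z.im with hy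
  set ψ : ℝ → ℝ := stepFun ε with hψ
  set s : ℝ → ℝ := fun p => ψ p * Real.sqrt (Real.exp 1 - Real.exp (-(4 * π * p * y))) with hs
  have hsc : ContDiff ℝ ∞ fun p : ℝ => (s p : ℂ) :=
    Complex.ofRealCLM.contDiff.comp (contDiff_stepFun_mul_sqrt hz hε hzε)
  set ρ : 𝓢(ℝ, ℂ) := cutMul (fun p : ℝ => (s p : ℂ)) hsc θ hθ with hρdef
  have hMc : ContDiff ℝ ∞ fun p : ℝ =>
      (((1 - ψ p ^ 2) * (Real.exp 1 - Real.exp (-(4 * π * p * y))) : ℝ) : ℂ) :=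
    Complex.ofRealCLM.contDiff.comp ((contDiff_const.sub (contDiff_stepFun.pow 2)).mul
      (contDiff_const.sub (Real.contDiff_exp.comp (by fun_prop))))
  set η : 𝓢(ℝ, ℂ) := cutMul (fun p : ℝ =>
      (((1 - ψ p ^ 2) * (Real.exp 1 - Real.exp (-(4 * π * p * y))) : ℝ) : ℂ) * conj (θ p))
    (hMc.mul (contDiff_conj_comp θ)) θ hθ with hηdef
  have hψ1 : ∀ p : ℝ, -ε < p → ψ p = 1 := fun p hp => stepFun_of_ge hε hp.le
  refine ⟨ρ, η, hasCompactSupport_cutMul _ _ _ hθ, hasCompactSupport_cutMul _ _ _ hθ,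
    fun p hp => by simp [hηdef, hψ1 p hp], ?_⟩
  ext p
  simp only [smul_apply, add_apply, conjMulSymb_apply, smul_eq_mul, conj_modSymb_mul_modSymb,
    hρdef, hηdef, cutMul_apply, map_mul, Complex.conj_ofReal]
  have hs2 : ((s p : ℂ)) ^ 2 =
      ((ψ p ^ 2 * (Real.exp 1 - Real.exp (-(4 * π * p * y))) : ℝ) : ℂ) := by
    rw [← Complex.ofReal_pow]
    congr 1
    by_cases hψ0 : ψ p = 0
    · simp [hs, hψ0]
    · have hp : -(2 * ε) < p := (stepFun_pos_iff hε).mp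
        (lt_of_le_of_ne (stepFun_nonneg ε p) (Ne.symm hψ0))
      rw [hs]
      simp only
      rw [mul_pow, Real.sq_sqrt (radicand_pos hz hzε (by linarith)).le]
  push_cast at hs2 ⊢
  linear_combination (-(conj (θ p) * θ p)) * hs2

end ModulatedSymbols


/-! ### Ground states in the generator form: the negative spectral part vanishes -/

section NegativeSpectrum

variable [PartialOrder A] [StarOrderedRing A] {τ : ℝ → (A ≃⋆ₐ[ℂ] A)}

/-- **Generator positivity kills the negative spectral part (elements of `D(δ)`).** For a ground
state `ω` (generator form), `c ∈ D(δ)` and a compactly supported symbol `σ` vanishing on `(-ε, ∞)`,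
the smeared element `x = τ_{𝓕σ}(c)` satisfies `ω(x⋆ x) = 0`: indeed `x ∈ D(δ)` with
`δx = τ_{𝓕σ}(δc)`, `0 ≤ -i ω(x⋆ δx) = 2π Λ_{c,c}(p |σ|²)` (`State.generator_specPair`) and
`p |σ|² = -(ε/4)|σ|² - |m σ|²` (`momConjMulSymb_decomp_of_neg_support`), so that
`0 ≤ -(ε/4) ω(x⋆ x) - ω(y⋆ y)`. This is the spectrum condition `H_ω ≥ 0` of Bratteli–Robinson II
Prop. 5.3.19 (generator form ⇒ analytic form), Sakai (1991) Prop. 4.2.3. [folklore] -/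
theorem _root_.Literature.MathematicalPhysics.QuantumLattice.State.IsGroundState.apply_star_smear_mul_smear_eq_zero_of_hasDerivAt
    (hτ : Literature.MathematicalPhysics.QuantumLattice.IsAutomorphismGroup τ) {ω : Literature.MathematicalPhysics.QuantumLattice.State A} (hω : ω.IsGroundState τ)
    (σ : 𝓢(ℝ, ℂ)) (hσ : HasCompactSupport (σ : ℝ → ℂ)) {ε : ℝ} (hε : 0 < ε)
    (hσ0 : ∀ p : ℝ, -ε < p → σ p = 0) {c δc : A} (hc : HasDerivAt (fun t : ℝ => τ t c) δc 0) :
    ω (star (smear τ (𝓕 (σ : ℝ → ℂ)) c) * smear τ (𝓕 (σ : ℝ → ℂ)) c) = 0 := by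
  have hinv : ∀ (t : ℝ) (x : A), ω (τ t x) = ω x := fun t x =>
    Literature.MathematicalPhysics.QuantumLattice.State.IsGroundState.apply_dynamics_holds hτ hω t x
  set φ : ℝ → ℂ := fun u => ω (star c * τ u c) with hφ
  have hφc : Continuous φ := ω.continuous_apply_mul_aut hτ (star c) c
  have hφb : ∀ u, ‖φ u‖ ≤ ‖c‖ * ‖c‖ := fun u => by
    simpa only [hφ, norm_star] using ω.norm_apply_mul_aut_le (star c) c u
  -- generator positivity on the smeared element
  have hpos : 0 ≤ -I * ω (star (smear τ (𝓕 (σ : ℝ → ℂ)) c) * smear τ (𝓕 (σ : ℝ → ℂ)) δc) :=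
    hω _ _ (hasDerivAt_aut_smear hτ (integrable_fourier_schwartz σ) hc)
  rw [ω.generator_specPair hτ hinv σ hσ hc] at hpos
  obtain ⟨ρ, hρ, hdec⟩ := momConjMulSymb_decomp_of_neg_support σ hσ hε hσ0
  have h1 := ω.specPair_sq hτ hinv σ hσ c
  have h2 := ω.specPair_sq hτ hinv ρ hρ c
  rw [hdec, specPair_sub hφc hφb, ← neg_smul, specPair_smul, ← Complex.ofReal_neg] at hpos
  have h2π : (2 : ℂ) * π = ((2 * π : ℝ) : ℂ) := by push_cast; ring
  rw [h2π, mul_sub, ← mul_assoc, ← Complex.ofReal_mul] at hpos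
  have hre := (Complex.nonneg_iff.mp hpos).1
  rw [sub_re, Complex.re_ofReal_mul, Complex.re_ofReal_mul] at hre
  -- `0 ≤ 2π (-(ε/4)) S₁ - 2π S₂` with `S₁, S₂ ≥ 0` forces `S₁ = 0`
  have hS₁ : (specPair φ (conjMulSymb σ σ hσ)).re = 0 := by
    refine le_antisymm ?_ h1.2.1
    have hπS₂ : 0 ≤ 2 * π * (specPair φ (conjMulSymb ρ ρ hρ)).re :=
      mul_nonneg (by positivity) h2.2.1
    have hπε : 0 < 2 * π * (ε / 4) := by positivity
    nlinarith [h1.2.1]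
  rw [← ω.specPair_conjMulSymb hτ hinv σ σ hσ c c]
  exact Complex.ext (by simpa using hS₁) (by simpa using h1.1)

/-- **Generator positivity kills the negative spectral part.** As above, for an arbitrary `c ∈ A`
(density of `D(δ)`, `IsAutomorphismGroup.exists_hasDerivAt_tendsto`, and continuity of
`c ↦ τ_{𝓕σ}(c)` and of `ω`). Bratteli–Robinson II Prop. 5.3.19 (generator form ⇒ analytic form).
[folklore] -/
theorem _root_.Literature.MathematicalPhysics.QuantumLattice.State.IsGroundState.apply_star_smear_mul_smear_eq_zero
    (hτ : Literature.MathematicalPhysics.QuantumLattice.IsAutomorphismGroup τ) {ω : Literature.MathematicalPhysics.QuantumLattice.State A} (hω : ω.IsGroundState τ)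
    (σ : 𝓢(ℝ, ℂ)) (hσ : HasCompactSupport (σ : ℝ → ℂ)) {ε : ℝ} (hε : 0 < ε)
    (hσ0 : ∀ p : ℝ, -ε < p → σ p = 0) (c : A) :
    ω (star (smear τ (𝓕 (σ : ℝ → ℂ)) c) * smear τ (𝓕 (σ : ℝ → ℂ)) c) = 0 := by
  obtain ⟨cs, δcs, hcs, hlim⟩ := hτ.exists_hasDerivAt_tendsto c
  have hk := integrable_fourier_schwartz σ
  set x : ℕ → A := fun n => smear τ (𝓕 (σ : ℝ → ℂ)) (cs n) with hx
  have hxt : Tendsto x atTop (𝓝 (smear τ (𝓕 (σ : ℝ → ℂ)) c)) := by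
    have h := ((smearCLM hτ hk).continuous.tendsto c).comp hlim
    simpa only [Function.comp_def, smearCLM_apply] using h
  have h0 : ∀ n, ω (star (x n) * x n) = 0 := fun n =>
    hω.apply_star_smear_mul_smear_eq_zero_of_hasDerivAt hτ σ hσ hε hσ0 (hcs n)
  have h1 : Tendsto (fun n => ω (star (x n) * x n)) atTop
      (𝓝 (ω (star (smear τ (𝓕 (σ : ℝ → ℂ)) c) * smear τ (𝓕 (σ : ℝ → ℂ)) c))) :=
    (ω.toContinuousLinearMap.continuous.tendsto _).comp (hxt.star.mul hxt)
  simp only [h0] at h1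
  exact tendsto_nhds_unique h1 tendsto_const_nhds

/-- **The negative spectral part of a ground state vanishes**: for a ground state `ω` (generator
form), all `x c ∈ A` and every compactly supported symbol `η` vanishing on `(-ε, ∞)`, `ε > 0`,
`Λ_{x,c}(η) = ∫ 𝓕η(u) ω(x τ_u(c)) du = 0`. (Write `η = conj χ · η` with a bump `χ ≡ 1` on the
support of `η`; then `Λ_{x,c}(η) = ω(y w)` with `w = τ_{𝓕η}(c)`, `ω(w⋆ w) = 0`, and the
Cauchy–Schwarz inequality.) Formally: the spectral measure of `U_ω` is supported in `[0, ∞)`,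
Bratteli–Robinson II Prop. 5.3.19 (generator form ⇒ analytic form). [folklore] -/
theorem _root_.Literature.MathematicalPhysics.QuantumLattice.State.IsGroundState.specPair_eq_zero (hτ : Literature.MathematicalPhysics.QuantumLattice.IsAutomorphismGroup τ) {ω : Literature.MathematicalPhysics.QuantumLattice.State A}
    (hω : ω.IsGroundState τ) (x c : A) (η : 𝓢(ℝ, ℂ)) (hη : HasCompactSupport (η : ℝ → ℂ))
    {ε : ℝ} (hε : 0 < ε) (hη0 : ∀ p : ℝ, -ε < p → η p = 0) :
    specPair (fun u => ω (x * τ u c)) η = 0 := by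
  have hinv : ∀ (t : ℝ) (x : A), ω (τ t x) = ω x := fun t x =>
    Literature.MathematicalPhysics.QuantumLattice.State.IsGroundState.apply_dynamics_holds hτ hω t x
  obtain ⟨S, hS0, hS⟩ := exists_abs_le_of_hasCompactSupport hη
  have hR : (0 : ℝ) < S + 1 := by linarith
  set β : 𝓢(ℝ, ℂ) := bumpSymb (S + 1) hR with hβ
  have hβη : conjMulSymb β η hη = η := by
    ext p
    rw [conjMulSymb_apply, hβ, bumpSymb_apply, conj_bumpFun]
    by_cases hp : η p = 0
    · simp [hp]
    · rw [bumpFun_apply_of_abs_le hR ((hS p hp).trans (by linarith)), one_mul]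
  have key := ω.specPair_conjMulSymb hτ hinv β η hη (star x) c
  rw [star_star, hβη] at key
  rw [key]
  set y : A := smear τ (𝓕 (β : ℝ → ℂ)) (star x)
  set w : A := smear τ (𝓕 (η : ℝ → ℂ)) c
  have hcs := Literature.MathematicalPhysics.QuantumLattice.State.norm_apply_star_mul_sq_le_holds ω y w
  have hw : ω (star w * w) = 0 := hω.apply_star_smear_mul_smear_eq_zero hτ η hη hε hη0 c
  rw [hw, Complex.zero_re, mul_zero] at hcs
  have h0 : ‖ω (star y * w)‖ ^ 2 = 0 := le_antisymm hcs (sq_nonneg _)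
  exact norm_eq_zero.mp (pow_eq_zero_iff two_ne_zero |>.mp h0)

end NegativeSpectrum

/-! ### Ground states in the generator form are analytic ground states -/

section GeneratorImpliesAnalytic

/-- The Fourier transform is additive on Schwartz symbols (as functions). [folklore] -/
theorem fourier_schwartz_sub_coe (θ₁ θ₂ : 𝓢(ℝ, ℂ)) :
    𝓕 ((θ₁ - θ₂ : 𝓢(ℝ, ℂ)) : ℝ → ℂ) = 𝓕 (θ₁ : ℝ → ℂ) - 𝓕 (θ₂ : ℝ → ℂ) := by
  have h := map_sub (SchwartzMap.fourierTransformCLM ℂ) θ₁ θ₂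
  simp only [SchwartzMap.fourierTransformCLM_apply] at h
  ext u
  change (𝓕 (θ₁ - θ₂)) u = (𝓕 θ₁) u - (𝓕 θ₂) u
  rw [h]
  rfl

variable {τ : ℝ → (A ≃⋆ₐ[ℂ] A)}

/-- For real `t`, smearing by the kernel of `e_t θ` is `τ_t` of smearing by `𝓕θ`:
`τ_{𝓕(e_t θ)}(c) = τ_t(τ_{𝓕θ}(c))`. [folklore] -/
theorem smear_fourier_modSymb_ofReal (hτ : Literature.MathematicalPhysics.QuantumLattice.IsAutomorphismGroup τ) (θ : 𝓢(ℝ, ℂ))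
    (hθ : HasCompactSupport (θ : ℝ → ℂ)) (c : A) (t : ℝ) :
    smear τ (𝓕 (modSymb θ hθ t : ℝ → ℂ)) c = τ t (smear τ (𝓕 (θ : ℝ → ℂ)) c) := by
  rw [aut_smear_eq_smear hτ (integrable_fourier_schwartz θ)]
  have hk : 𝓕 (modSymb θ hθ t : ℝ → ℂ) = fun u => 𝓕 (θ : ℝ → ℂ) (u - t) :=
    funext fun u => fourier_modSymb_ofReal θ hθ t u
  rw [hk]

/-- Smearing by `𝓕(e_z θ)` is additive in `θ`. [folklore] -/
theorem smear_fourier_modSymb_sub (hτ : Literature.MathematicalPhysics.QuantumLattice.IsAutomorphismGroup τ) (θ₁ θ₂ : 𝓢(ℝ, ℂ))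
    (hθ₁ : HasCompactSupport (θ₁ : ℝ → ℂ)) (hθ₂ : HasCompactSupport (θ₂ : ℝ → ℂ))
    (h₁₂ : HasCompactSupport ((θ₁ - θ₂ : 𝓢(ℝ, ℂ)) : ℝ → ℂ)) (c : A) (z : ℂ) :
    smear τ (𝓕 (modSymb (θ₁ - θ₂) h₁₂ z : ℝ → ℂ)) c =
      smear τ (𝓕 (modSymb θ₁ hθ₁ z : ℝ → ℂ)) c - smear τ (𝓕 (modSymb θ₂ hθ₂ z : ℝ → ℂ)) c := by
  rw [modSymb_sub θ₁ θ₂ hθ₁ hθ₂ h₁₂ z, fourier_schwartz_sub_coe,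
    smear_sub_left hτ (integrable_fourier_schwartz _) (integrable_fourier_schwartz _)]

variable [PartialOrder A] [StarOrderedRing A]

/-- Smearing by the kernel of a modulated symbol, through a state:
`ω(x τ_{𝓕(e_z θ)}(c)) = ∫ K_θ(u - z) ω(x τ_u(c)) du`. [folklore] -/
theorem _root_.Literature.MathematicalPhysics.QuantumLattice.State.apply_mul_smear_modSymb (ω : Literature.MathematicalPhysics.QuantumLattice.State A) (hτ : Literature.MathematicalPhysics.QuantumLattice.IsAutomorphismGroup τ)
    (θ : 𝓢(ℝ, ℂ)) (hθ : HasCompactSupport (θ : ℝ → ℂ)) (x c : A) (z : ℂ) :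
    ω (x * smear τ (𝓕 (modSymb θ hθ z : ℝ → ℂ)) c) =
      ∫ u : ℝ, extKernel θ (u - z) * ω (x * τ u c) := by
  rw [ω.apply_mul_smear hτ (integrable_fourier_schwartz _)]
  congr 1 with u
  rw [fourier_modSymb]

/-- **Analytic continuation of the dynamics on spectrally cut-off elements**:
`z ↦ ω(x τ_{𝓕(e_z θ)}(c))` is entire. [folklore] -/
theorem _root_.Literature.MathematicalPhysics.QuantumLattice.State.differentiable_apply_mul_smear_modSymb (ω : Literature.MathematicalPhysics.QuantumLattice.State A) (hτ : Literature.MathematicalPhysics.QuantumLattice.IsAutomorphismGroup τ)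
    (θ : 𝓢(ℝ, ℂ)) (hθ : HasCompactSupport (θ : ℝ → ℂ)) (x c : A) :
    Differentiable ℂ fun z : ℂ => ω (x * smear τ (𝓕 (modSymb θ hθ z : ℝ → ℂ)) c) := by
  have h := differentiable_integral_extKernel_mul (ω.continuous_apply_mul_aut hτ x c)
    (fun u => ω.norm_apply_mul_aut_le x c u) θ hθ
  have heq : (fun z : ℂ => ω (x * smear τ (𝓕 (modSymb θ hθ z : ℝ → ℂ)) c)) =
      fun z : ℂ => ∫ u : ℝ, extKernel θ (u - z) * ω (x * τ u c) :=
    funext fun z => ω.apply_mul_smear_modSymb hτ θ hθ x c z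
  rw [heq]
  exact h

/-- **The spectral bound on the analytic continuation.** For a ground state `ω` (generator
form), a compactly supported symbol `θ`, `c ∈ A` and `Im z ≥ 0`:
`ω(b_z⋆ b_z) ≤ e ‖τ_{𝓕θ}(c)‖²` for `b_z = τ_{𝓕(e_z θ)}(c)` — by the decomposition
`e |θ|² = |e_z θ|² + |ρ|² + η` at height `Im z` (`conjMulSymb_modSymb_decomp`, with
`ε = 1/(16π (Im z + 1))`), positivity of `Λ_{c,c}(|ρ|²)` and the vanishing of the negative
spectral part `Λ_{c,c}(η) = 0`. Formally `‖e^{izH_ω} ψ‖ ≤ ‖ψ‖` for `H_ω ≥ 0`, `Im z ≥ 0`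
(Bratteli–Robinson II Prop. 5.3.19, generator form ⇒ analytic form). [folklore] -/
theorem _root_.Literature.MathematicalPhysics.QuantumLattice.State.IsGroundState.re_apply_star_smear_modSymb_le (hτ : Literature.MathematicalPhysics.QuantumLattice.IsAutomorphismGroup τ)
    {ω : Literature.MathematicalPhysics.QuantumLattice.State A} (hω : ω.IsGroundState τ) (θ : 𝓢(ℝ, ℂ))
    (hθ : HasCompactSupport (θ : ℝ → ℂ)) (c : A) {z : ℂ} (hz : 0 ≤ z.im) :
    (ω (star (smear τ (𝓕 (modSymb θ hθ z : ℝ → ℂ)) c) *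
        smear τ (𝓕 (modSymb θ hθ z : ℝ → ℂ)) c)).re ≤
      Real.exp 1 * ‖smear τ (𝓕 (θ : ℝ → ℂ)) c‖ ^ 2 := by
  have hinv : ∀ (t : ℝ) (x : A), ω (τ t x) = ω x := fun t x =>
    Literature.MathematicalPhysics.QuantumLattice.State.IsGroundState.apply_dynamics_holds hτ hω t x
  set ε : ℝ := 1 / (16 * π * (z.im + 1)) with hεdef
  have hε : 0 < ε := by positivity
  have hzε : 16 * π * z.im * ε ≤ 1 := by
    rw [hεdef, mul_one_div, div_le_one (by positivity)]
    nlinarith [Real.pi_pos, hz]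
  obtain ⟨ρ, η, hρ, hη, hη0, hdec⟩ := conjMulSymb_modSymb_decomp θ hθ hz hε hzε
  set φ : ℝ → ℂ := fun u => ω (star c * τ u c) with hφ
  have hφc : Continuous φ := ω.continuous_apply_mul_aut hτ (star c) c
  have hφb : ∀ u, ‖φ u‖ ≤ ‖c‖ * ‖c‖ := fun u => by
    simpa only [hφ, norm_star] using ω.norm_apply_mul_aut_le (star c) c u
  have hS := congrArg (specPair φ) hdec
  rw [specPair_smul, specPair_add hφc hφb, specPair_add hφc hφb,
    hω.specPair_eq_zero hτ (star c) c η hη hε hη0, add_zero] at hS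
  have h1 := ω.specPair_sq hτ hinv θ hθ c
  have h2 := ω.specPair_sq hτ hinv ρ hρ c
  rw [← ω.specPair_conjMulSymb hτ hinv (modSymb θ hθ z) (modSymb θ hθ z)
    (hasCompactSupport_modSymb θ hθ z) c c]
  have hre := congrArg Complex.re hS
  rw [Complex.re_ofReal_mul, add_re] at hre
  have h3 : Real.exp 1 * (specPair φ (conjMulSymb θ θ hθ)).re ≤
      Real.exp 1 * ‖smear τ (𝓕 (θ : ℝ → ℂ)) c‖ ^ 2 :=
    mul_le_mul_of_nonneg_left h1.2.2 (Real.exp_pos 1).le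
  linarith [h2.2.1]

/-- **Uniform bound on the analytic continuation**: for a ground state `ω` (generator form),
`|ω(x τ_{𝓕(e_z θ)}(c))| ≤ e ‖x‖ ‖τ_{𝓕θ}(c)‖` on `Im z ≥ 0` (Cauchy–Schwarz and
`State.IsGroundState.re_apply_star_smear_modSymb_le`). Bratteli–Robinson II Prop. 5.3.19
(generator form ⇒ analytic form: `|ω(A τ_z(B))| ≤ ‖A‖ ‖B‖`). [folklore] -/
theorem _root_.Literature.MathematicalPhysics.QuantumLattice.State.IsGroundState.norm_apply_mul_smear_modSymb_le (hτ : Literature.MathematicalPhysics.QuantumLattice.IsAutomorphismGroup τ)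
    {ω : Literature.MathematicalPhysics.QuantumLattice.State A} (hω : ω.IsGroundState τ) (θ : 𝓢(ℝ, ℂ))
    (hθ : HasCompactSupport (θ : ℝ → ℂ)) (x c : A) {z : ℂ} (hz : 0 ≤ z.im) :
    ‖ω (x * smear τ (𝓕 (modSymb θ hθ z : ℝ → ℂ)) c)‖ ≤
      Real.exp 1 * ‖x‖ * ‖smear τ (𝓕 (θ : ℝ → ℂ)) c‖ := by
  set bz : A := smear τ (𝓕 (modSymb θ hθ z : ℝ → ℂ)) c with hbz
  set b₀ : A := smear τ (𝓕 (θ : ℝ → ℂ)) c with hb₀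
  have hcs := Literature.MathematicalPhysics.QuantumLattice.State.norm_apply_star_mul_sq_le_holds ω (star x) bz
  rw [star_star] at hcs
  have hA : (ω (x * star x)).re ≤ ‖x‖ ^ 2 :=
    (Complex.re_le_norm _).trans ((Literature.MathematicalPhysics.QuantumLattice.State.norm_apply_le_norm_holds ω _).trans
      ((norm_mul_le _ _).trans (by rw [norm_star, sq])))
  have hB : (ω (star bz * bz)).re ≤ Real.exp 1 * ‖b₀‖ ^ 2 :=
    hω.re_apply_star_smear_modSymb_le hτ θ hθ c hz
  have hB0 : 0 ≤ (ω (star bz * bz)).re :=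
    (Complex.nonneg_iff.mp (ω.map_nonneg (star_mul_self_nonneg bz))).1
  have he : Real.exp 1 ≤ Real.exp 1 ^ 2 := by nlinarith [Real.add_one_le_exp (1 : ℝ)]
  have h : ‖ω (x * bz)‖ ^ 2 ≤ (Real.exp 1 * ‖x‖ * ‖b₀‖) ^ 2 :=
    calc ‖ω (x * bz)‖ ^ 2 ≤ (ω (x * star x)).re * (ω (star bz * bz)).re := hcs
      _ ≤ ‖x‖ ^ 2 * (Real.exp 1 * ‖b₀‖ ^ 2) := mul_le_mul hA hB hB0 (by positivity)
      _ ≤ ‖x‖ ^ 2 * (Real.exp 1 ^ 2 * ‖b₀‖ ^ 2) := by gcongr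
      _ = (Real.exp 1 * ‖x‖ * ‖b₀‖) ^ 2 := by ring
  exact (pow_le_pow_iff_left₀ (norm_nonneg _) (by positivity) two_ne_zero).mp h

/-- **Ground states in the generator form are analytic ground states** (Bratteli–Robinson II Prop.
5.3.19, generator form ⇒ analytic form, for genuine states of the C⋆-algebra `A`,
`[StarOrderedRing A]`): if `-i ω(a⋆ δ(a)) ≥ 0` on `D(δ)`, then for all `a b` the function
`t ↦ ω(a τ_t(b))` is the boundary value of a bounded continuous function on `Im z ≥ 0`, analytic in
`Im z > 0`.

Proof (Stone/Bochner-free version of the printed argument `F(z) = (Ω, π(A) e^{izH} π(B) Ω)`,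
`H ≥ 0`): `ω` is `τ`-invariant (`State.IsGroundState.apply_dynamics_holds`) and its negative
spectral part vanishes (`State.IsGroundState.specPair_eq_zero`); for the spectrally cut-off
approximants `b_n = τ_{𝓕θ_n}(b) → b` (`θ_n = χ(·/(n+1))`, `tendsto_smear_fourier`) the functions
`G_n(z) = ω(a τ_{𝓕(e_z θ_n)}(b))` are entire (`State.differentiable_apply_mul_smear_modSymb`),
restrict to `ω(a τ_t(b_n))` on `ℝ` (`smear_fourier_modSymb_ofReal`) and satisfy
`|G_m(z) - G_n(z)| ≤ e ‖a‖ ‖b_m - b_n‖` on `Im z ≥ 0`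
(`State.IsGroundState.norm_apply_mul_smear_modSymb_le`, linearity in `θ`); their uniform limit
on the closed upper half-plane is the required function.
[cite: BratteliRobinsonII1997, Prop. 5.3.19] -/
theorem _root_.Literature.MathematicalPhysics.QuantumLattice.State.IsGroundState.isKMSGroundState (hτ : Literature.MathematicalPhysics.QuantumLattice.IsAutomorphismGroup τ) {ω : Literature.MathematicalPhysics.QuantumLattice.State A}
    (hω : ω.IsGroundState τ) : ω.IsKMSGroundState τ := by
  intro a b
  -- the approximate identity `𝓕θ_n`, `θ_n = χ(·/(n+1))`
  obtain ⟨χ, hχ⟩ : ∃ χ : 𝓢(ℝ, ℂ), χ = bumpSymb 1 one_pos := ⟨_, rfl⟩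
  obtain ⟨θ, hθ⟩ : ∃ θ : ℕ → 𝓢(ℝ, ℂ), ∀ n, θ n = bumpSymb ((n : ℝ) + 1) (by positivity) :=
    ⟨_, fun n => rfl⟩
  have hθs : ∀ n, HasCompactSupport (θ n : ℝ → ℂ) := fun n => by
    rw [hθ n]; exact hasCompactSupport_bumpSymb _ _
  have hθn : ∀ (n : ℕ) (p : ℝ), θ n p = χ (p / (n + 1)) := fun n p => by
    rw [hθ n, hχ, bumpSymb_apply, bumpSymb_apply, bumpFun_eq_bumpFun_one_div]
  have hχ0 : χ 0 = 1 := by rw [hχ, bumpSymb_apply, bumpFun_zero]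
  set bs : ℕ → A := fun n => smear τ (𝓕 (θ n : ℝ → ℂ)) b with hbs_def
  have hbs : Tendsto bs atTop (𝓝 b) := tendsto_smear_fourier hτ χ hχ0 θ hθn b
  -- the entire functions `G_n`
  set G : ℕ → ℂ → ℂ := fun n z => ω (a * smear τ (𝓕 (modSymb (θ n) (hθs n) z : ℝ → ℂ)) b)
    with hG
  have hGd : ∀ n, Differentiable ℂ (G n) := fun n =>
    ω.differentiable_apply_mul_smear_modSymb hτ (θ n) (hθs n) a b
  have hGt : ∀ (n : ℕ) (t : ℝ), G n t = ω (a * τ t (bs n)) := fun n t => by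
    simp only [hG, hbs_def]
    rw [smear_fourier_modSymb_ofReal hτ]
  set L : ℝ := Real.exp 1 * ‖a‖ with hL
  have hL0 : 0 ≤ L := by positivity
  have hGb : ∀ (n : ℕ) (z : ℂ), 0 ≤ z.im → ‖G n z‖ ≤ L * ‖bs n‖ := fun n z hz =>
    hω.norm_apply_mul_smear_modSymb_le hτ (θ n) (hθs n) a b hz
  -- Step 1: differences are controlled by `‖bs m - bs n‖`
  have hdiff : ∀ (m n : ℕ), ∀ z ∈ {z : ℂ | 0 ≤ z.im}, ‖G m z - G n z‖ ≤ L * ‖bs m - bs n‖ := by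
    intro m n z hz
    have hmn : HasCompactSupport ((θ m - θ n : 𝓢(ℝ, ℂ)) : ℝ → ℂ) := (hθs m).sub (hθs n)
    have h1 : G m z - G n z = ω (a * smear τ (𝓕 (modSymb (θ m - θ n) hmn z : ℝ → ℂ)) b) := by
      simp only [hG]
      rw [smear_fourier_modSymb_sub hτ (θ m) (θ n) (hθs m) (hθs n) hmn b z, mul_sub, map_sub]
    have h2 : bs m - bs n = smear τ (𝓕 ((θ m - θ n : 𝓢(ℝ, ℂ)) : ℝ → ℂ)) b := by
      simp only [hbs_def]
      rw [fourier_schwartz_sub_coe, smear_sub_left hτ (integrable_fourier_schwartz _)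
        (integrable_fourier_schwartz _)]
    rw [h1, h2]
    exact hω.norm_apply_mul_smear_modSymb_le hτ _ hmn a b hz
  -- Step 2: uniformly Cauchy, hence uniformly convergent, on the closed upper half-plane
  have hC : UniformCauchySeqOn G atTop {z : ℂ | 0 ≤ z.im} := by
    rw [Metric.uniformCauchySeqOn_iff]
    intro ε hε
    obtain ⟨N, hN⟩ := Metric.cauchySeq_iff.1 hbs.cauchySeq (ε / (L + 1)) (by positivity)
    refine ⟨N, fun m hm n hn z hz => ?_⟩
    rw [dist_eq_norm]
    calc ‖G m z - G n z‖ ≤ L * ‖bs m - bs n‖ := hdiff m n z hz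
      _ ≤ (L + 1) * ‖bs m - bs n‖ := by gcongr; linarith
      _ < (L + 1) * (ε / (L + 1)) := by
          gcongr
          rw [← dist_eq_norm]
          exact hN m hm n hn
      _ = ε := by field_simp
  have hpt : ∀ z ∈ {z : ℂ | 0 ≤ z.im},
      Tendsto (fun n => G n z) atTop (𝓝 (limUnder atTop fun n => G n z)) :=
    fun z hz => tendsto_nhds_limUnder (cauchySeq_tendsto_of_complete (hC.cauchySeq hz))
  have hU : TendstoUniformlyOn G (fun z => limUnder atTop fun n => G n z) atTop
      {z : ℂ | 0 ≤ z.im} :=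
    hC.tendstoUniformlyOn_of_tendsto hpt
  -- Step 3: the uniform limit is the required function
  have hcont : ∀ t : ℝ, Continuous fun x : A => ω (a * τ t x) := fun t =>
    ω.toContinuousLinearMap.continuous.comp (continuous_const.mul (autCLM τ t).continuous)
  refine ⟨fun z => limUnder atTop fun n => G n z, ?_, ?_, ?_, fun t => ?_⟩
  · exact hU.continuousOn (Frequently.of_forall fun n => (hGd n).continuous.continuousOn)
  · have hU' : TendstoLocallyUniformlyOn G (fun z => limUnder atTop fun n => G n z) atTop
        {z : ℂ | 0 < z.im} :=
      (hU.mono fun z (hz : 0 < z.im) => hz.le).tendstoLocallyUniformlyOn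
    exact hU'.differentiableOn (Eventually.of_forall fun n => (hGd n).differentiableOn)
      (isOpen_lt continuous_const Complex.continuous_im)
  · obtain ⟨N, hN⟩ := ((Metric.tendstoUniformlyOn_iff.1 hU) 1 one_pos).exists
    refine ⟨L * ‖bs N‖ + 1, fun z hz => ?_⟩
    have h1 := hN z hz
    rw [dist_eq_norm] at h1
    exact (norm_le_insert' _ _).trans (add_le_add (hGb N z hz) h1.le)
  · have h1 := hpt t (show 0 ≤ (t : ℂ).im by simp)
    have h2 : Tendsto (fun n => G n t) atTop (𝓝 (ω (a * τ t b))) := by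
      have : (fun n => G n t) = fun n => ω (a * τ t (bs n)) := funext fun n => hGt n t
      rw [this]
      exact ((hcont t).tendsto b).comp hbs
    exact tendsto_nhds_unique h1 h2

/-- **Bratteli–Robinson II Prop. 5.3.19** (generator form ⇔ analytic form of the ground-state
condition), for genuine states of a unital C⋆-algebra
(`[StarOrderedRing A]`) and a strongly continuous one-parameter group of ⋆-automorphisms: the
generator form `-i ω(a⋆ δ(a)) ≥ 0` of the ground-state condition is equivalent to the analytic
(`β = +∞` KMS) form. [cite: BratteliRobinsonII1997, Prop. 5.3.19] -/
theorem _root_.Literature.MathematicalPhysics.QuantumLattice.State.isGroundState_iff_isKMSGroundState' (hτ : Literature.MathematicalPhysics.QuantumLattice.IsAutomorphismGroup τ) (ω : Literature.MathematicalPhysics.QuantumLattice.State A) :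
    ω.IsGroundState τ ↔ ω.IsKMSGroundState τ :=
  ⟨fun h => h.isKMSGroundState hτ, fun h => h.isGroundState hτ⟩

end GeneratorImpliesAnalytic

section CorrectedFact

variable {A : Type*} [CStarAlgebra A] [PartialOrder A] {τ : ℝ → (A ≃⋆ₐ[ℂ] A)}

/-- **Ground states: generator form ⇔ analytic (`β = +∞` KMS) form** — corrected statement of the
named fact `State.isGroundState_iff_isKMSGroundState`
(`Literature/Analysis/FunctionSpaces/KMSStates.lean`). Let `A` be a unital C⋆-algebra *with its
C⋆-order* (`[StarOrderedRing A]`, so that `State A` is the set of genuine states: positive,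
normalised), `τ` a strongly continuous one-parameter group of ⋆-automorphisms with generator `δ`,
and `ω` a state. Then `-i ω(a⋆ δ(a)) ≥ 0` for all `a ∈ D(δ)` (`State.IsGroundState`,
Bratteli–Robinson II Def. 5.3.18; Sakai, *Operator algebras in dynamical systems* (1991),
Def. 4.2.1) iff for all `a b ∈ A` the function `t ↦ ω(a τ_t(b))` extends to a function continuous
and bounded on `Im z ≥ 0` and analytic in `Im z > 0` (`State.IsKMSGroundState`). Bratteli–Robinson
II Prop. 5.3.19 (equivalence of the generator condition with the analytic condition; the printed
proof runs through `τ`-invariance, the GNS covariant representation `U_ω(t) = e^{itH_ω}` and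
`H_ω ≥ 0`, cf. Sakai (1991) Prop. 4.2.2, Prop. 4.2.3 and the `β = +∞` case of Prop. 4.3.5).

Discrepancy with `State.isGroundState_iff_isKMSGroundState`: that declaration sits before
`variable [StarOrderedRing A]` in `KMSStates.lean` and hence quantifies over an ARBITRARY
`[PartialOrder A]`, unrelated to the ⋆-algebra structure, for which `State A` (monotone linear `ω`
with `ω 1 = 1`) need not consist of positive functionals. Positivity of `ω` is essential (it is
what makes `t ↦ ω(a⋆ τ_t(a))` positive-definite), and without it the equivalence is false: on
`A = B(ℂ²)` with the discrete order, `P` the projection onto `e₀`, `τ_t = Ad (e^{it} P + (1 - P))`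
and the (non-positive) normalised functional `ω(x) = x₁₁ + x₀₁`, every `t ↦ ω(a τ_t(b))` equals
`c₀ + c₁ e^{it}` (analytic form holds), while `-i ω(a⋆ δ(a)) = 1 - i` for `a = E₀₁ + i E₀₀`
(generator form fails); this is the sorry-free theorem
`Literature.Analysis.FunctionSpaces.KMSGroundStateCounterexample.not_isGroundState_iff_isKMSGroundState`
(`Literature/Analysis/FunctionSpaces/KMSStatesCounterexample.lean`). The present declaration
only adds the missing instance hypothesis and is otherwise verbatim; it is discharged below
(`State.isGroundState_iff_isKMSGroundState_of_starOrderedRing_holds`).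
[cite: BratteliRobinsonII1997, Prop. 5.3.19] -/
def _root_.Literature.MathematicalPhysics.QuantumLattice.State.isGroundState_iff_isKMSGroundState_of_starOrderedRing [StarOrderedRing A] : Prop :=
  ∀ (_hτ : Literature.MathematicalPhysics.QuantumLattice.IsAutomorphismGroup τ) (ω : Literature.MathematicalPhysics.QuantumLattice.State A),
    ω.IsGroundState τ ↔ ω.IsKMSGroundState τ

variable [StarOrderedRing A]

/-- **Discharge of the corrected named fact
`State.isGroundState_iff_isKMSGroundState_of_starOrderedRing`** (Bratteli–Robinson II Prop. 5.3.19,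
generator form ⇔ analytic form, for genuine states of the C⋆-algebra `A`, `[StarOrderedRing A]`), by
`State.isGroundState_iff_isKMSGroundState'`. [cite: BratteliRobinsonII1997, Prop. 5.3.19] -/
theorem _root_.Literature.MathematicalPhysics.QuantumLattice.State.isGroundState_iff_isKMSGroundState_of_starOrderedRing_holds :
    Literature.MathematicalPhysics.QuantumLattice.State.isGroundState_iff_isKMSGroundState_of_starOrderedRing (A := A) (τ := τ) :=
  fun hτ ω => Literature.MathematicalPhysics.QuantumLattice.State.isGroundState_iff_isKMSGroundState' hτ ω

/-- Corrected form of the named fact `kmsGroundStates_eq` of `KMSStates.lean` (which, like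
`State.isGroundState_iff_isKMSGroundState`, quantifies over an arbitrary `[PartialOrder A]` and is
false in that generality): for the C⋆-order on `A`, the analytic ground states `kmsGroundStates τ`
are exactly the ground states in the generator form. Bratteli–Robinson II Prop. 5.3.19.
[cite: BratteliRobinsonII1997, Prop. 5.3.19] -/
theorem _root_.Literature.MathematicalPhysics.QuantumLattice.State.kmsGroundStates_eq_setOf_isGroundState (hτ : Literature.MathematicalPhysics.QuantumLattice.IsAutomorphismGroup τ) :
    kmsGroundStates τ = {ω : Literature.MathematicalPhysics.QuantumLattice.State A | ω.IsGroundState τ} :=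
  Set.ext fun ω => (Literature.MathematicalPhysics.QuantumLattice.State.isGroundState_iff_isKMSGroundState' hτ ω).symm

end CorrectedFact

end Literature.Analysis.FunctionSpaces
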